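/-
Copyright (c) 2026. All rights reserved.
Released under Apache 2.0 license as described in the file LICENSE.
-/
import Literature.Geometry.Kaehler.ComplexTorusQuaternionXSixAtkinLehnerToolkit
import Literature.Geometry.Kaehler.ComplexTorusQuaternionXSixAtkinLehnerQuotientsSpecialPoints
import Literature.Geometry.Kaehler.ComplexTorusQuaternionXSixSpecialPointsFibres
import HarnessLib

/-!
# The tower `X₆ → X₆^{(d)} → X₆⁺` over the special cycle `Z(t)`, fibre by fibre (every `t`, `d = 2, 3, 6`): a fibre of
# `Pt(t)/Γ₆ → Pt(t)/Γ₆^{(d)}` is `{[τ], [ρ(w_d)τ]}` — ONE class exactly at the `Z(t_d)`-points (`t₂ = 1`, `t₃ = 3`, `t₆ = 6`);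
# a fibre of `Pt(t)/Γ₆^{(d)} → Pt(t)/Γ₆⁺` is `{[τ]_d, [ρ(w_{d′})τ]_d}` — ONE class exactly at the `Z(t_{d′})`- and `Z(t_{6/…})`-points
# of the two OTHER involutions

[tag: complex_torus] [tag: abelian_surface] [tag: quaternion_multiplication] [tag: complex_multiplication]
[tag: shimura_curve] [tag: special_cycles] [tag: atkin_lehner] [tag: elliptic_points]

Lane `lit-hodgefound`, seat p12, row g38-#2 — THEOREMS ONLY (no definition, no named fact, no instance); the first consumer
of the public toolkit `…XSixAtkinLehnerToolkit` (g38-#1). Setting as in all `…XSix…` files: `B = (−1,3)_ℚ`, `𝔬 = ℤ⟨1, i, j, ij⟩`,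
`O₆` as the predicate `a ∈ 𝔬 ∨ a − e ∈ 𝔬`, `Γ₆ = O₆¹`, `ρ`, `Pt(t) = {τ ∈ ℌ : ρ(x)τ = τ, x ∈ 𝔬 ∩ B⁰, nr x = t}`,
`Γ₆⁺ = N(O₆)⁺`, `Γ₆^{(d)} = {g ∈ Γ₆⁺ : nr g ∈ ℚ^{×2}·{1, d}}` (`…XSixAtkinLehnerQuotientsSpecialPoints`), `w₂ = 1 + i`,
`μ = w₃ = 3 + j + ij`, `w₆ = w₂μ = 3 + 3i + 2ij`. The three projections are Mathlib's `Quot.factor` along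
`Γ₆ ⊂ Γ₆^{(d)} ⊂ Γ₆⁺`; fibres are inline subtypes; the maps `[τ] ↦ [ρ(w)τ]` are written on representatives
`⟨ρ(w)τ, _⟩` with the membership proofs `moebius_{w2,mu,w6}_mem_specialPoints`.

## The mechanism (the print)

`Γ₆⁺ = ℚ_{>0}·Γ₆·{1, w₂, μ, w₂μ}` and `Γ₆ ⊲ Γ₆⁺` (Vignéras: «les éléments de `N(𝒪)` de norme réduite positive forment un
groupe … `Γ` est distingué»; Bayer–Travesa: «`Γ₆⁺/Γ₆ ≅ (ℤ/2ℤ)²` … `X₆^{(2)} = X₆/⟨ω₂⟩, X₆^{(3)} = X₆/⟨ω₃⟩, X₆^{(6)} = X₆/⟨ω₆⟩` and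
`X₆⁺ = X₆/W`»), so `W = {1, ω₂, ω₃, ω₆} ≅ (ℤ/2ℤ)²` acts on `Pt(t)/Γ₆` (KRY Remark 3.4.7: «the group of Atkin-Lehner involutions
permutes the components») with `Pt(t)/Γ₆^{(d)} = (Pt(t)/Γ₆)/⟨ω_d⟩` and `Pt(t)/Γ₆⁺ = (Pt(t)/Γ₆)/W`; the class `[τ]` is fixed
by `ω_d` iff `τ ∈ Pt(t_d)` (Ogg's fixed points of `w(m)`, `…XSixSpecialPointsBurnside`). Hence the fibre of
`X₆ → X₆^{(d)}` over `[τ]_d` is the `⟨ω_d⟩`-orbit `{[τ], ω_d[τ]}`, and the fibre of `X₆^{(d)} → X₆⁺` over `[τ]⁺` is the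
`W/⟨ω_d⟩`-orbit `{[τ]_d, ω_{d′}[τ]_d}`, of one class iff `ω_{d′}[τ] ∈ {[τ], ω_d[τ]}` iff `τ ∈ Pt(t_{d′}) ∪ Pt(t_{d″})`
(`{d, d′, d″} = {2, 3, 6}`).

* P. Bayer, A. Travesa (2007), §2 p. 318; §7 p. 332 («`P₀` is an elliptic point for `X₆^{(6)}` and `X₆⁺`, but it is not
  elliptic for `X₆`, `X₆^{(2)}` and `X₆^{(3)}`»), Table 9. [cite: BayerTravesa2007, §2 p. 318 and §7]
* A. P. Ogg (1983), §2 pp. 283–284, (2)–(4) (fixed points of `w(m)`; `X → X/⟨w(m)⟩`). [cite: Ogg1983RealPoints, §2]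
* S. Kudla, M. Rapoport, T. Yang (2006), §3.4 (3.4.9)–(3.4.11) and Remark 3.4.7. [cite: KudlaRapoportYang2006, §3.4]
* M.-F. Vignéras (1980), Ch. IV §3 B. [cite: VignerasLNM800, Ch. IV §3 B]

## What is proved

* §1 the tower: **`atkinLehnerQuotient_rel_of_specialPoints_rel`** (`Γ₆ ⊂ Γ₆^{(d)}`), **`specialPointsPlus_rel_of_atkinLehnerQuotient_rel`**
  (`Γ₆^{(d)} ⊂ Γ₆⁺`), **`factor_atkinLehnerQuotient_factor`** (`X₆ → X₆^{(d)} → X₆⁺` composes to `X₆ → X₆⁺` on `Z(t)`),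
  **`finite_atkinLehnerQuotient`** (`t > 0`).
* §2 **`atkinLehnerQuotient{Two,Three,Six}_rel_iff`**: `p ∼_{Γ₆^{(d)}} q ⟺ q = ρ(v)p ∨ q = ρ(v)ρ(w_d)p` for some `v ∈ Γ₆`
  (`Γ₆^{(d)} = ℚ^×Γ₆{1, w_d}`).
* §3 `X₆ → X₆^{(d)}` on `Z(t)`: **`factor_mk_eq_mk_iff_atkinLehnerQuotient{Two,Three,Six}`** (the fibre through `[τ]` is
  `{[τ], [ρ(w_d)τ]}`), **`card_fibre_atkinLehnerQuotient{Two,Three,Six}_eq_one_iff`** (`⟺ τ ∈ Pt(1)`, `Pt(3)`, `Pt(6)`),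
  **`…_eq_two_iff`**, **`…_eq_one_or_eq_two`**, and the class equations **`card_specialPoints_add_card_oneFibres_eq_two_mul_card_atkinLehnerQuotient{Two,Three,Six}`**
  (`#(Pt(t)/Γ₆) + #{one-class fibres} = 2·#(Pt(t)/Γ₆^{(d)})`, `t > 0`) with **`card_oneFibres_atkinLehnerQuotient{Two,Three,Six}_eq_card_inter`**
  (the one-class fibres are counted by `#((Pt(t) ∩ Pt(t_d))/Γ₆)` of `…XSixAtkinLehnerQuotientsSpecialPoints`).
* §4 `X₆^{(d)} → X₆⁺` on `Z(t)`: **`factor_mk_eq_mk_iff_specialPointsPlus`** (the fibre of `X₆ → X₆⁺` through `[τ]` is the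
  `W`-orbit `{[τ], [ρ(w₂)τ], [ρ(μ)τ], [ρ(w₂)ρ(μ)τ]}`), **`factorPlus_mk_eq_mk_iff_atkinLehnerQuotient{Two,Three,Six}`**
  (the fibre through `[τ]_d` is `{[τ]_d, [ρ(w_{d′})τ]_d}`, `w_{2′} = μ`, `w_{3′} = w_{6′} = w₂`),
  **`card_plusFibre_atkinLehnerQuotientTwo_eq_one_iff`** (`⟺ τ ∈ Pt(3) ∪ Pt(6)`), **`…Three_eq_one_iff`** (`⟺ τ ∈ Pt(1) ∪ Pt(6)`),
  **`…Six_eq_one_iff`** (`⟺ τ ∈ Pt(1) ∪ Pt(3)`), **`…_eq_two_iff`**, **`…_eq_one_or_eq_two`**, and the class equations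
  **`card_atkinLehnerQuotient{Two,Three,Six}_add_card_onePlusFibres_eq_two_mul_card_specialPointsPlus`** (`t > 0`).

## Honest scope

Statements about the bare quotient TYPES and `Quot.factor` maps of the `…XSix…` files; nothing identifies them with points
of algebraic models of `X₆^{(d)}`, `X₆⁺` or with ramification divisors (Bayer–Travesa's `P₀, …` are not named). 0 definitions,
0 named facts, 0 instances — net debt `0`.
-/

noncomputable section

set_option maxSynthPendingDepth 3

open Quaternion Function

namespace Literature.Geometry.Kaehler.ComplexTorus.QuaternionType

/-! ## §0 Helpers -/

section Helpers

/-- A subtype cut out by `b = x ∨ b = y` with `y = x` has one element. [folklore] -/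
private theorem card_eq_one_of_iff_eq_or_eq₂₁ {Q : Type*} {F : Q → Prop} {x y : Q} (hF : ∀ b, F b ↔ b = x ∨ b = y)
    (h : y = x) : Nat.card {b // F b} = 1 := by
  rw [Nat.card_eq_one_iff_unique]
  refine ⟨⟨fun a b ↦ Subtype.ext ?_⟩, ⟨⟨x, (hF x).2 (Or.inl rfl)⟩⟩⟩
  have ha := (hF a.1).1 a.2
  have hb := (hF b.1).1 b.2
  rw [h, or_self] at ha hb
  rw [ha, hb]

/-- A subtype cut out by `b = x ∨ b = y` with `y ≠ x` has two elements. [folklore] -/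
private theorem card_eq_two_of_iff_eq_or_eq₂₁ {Q : Type*} {F : Q → Prop} {x y : Q} (hF : ∀ b, F b ↔ b = x ∨ b = y)
    (h : y ≠ x) : Nat.card {b // F b} = 2 := by
  rw [Nat.card_eq_two_iff]
  refine ⟨⟨x, (hF x).2 (Or.inl rfl)⟩, ⟨y, (hF y).2 (Or.inr rfl)⟩, fun e ↦ h (congrArg Subtype.val e).symm, ?_⟩
  rw [Set.eq_univ_iff_forall]
  rintro ⟨b, hb⟩
  simp only [Set.mem_insert_iff, Set.mem_singleton_iff, Subtype.mk.injEq]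
  exact (hF b).1 hb

/-- … so it has one or two elements, one iff `y = x`, two iff `y ≠ x`. [folklore] -/
private theorem card_eq_one_iff_of_iff_eq_or_eq₂₁ {Q : Type*} {F : Q → Prop} {x y : Q} (hF : ∀ b, F b ↔ b = x ∨ b = y) :
    (Nat.card {b // F b} = 1 ↔ y = x) ∧ (Nat.card {b // F b} = 2 ↔ y ≠ x) ∧
    (Nat.card {b // F b} = 1 ∨ Nat.card {b // F b} = 2) := by
  by_cases h : y = x
  · have h1 := card_eq_one_of_iff_eq_or_eq₂₁ hF h
    exact ⟨⟨fun _ ↦ h, fun _ ↦ h1⟩, ⟨fun h2 ↦ by omega, fun hne ↦ absurd h hne⟩, Or.inl h1⟩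
  · have h2 := card_eq_two_of_iff_eq_or_eq₂₁ hF h
    exact ⟨⟨fun h1 ↦ by omega, fun he ↦ absurd he h⟩, ⟨fun _ ↦ h, fun _ ↦ h2⟩, Or.inr h2⟩

/-- **Fibres of size `1` or `2`**: `|Q| + #{c : |f⁻¹(c)| = 1} = 2·|Q'|`. [folklore] -/
private theorem card_add_card_eq_two_mul₂₁ {Q Q' : Type*} [Finite Q] [Finite Q'] (f : Q → Q')
    (h12 : ∀ c, Nat.card {a // f a = c} = 1 ∨ Nat.card {a // f a = c} = 2) :
    Nat.card Q + Nat.card {c // Nat.card {a // f a = c} = 1} = 2 * Nat.card Q' := by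
  classical
  letI := Fintype.ofFinite Q'
  have hsig : Nat.card Q = ∑ c, Nat.card {a // f a = c} := by
    rw [← Nat.card_congr (Equiv.sigmaFiberEquiv f), Nat.card_sigma]
  have hc : ∀ c, Nat.card {a // f a = c} + (if Nat.card {a // f a = c} = 1 then 1 else 0) = 2 := by
    intro c
    rcases h12 c with h | h <;> simp [h]
  have hs := Finset.sum_congr rfl (fun c (_ : c ∈ (Finset.univ : Finset Q')) ↦ hc c)
  rw [Finset.sum_add_distrib] at hs
  simp only [Finset.sum_boole, Nat.cast_id, Finset.sum_const, smul_eq_mul, Finset.card_univ] at hs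
  rw [← hsig, ← Fintype.card_subtype, ← Nat.card_eq_fintype_card, ← Nat.card_eq_fintype_card] at hs
  omega

/-- `Quot.factor` is onto. [folklore] -/
private theorem factor_surjective₂₁ {α : Type*} (r s : α → α → Prop) (h : ∀ a b, r a b → s a b) :
    Function.Surjective (Quot.factor r s h) := by
  intro c
  induction c using Quot.ind with
  | _ a => exact ⟨Quot.mk r a, rfl⟩

/-- `nr w₂ = 2`. [folklore] -/
private theorem norm_w2₂₁ : ((⟨1, 1, 0, 0⟩ : ℍ[ℚ,((-1 : ℤ) : ℚ),((3 : ℤ) : ℚ)]) * star ⟨1, 1, 0, 0⟩).re = 2 := by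
  rw [QuaternionAlgebra.star_mk, QuaternionAlgebra.mk_mul_mk]; norm_num

/-- `nr μ = 3`. [folklore] -/
private theorem norm_mu₂₁ : ((⟨3, 0, 1, 1⟩ : ℍ[ℚ,((-1 : ℤ) : ℚ),((3 : ℤ) : ℚ)]) * star ⟨3, 0, 1, 1⟩).re = 3 := by
  rw [QuaternionAlgebra.star_mk, QuaternionAlgebra.mk_mul_mk]; norm_num

/-- `nr w₆ = 6`. [folklore] -/
private theorem norm_w6₂₁ : ((⟨3, 3, 0, 2⟩ : ℍ[ℚ,((-1 : ℤ) : ℚ),((3 : ℤ) : ℚ)]) * star ⟨3, 3, 0, 2⟩).re = 6 := by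
  rw [QuaternionAlgebra.star_mk, QuaternionAlgebra.mk_mul_mk]; norm_num

/-- `w₂, μ, w₆` normalise `O₆` on the left. [folklore] -/
private theorem normalises_w2_mu_w6₂₁ :
    (∀ a : ℍ[ℚ,((-1 : ℤ) : ℚ),((3 : ℤ) : ℚ)], (a ∈ order (-1) 3 ∨ a - ⟨1/2, 1/2, 1/2, -1/2⟩ ∈ order (-1) 3) →
      ∃ b : ℍ[ℚ,((-1 : ℤ) : ℚ),((3 : ℤ) : ℚ)], (b ∈ order (-1) 3 ∨ b - ⟨1/2, 1/2, 1/2, -1/2⟩ ∈ order (-1) 3) ∧ (⟨1, 1, 0, 0⟩ : ℍ[ℚ,((-1 : ℤ) : ℚ),((3 : ℤ) : ℚ)]) * a = b * (⟨1, 1, 0, 0⟩ : ℍ[ℚ,((-1 : ℤ) : ℚ),((3 : ℤ) : ℚ)])) ∧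
    (∀ a : ℍ[ℚ,((-1 : ℤ) : ℚ),((3 : ℤ) : ℚ)], (a ∈ order (-1) 3 ∨ a - ⟨1/2, 1/2, 1/2, -1/2⟩ ∈ order (-1) 3) →
      ∃ b : ℍ[ℚ,((-1 : ℤ) : ℚ),((3 : ℤ) : ℚ)], (b ∈ order (-1) 3 ∨ b - ⟨1/2, 1/2, 1/2, -1/2⟩ ∈ order (-1) 3) ∧ (⟨3, 0, 1, 1⟩ : ℍ[ℚ,((-1 : ℤ) : ℚ),((3 : ℤ) : ℚ)]) * a = b * (⟨3, 0, 1, 1⟩ : ℍ[ℚ,((-1 : ℤ) : ℚ),((3 : ℤ) : ℚ)])) ∧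
    (∀ a : ℍ[ℚ,((-1 : ℤ) : ℚ),((3 : ℤ) : ℚ)], (a ∈ order (-1) 3 ∨ a - ⟨1/2, 1/2, 1/2, -1/2⟩ ∈ order (-1) 3) →
      ∃ b : ℍ[ℚ,((-1 : ℤ) : ℚ),((3 : ℤ) : ℚ)], (b ∈ order (-1) 3 ∨ b - ⟨1/2, 1/2, 1/2, -1/2⟩ ∈ order (-1) 3) ∧ (⟨3, 3, 0, 2⟩ : ℍ[ℚ,((-1 : ℤ) : ℚ),((3 : ℤ) : ℚ)]) * a = b * (⟨3, 3, 0, 2⟩ : ℍ[ℚ,((-1 : ℤ) : ℚ),((3 : ℤ) : ℚ)])) := by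
  have h1O : ((1 : ℍ[ℚ,((-1 : ℤ) : ℚ),((3 : ℤ) : ℚ)]) ∈ order (-1) 3 ∨ (1 : ℍ[ℚ,((-1 : ℤ) : ℚ),((3 : ℤ) : ℚ)]) - ⟨1/2, 1/2, 1/2, -1/2⟩ ∈ order (-1) 3) := Or.inl (Subring.one_mem _)
  have h11 : (1 : ℍ[ℚ,((-1 : ℤ) : ℚ),((3 : ℤ) : ℚ)]) * star 1 = 1 := by rw [star_one, mul_one]
  have hw6 : (⟨1, 1, 0, 0⟩ : ℍ[ℚ,((-1 : ℤ) : ℚ),((3 : ℤ) : ℚ)]) * ⟨3, 0, 1, 1⟩ = ⟨3, 3, 0, 2⟩ := (pureVec_mul_w6 0 0 0).1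
  have h2 := (normOne_mul_word_normalises h1O h11 1 0).2.1
  have h3 := (normOne_mul_word_normalises h1O h11 0 1).2.1
  have h6 := (normOne_mul_word_normalises h1O h11 1 1).2.1
  simp only [pow_one, pow_zero, mul_one, one_mul] at h2 h3 h6
  rw [hw6] at h6
  exact ⟨h2, h3, h6⟩

/-- **THE INVOLUTIONS `ω₂, ω₃, ω₆` ARE WELL DEFINED ON `Pt(t)/Γ₆`**: the three lifts `τ ↦ ρ(w₂)τ, ρ(μ)τ, ρ(w₆)τ` of `Pt(t)`
respect `Γ₆`-equivalence (`Γ₆ ⊲ Γ₆⁺`; `specialPoints_rel_map_of_normalises`). [cite: BayerTravesa2007, §2 p. 318 («They give rise to involutions of the curve `X₆`, denoted `ω_d`»)] [cite: VignerasLNM800, Ch. IV §3 B («`Γ` est distingué dans `G`»)] -/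
theorem specialPoints_rel_map_w2_mu_w6 (t : ℤ) :
    (∀ p q : {τ : ℂ // 0 < τ.im ∧ ∃ x : ℍ[ℚ,((-1 : ℤ) : ℚ),((3 : ℤ) : ℚ)],
        x ∈ order (-1) 3 ∧ x.re = 0 ∧ (x * star x).re = t ∧ moebius (rho (-1) 3 (by norm_num) (castQ (-1) 3 x)) τ = τ},
      (∃ v : ℍ[ℚ,((-1 : ℤ) : ℚ),((3 : ℤ) : ℚ)], (v ∈ order (-1) 3 ∨ v - ⟨1/2, 1/2, 1/2, -1/2⟩ ∈ order (-1) 3) ∧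
        v * star v = 1 ∧ moebius (rho (-1) 3 (by norm_num) (castQ (-1) 3 v)) p.1 = q.1) →
      ∃ v : ℍ[ℚ,((-1 : ℤ) : ℚ),((3 : ℤ) : ℚ)], (v ∈ order (-1) 3 ∨ v - ⟨1/2, 1/2, 1/2, -1/2⟩ ∈ order (-1) 3) ∧
        v * star v = 1 ∧ moebius (rho (-1) 3 (by norm_num) (castQ (-1) 3 v)) (⟨moebius (rho (-1) 3 (by norm_num) (castQ (-1) 3 (⟨1, 1, 0, 0⟩ : ℍ[ℚ,((-1 : ℤ) : ℚ),((3 : ℤ) : ℚ)]))) p.1, moebius_w2_mem_specialPoints p.2.1 p.2.2⟩ : {τ : ℂ // 0 < τ.im ∧ ∃ x : ℍ[ℚ,((-1 : ℤ) : ℚ),((3 : ℤ) : ℚ)],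
        x ∈ order (-1) 3 ∧ x.re = 0 ∧ (x * star x).re = t ∧ moebius (rho (-1) 3 (by norm_num) (castQ (-1) 3 x)) τ = τ}).1 = (⟨moebius (rho (-1) 3 (by norm_num) (castQ (-1) 3 (⟨1, 1, 0, 0⟩ : ℍ[ℚ,((-1 : ℤ) : ℚ),((3 : ℤ) : ℚ)]))) q.1, moebius_w2_mem_specialPoints q.2.1 q.2.2⟩ : {τ : ℂ // 0 < τ.im ∧ ∃ x : ℍ[ℚ,((-1 : ℤ) : ℚ),((3 : ℤ) : ℚ)],
        x ∈ order (-1) 3 ∧ x.re = 0 ∧ (x * star x).re = t ∧ moebius (rho (-1) 3 (by norm_num) (castQ (-1) 3 x)) τ = τ}).1) ∧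
    (∀ p q : {τ : ℂ // 0 < τ.im ∧ ∃ x : ℍ[ℚ,((-1 : ℤ) : ℚ),((3 : ℤ) : ℚ)],
        x ∈ order (-1) 3 ∧ x.re = 0 ∧ (x * star x).re = t ∧ moebius (rho (-1) 3 (by norm_num) (castQ (-1) 3 x)) τ = τ},
      (∃ v : ℍ[ℚ,((-1 : ℤ) : ℚ),((3 : ℤ) : ℚ)], (v ∈ order (-1) 3 ∨ v - ⟨1/2, 1/2, 1/2, -1/2⟩ ∈ order (-1) 3) ∧
        v * star v = 1 ∧ moebius (rho (-1) 3 (by norm_num) (castQ (-1) 3 v)) p.1 = q.1) →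
      ∃ v : ℍ[ℚ,((-1 : ℤ) : ℚ),((3 : ℤ) : ℚ)], (v ∈ order (-1) 3 ∨ v - ⟨1/2, 1/2, 1/2, -1/2⟩ ∈ order (-1) 3) ∧
        v * star v = 1 ∧ moebius (rho (-1) 3 (by norm_num) (castQ (-1) 3 v)) (⟨moebius (rho (-1) 3 (by norm_num) (castQ (-1) 3 (⟨3, 0, 1, 1⟩ : ℍ[ℚ,((-1 : ℤ) : ℚ),((3 : ℤ) : ℚ)]))) p.1, moebius_mu_mem_specialPoints p.2.1 p.2.2⟩ : {τ : ℂ // 0 < τ.im ∧ ∃ x : ℍ[ℚ,((-1 : ℤ) : ℚ),((3 : ℤ) : ℚ)],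
        x ∈ order (-1) 3 ∧ x.re = 0 ∧ (x * star x).re = t ∧ moebius (rho (-1) 3 (by norm_num) (castQ (-1) 3 x)) τ = τ}).1 = (⟨moebius (rho (-1) 3 (by norm_num) (castQ (-1) 3 (⟨3, 0, 1, 1⟩ : ℍ[ℚ,((-1 : ℤ) : ℚ),((3 : ℤ) : ℚ)]))) q.1, moebius_mu_mem_specialPoints q.2.1 q.2.2⟩ : {τ : ℂ // 0 < τ.im ∧ ∃ x : ℍ[ℚ,((-1 : ℤ) : ℚ),((3 : ℤ) : ℚ)],
        x ∈ order (-1) 3 ∧ x.re = 0 ∧ (x * star x).re = t ∧ moebius (rho (-1) 3 (by norm_num) (castQ (-1) 3 x)) τ = τ}).1) ∧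
    (∀ p q : {τ : ℂ // 0 < τ.im ∧ ∃ x : ℍ[ℚ,((-1 : ℤ) : ℚ),((3 : ℤ) : ℚ)],
        x ∈ order (-1) 3 ∧ x.re = 0 ∧ (x * star x).re = t ∧ moebius (rho (-1) 3 (by norm_num) (castQ (-1) 3 x)) τ = τ},
      (∃ v : ℍ[ℚ,((-1 : ℤ) : ℚ),((3 : ℤ) : ℚ)], (v ∈ order (-1) 3 ∨ v - ⟨1/2, 1/2, 1/2, -1/2⟩ ∈ order (-1) 3) ∧
        v * star v = 1 ∧ moebius (rho (-1) 3 (by norm_num) (castQ (-1) 3 v)) p.1 = q.1) →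
      ∃ v : ℍ[ℚ,((-1 : ℤ) : ℚ),((3 : ℤ) : ℚ)], (v ∈ order (-1) 3 ∨ v - ⟨1/2, 1/2, 1/2, -1/2⟩ ∈ order (-1) 3) ∧
        v * star v = 1 ∧ moebius (rho (-1) 3 (by norm_num) (castQ (-1) 3 v)) (⟨moebius (rho (-1) 3 (by norm_num) (castQ (-1) 3 (⟨3, 3, 0, 2⟩ : ℍ[ℚ,((-1 : ℤ) : ℚ),((3 : ℤ) : ℚ)]))) p.1, moebius_w6_mem_specialPoints p.2.1 p.2.2⟩ : {τ : ℂ // 0 < τ.im ∧ ∃ x : ℍ[ℚ,((-1 : ℤ) : ℚ),((3 : ℤ) : ℚ)],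
        x ∈ order (-1) 3 ∧ x.re = 0 ∧ (x * star x).re = t ∧ moebius (rho (-1) 3 (by norm_num) (castQ (-1) 3 x)) τ = τ}).1 = (⟨moebius (rho (-1) 3 (by norm_num) (castQ (-1) 3 (⟨3, 3, 0, 2⟩ : ℍ[ℚ,((-1 : ℤ) : ℚ),((3 : ℤ) : ℚ)]))) q.1, moebius_w6_mem_specialPoints q.2.1 q.2.2⟩ : {τ : ℂ // 0 < τ.im ∧ ∃ x : ℍ[ℚ,((-1 : ℤ) : ℚ),((3 : ℤ) : ℚ)],
        x ∈ order (-1) 3 ∧ x.re = 0 ∧ (x * star x).re = t ∧ moebius (rho (-1) 3 (by norm_num) (castQ (-1) 3 x)) τ = τ}).1) :=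
  ⟨specialPoints_rel_map_of_normalises ⟨1, 1, 0, 0⟩ (fun p ↦ (⟨moebius (rho (-1) 3 (by norm_num) (castQ (-1) 3 (⟨1, 1, 0, 0⟩ : ℍ[ℚ,((-1 : ℤ) : ℚ),((3 : ℤ) : ℚ)]))) p.1, moebius_w2_mem_specialPoints p.2.1 p.2.2⟩ : {τ : ℂ // 0 < τ.im ∧ ∃ x : ℍ[ℚ,((-1 : ℤ) : ℚ),((3 : ℤ) : ℚ)],
        x ∈ order (-1) 3 ∧ x.re = 0 ∧ (x * star x).re = t ∧ moebius (rho (-1) 3 (by norm_num) (castQ (-1) 3 x)) τ = τ})) (by rw [norm_w2₂₁]; norm_num)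
      normalises_w2_mu_w6₂₁.1 (fun _ ↦ rfl),
    specialPoints_rel_map_of_normalises ⟨3, 0, 1, 1⟩ (fun p ↦ (⟨moebius (rho (-1) 3 (by norm_num) (castQ (-1) 3 (⟨3, 0, 1, 1⟩ : ℍ[ℚ,((-1 : ℤ) : ℚ),((3 : ℤ) : ℚ)]))) p.1, moebius_mu_mem_specialPoints p.2.1 p.2.2⟩ : {τ : ℂ // 0 < τ.im ∧ ∃ x : ℍ[ℚ,((-1 : ℤ) : ℚ),((3 : ℤ) : ℚ)],
        x ∈ order (-1) 3 ∧ x.re = 0 ∧ (x * star x).re = t ∧ moebius (rho (-1) 3 (by norm_num) (castQ (-1) 3 x)) τ = τ})) (by rw [norm_mu₂₁]; norm_num)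
      normalises_w2_mu_w6₂₁.2.1 (fun _ ↦ rfl),
    specialPoints_rel_map_of_normalises ⟨3, 3, 0, 2⟩ (fun p ↦ (⟨moebius (rho (-1) 3 (by norm_num) (castQ (-1) 3 (⟨3, 3, 0, 2⟩ : ℍ[ℚ,((-1 : ℤ) : ℚ),((3 : ℤ) : ℚ)]))) p.1, moebius_w6_mem_specialPoints p.2.1 p.2.2⟩ : {τ : ℂ // 0 < τ.im ∧ ∃ x : ℍ[ℚ,((-1 : ℤ) : ℚ),((3 : ℤ) : ℚ)],
        x ∈ order (-1) 3 ∧ x.re = 0 ∧ (x * star x).re = t ∧ moebius (rho (-1) 3 (by norm_num) (castQ (-1) 3 x)) τ = τ})) (by rw [norm_w6₂₁]; norm_num)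
      normalises_w2_mu_w6₂₁.2.2 (fun _ ↦ rfl)⟩

/-- **THE KLEIN FOUR-GROUP RELATIONS ON `Pt(t)/Γ₆`**: `[ρ(w₂)ρ(w₂)τ] = [τ]`, `[ρ(μ)ρ(μ)τ] = [τ]`, `[ρ(w₂)ρ(μ)τ] = [ρ(μ)ρ(w₂)τ]`,
and `ρ(w₆)τ = ρ(w₂)ρ(μ)τ` as points of `Pt(t)` — `ω₂² = ω₃² = 1`, `ω₂ω₃ = ω₃ω₂ = ω₆`, `W ≅ (ℤ/2ℤ)²`. [cite: Ogg1983RealPoints, §2 (2) («`W ≃ C₂^r`»)] [cite: BayerTravesa2007, §2 p. 318 («`Γ₆⁺/Γ₆ ≅ (ℤ/2ℤ)²`»)] -/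
theorem specialPoints_mk_klein {t : ℤ} (p : {τ : ℂ // 0 < τ.im ∧ ∃ x : ℍ[ℚ,((-1 : ℤ) : ℚ),((3 : ℤ) : ℚ)],
        x ∈ order (-1) 3 ∧ x.re = 0 ∧ (x * star x).re = t ∧ moebius (rho (-1) 3 (by norm_num) (castQ (-1) 3 x)) τ = τ}) :
    Quot.mk (fun p q : {τ : ℂ // 0 < τ.im ∧ ∃ x : ℍ[ℚ,((-1 : ℤ) : ℚ),((3 : ℤ) : ℚ)],
        x ∈ order (-1) 3 ∧ x.re = 0 ∧ (x * star x).re = t ∧ moebius (rho (-1) 3 (by norm_num) (castQ (-1) 3 x)) τ = τ} ↦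
      ∃ v : ℍ[ℚ,((-1 : ℤ) : ℚ),((3 : ℤ) : ℚ)], (v ∈ order (-1) 3 ∨ v - ⟨1/2, 1/2, 1/2, -1/2⟩ ∈ order (-1) 3) ∧
        v * star v = 1 ∧ moebius (rho (-1) 3 (by norm_num) (castQ (-1) 3 v)) p.1 = q.1) (⟨moebius (rho (-1) 3 (by norm_num) (castQ (-1) 3 (⟨1, 1, 0, 0⟩ : ℍ[ℚ,((-1 : ℤ) : ℚ),((3 : ℤ) : ℚ)]))) (⟨moebius (rho (-1) 3 (by norm_num) (castQ (-1) 3 (⟨1, 1, 0, 0⟩ : ℍ[ℚ,((-1 : ℤ) : ℚ),((3 : ℤ) : ℚ)]))) p.1, moebius_w2_mem_specialPoints p.2.1 p.2.2⟩ : {τ : ℂ // 0 < τ.im ∧ ∃ x : ℍ[ℚ,((-1 : ℤ) : ℚ),((3 : ℤ) : ℚ)],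
        x ∈ order (-1) 3 ∧ x.re = 0 ∧ (x * star x).re = t ∧ moebius (rho (-1) 3 (by norm_num) (castQ (-1) 3 x)) τ = τ}).1, moebius_w2_mem_specialPoints (⟨moebius (rho (-1) 3 (by norm_num) (castQ (-1) 3 (⟨1, 1, 0, 0⟩ : ℍ[ℚ,((-1 : ℤ) : ℚ),((3 : ℤ) : ℚ)]))) p.1, moebius_w2_mem_specialPoints p.2.1 p.2.2⟩ : {τ : ℂ // 0 < τ.im ∧ ∃ x : ℍ[ℚ,((-1 : ℤ) : ℚ),((3 : ℤ) : ℚ)],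
        x ∈ order (-1) 3 ∧ x.re = 0 ∧ (x * star x).re = t ∧ moebius (rho (-1) 3 (by norm_num) (castQ (-1) 3 x)) τ = τ}).2.1 (⟨moebius (rho (-1) 3 (by norm_num) (castQ (-1) 3 (⟨1, 1, 0, 0⟩ : ℍ[ℚ,((-1 : ℤ) : ℚ),((3 : ℤ) : ℚ)]))) p.1, moebius_w2_mem_specialPoints p.2.1 p.2.2⟩ : {τ : ℂ // 0 < τ.im ∧ ∃ x : ℍ[ℚ,((-1 : ℤ) : ℚ),((3 : ℤ) : ℚ)],
        x ∈ order (-1) 3 ∧ x.re = 0 ∧ (x * star x).re = t ∧ moebius (rho (-1) 3 (by norm_num) (castQ (-1) 3 x)) τ = τ}).2.2⟩ : {τ : ℂ // 0 < τ.im ∧ ∃ x : ℍ[ℚ,((-1 : ℤ) : ℚ),((3 : ℤ) : ℚ)],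
        x ∈ order (-1) 3 ∧ x.re = 0 ∧ (x * star x).re = t ∧ moebius (rho (-1) 3 (by norm_num) (castQ (-1) 3 x)) τ = τ}) = Quot.mk _ p ∧
    Quot.mk (fun p q : {τ : ℂ // 0 < τ.im ∧ ∃ x : ℍ[ℚ,((-1 : ℤ) : ℚ),((3 : ℤ) : ℚ)],
        x ∈ order (-1) 3 ∧ x.re = 0 ∧ (x * star x).re = t ∧ moebius (rho (-1) 3 (by norm_num) (castQ (-1) 3 x)) τ = τ} ↦
      ∃ v : ℍ[ℚ,((-1 : ℤ) : ℚ),((3 : ℤ) : ℚ)], (v ∈ order (-1) 3 ∨ v - ⟨1/2, 1/2, 1/2, -1/2⟩ ∈ order (-1) 3) ∧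
        v * star v = 1 ∧ moebius (rho (-1) 3 (by norm_num) (castQ (-1) 3 v)) p.1 = q.1) (⟨moebius (rho (-1) 3 (by norm_num) (castQ (-1) 3 (⟨3, 0, 1, 1⟩ : ℍ[ℚ,((-1 : ℤ) : ℚ),((3 : ℤ) : ℚ)]))) (⟨moebius (rho (-1) 3 (by norm_num) (castQ (-1) 3 (⟨3, 0, 1, 1⟩ : ℍ[ℚ,((-1 : ℤ) : ℚ),((3 : ℤ) : ℚ)]))) p.1, moebius_mu_mem_specialPoints p.2.1 p.2.2⟩ : {τ : ℂ // 0 < τ.im ∧ ∃ x : ℍ[ℚ,((-1 : ℤ) : ℚ),((3 : ℤ) : ℚ)],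
        x ∈ order (-1) 3 ∧ x.re = 0 ∧ (x * star x).re = t ∧ moebius (rho (-1) 3 (by norm_num) (castQ (-1) 3 x)) τ = τ}).1, moebius_mu_mem_specialPoints (⟨moebius (rho (-1) 3 (by norm_num) (castQ (-1) 3 (⟨3, 0, 1, 1⟩ : ℍ[ℚ,((-1 : ℤ) : ℚ),((3 : ℤ) : ℚ)]))) p.1, moebius_mu_mem_specialPoints p.2.1 p.2.2⟩ : {τ : ℂ // 0 < τ.im ∧ ∃ x : ℍ[ℚ,((-1 : ℤ) : ℚ),((3 : ℤ) : ℚ)],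
        x ∈ order (-1) 3 ∧ x.re = 0 ∧ (x * star x).re = t ∧ moebius (rho (-1) 3 (by norm_num) (castQ (-1) 3 x)) τ = τ}).2.1 (⟨moebius (rho (-1) 3 (by norm_num) (castQ (-1) 3 (⟨3, 0, 1, 1⟩ : ℍ[ℚ,((-1 : ℤ) : ℚ),((3 : ℤ) : ℚ)]))) p.1, moebius_mu_mem_specialPoints p.2.1 p.2.2⟩ : {τ : ℂ // 0 < τ.im ∧ ∃ x : ℍ[ℚ,((-1 : ℤ) : ℚ),((3 : ℤ) : ℚ)],
        x ∈ order (-1) 3 ∧ x.re = 0 ∧ (x * star x).re = t ∧ moebius (rho (-1) 3 (by norm_num) (castQ (-1) 3 x)) τ = τ}).2.2⟩ : {τ : ℂ // 0 < τ.im ∧ ∃ x : ℍ[ℚ,((-1 : ℤ) : ℚ),((3 : ℤ) : ℚ)],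
        x ∈ order (-1) 3 ∧ x.re = 0 ∧ (x * star x).re = t ∧ moebius (rho (-1) 3 (by norm_num) (castQ (-1) 3 x)) τ = τ}) = Quot.mk _ p ∧
    Quot.mk (fun p q : {τ : ℂ // 0 < τ.im ∧ ∃ x : ℍ[ℚ,((-1 : ℤ) : ℚ),((3 : ℤ) : ℚ)],
        x ∈ order (-1) 3 ∧ x.re = 0 ∧ (x * star x).re = t ∧ moebius (rho (-1) 3 (by norm_num) (castQ (-1) 3 x)) τ = τ} ↦
      ∃ v : ℍ[ℚ,((-1 : ℤ) : ℚ),((3 : ℤ) : ℚ)], (v ∈ order (-1) 3 ∨ v - ⟨1/2, 1/2, 1/2, -1/2⟩ ∈ order (-1) 3) ∧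
        v * star v = 1 ∧ moebius (rho (-1) 3 (by norm_num) (castQ (-1) 3 v)) p.1 = q.1) (⟨moebius (rho (-1) 3 (by norm_num) (castQ (-1) 3 (⟨1, 1, 0, 0⟩ : ℍ[ℚ,((-1 : ℤ) : ℚ),((3 : ℤ) : ℚ)]))) (⟨moebius (rho (-1) 3 (by norm_num) (castQ (-1) 3 (⟨3, 0, 1, 1⟩ : ℍ[ℚ,((-1 : ℤ) : ℚ),((3 : ℤ) : ℚ)]))) p.1, moebius_mu_mem_specialPoints p.2.1 p.2.2⟩ : {τ : ℂ // 0 < τ.im ∧ ∃ x : ℍ[ℚ,((-1 : ℤ) : ℚ),((3 : ℤ) : ℚ)],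
        x ∈ order (-1) 3 ∧ x.re = 0 ∧ (x * star x).re = t ∧ moebius (rho (-1) 3 (by norm_num) (castQ (-1) 3 x)) τ = τ}).1, moebius_w2_mem_specialPoints (⟨moebius (rho (-1) 3 (by norm_num) (castQ (-1) 3 (⟨3, 0, 1, 1⟩ : ℍ[ℚ,((-1 : ℤ) : ℚ),((3 : ℤ) : ℚ)]))) p.1, moebius_mu_mem_specialPoints p.2.1 p.2.2⟩ : {τ : ℂ // 0 < τ.im ∧ ∃ x : ℍ[ℚ,((-1 : ℤ) : ℚ),((3 : ℤ) : ℚ)],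
        x ∈ order (-1) 3 ∧ x.re = 0 ∧ (x * star x).re = t ∧ moebius (rho (-1) 3 (by norm_num) (castQ (-1) 3 x)) τ = τ}).2.1 (⟨moebius (rho (-1) 3 (by norm_num) (castQ (-1) 3 (⟨3, 0, 1, 1⟩ : ℍ[ℚ,((-1 : ℤ) : ℚ),((3 : ℤ) : ℚ)]))) p.1, moebius_mu_mem_specialPoints p.2.1 p.2.2⟩ : {τ : ℂ // 0 < τ.im ∧ ∃ x : ℍ[ℚ,((-1 : ℤ) : ℚ),((3 : ℤ) : ℚ)],
        x ∈ order (-1) 3 ∧ x.re = 0 ∧ (x * star x).re = t ∧ moebius (rho (-1) 3 (by norm_num) (castQ (-1) 3 x)) τ = τ}).2.2⟩ : {τ : ℂ // 0 < τ.im ∧ ∃ x : ℍ[ℚ,((-1 : ℤ) : ℚ),((3 : ℤ) : ℚ)],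
        x ∈ order (-1) 3 ∧ x.re = 0 ∧ (x * star x).re = t ∧ moebius (rho (-1) 3 (by norm_num) (castQ (-1) 3 x)) τ = τ}) = Quot.mk _ (⟨moebius (rho (-1) 3 (by norm_num) (castQ (-1) 3 (⟨3, 0, 1, 1⟩ : ℍ[ℚ,((-1 : ℤ) : ℚ),((3 : ℤ) : ℚ)]))) (⟨moebius (rho (-1) 3 (by norm_num) (castQ (-1) 3 (⟨1, 1, 0, 0⟩ : ℍ[ℚ,((-1 : ℤ) : ℚ),((3 : ℤ) : ℚ)]))) p.1, moebius_w2_mem_specialPoints p.2.1 p.2.2⟩ : {τ : ℂ // 0 < τ.im ∧ ∃ x : ℍ[ℚ,((-1 : ℤ) : ℚ),((3 : ℤ) : ℚ)],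
        x ∈ order (-1) 3 ∧ x.re = 0 ∧ (x * star x).re = t ∧ moebius (rho (-1) 3 (by norm_num) (castQ (-1) 3 x)) τ = τ}).1, moebius_mu_mem_specialPoints (⟨moebius (rho (-1) 3 (by norm_num) (castQ (-1) 3 (⟨1, 1, 0, 0⟩ : ℍ[ℚ,((-1 : ℤ) : ℚ),((3 : ℤ) : ℚ)]))) p.1, moebius_w2_mem_specialPoints p.2.1 p.2.2⟩ : {τ : ℂ // 0 < τ.im ∧ ∃ x : ℍ[ℚ,((-1 : ℤ) : ℚ),((3 : ℤ) : ℚ)],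
        x ∈ order (-1) 3 ∧ x.re = 0 ∧ (x * star x).re = t ∧ moebius (rho (-1) 3 (by norm_num) (castQ (-1) 3 x)) τ = τ}).2.1 (⟨moebius (rho (-1) 3 (by norm_num) (castQ (-1) 3 (⟨1, 1, 0, 0⟩ : ℍ[ℚ,((-1 : ℤ) : ℚ),((3 : ℤ) : ℚ)]))) p.1, moebius_w2_mem_specialPoints p.2.1 p.2.2⟩ : {τ : ℂ // 0 < τ.im ∧ ∃ x : ℍ[ℚ,((-1 : ℤ) : ℚ),((3 : ℤ) : ℚ)],
        x ∈ order (-1) 3 ∧ x.re = 0 ∧ (x * star x).re = t ∧ moebius (rho (-1) 3 (by norm_num) (castQ (-1) 3 x)) τ = τ}).2.2⟩ : {τ : ℂ // 0 < τ.im ∧ ∃ x : ℍ[ℚ,((-1 : ℤ) : ℚ),((3 : ℤ) : ℚ)],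
        x ∈ order (-1) 3 ∧ x.re = 0 ∧ (x * star x).re = t ∧ moebius (rho (-1) 3 (by norm_num) (castQ (-1) 3 x)) τ = τ}) ∧
    (⟨moebius (rho (-1) 3 (by norm_num) (castQ (-1) 3 (⟨3, 3, 0, 2⟩ : ℍ[ℚ,((-1 : ℤ) : ℚ),((3 : ℤ) : ℚ)]))) p.1, moebius_w6_mem_specialPoints p.2.1 p.2.2⟩ : {τ : ℂ // 0 < τ.im ∧ ∃ x : ℍ[ℚ,((-1 : ℤ) : ℚ),((3 : ℤ) : ℚ)],
        x ∈ order (-1) 3 ∧ x.re = 0 ∧ (x * star x).re = t ∧ moebius (rho (-1) 3 (by norm_num) (castQ (-1) 3 x)) τ = τ}) = (⟨moebius (rho (-1) 3 (by norm_num) (castQ (-1) 3 (⟨1, 1, 0, 0⟩ : ℍ[ℚ,((-1 : ℤ) : ℚ),((3 : ℤ) : ℚ)]))) (⟨moebius (rho (-1) 3 (by norm_num) (castQ (-1) 3 (⟨3, 0, 1, 1⟩ : ℍ[ℚ,((-1 : ℤ) : ℚ),((3 : ℤ) : ℚ)]))) p.1, moebius_mu_mem_specialPoints p.2.1 p.2.2⟩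 : {τ : ℂ // 0 < τ.im ∧ ∃ x : ℍ[ℚ,((-1 : ℤ) : ℚ),((3 : ℤ) : ℚ)],
        x ∈ order (-1) 3 ∧ x.re = 0 ∧ (x * star x).re = t ∧ moebius (rho (-1) 3 (by norm_num) (castQ (-1) 3 x)) τ = τ}).1, moebius_w2_mem_specialPoints (⟨moebius (rho (-1) 3 (by norm_num) (castQ (-1) 3 (⟨3, 0, 1, 1⟩ : ℍ[ℚ,((-1 : ℤ) : ℚ),((3 : ℤ) : ℚ)]))) p.1, moebius_mu_mem_specialPoints p.2.1 p.2.2⟩ : {τ : ℂ // 0 < τ.im ∧ ∃ x : ℍ[ℚ,((-1 : ℤ) : ℚ),((3 : ℤ) : ℚ)],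
        x ∈ order (-1) 3 ∧ x.re = 0 ∧ (x * star x).re = t ∧ moebius (rho (-1) 3 (by norm_num) (castQ (-1) 3 x)) τ = τ}).2.1 (⟨moebius (rho (-1) 3 (by norm_num) (castQ (-1) 3 (⟨3, 0, 1, 1⟩ : ℍ[ℚ,((-1 : ℤ) : ℚ),((3 : ℤ) : ℚ)]))) p.1, moebius_mu_mem_specialPoints p.2.1 p.2.2⟩ : {τ : ℂ // 0 < τ.im ∧ ∃ x : ℍ[ℚ,((-1 : ℤ) : ℚ),((3 : ℤ) : ℚ)],
        x ∈ order (-1) 3 ∧ x.re = 0 ∧ (x * star x).re = t ∧ moebius (rho (-1) 3 (by norm_num) (castQ (-1) 3 x)) τ = τ}).2.2⟩ : {τ : ℂ // 0 < τ.im ∧ ∃ x : ℍ[ℚ,((-1 : ℤ) : ℚ),((3 : ℤ) : ℚ)],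
        x ∈ order (-1) 3 ∧ x.re = 0 ∧ (x * star x).re = t ∧ moebius (rho (-1) 3 (by norm_num) (castQ (-1) 3 x)) τ = τ}) := by
  refine ⟨(specialPoints_mk_eq_iff t _ _).2 (exists_normOne_moebius_w2_w2 p.2.1),
    (specialPoints_mk_eq_iff t _ _).2 (exists_normOne_moebius_mu_mu p.2.1),
    (specialPoints_mk_eq_iff t _ _).2 (exists_normOne_moebius_mu_w2 p.2.1), Subtype.ext ?_⟩
  exact (moebius_w2_moebius_mu p.2.1).symm

/-- **`ω₂, ω₃` ARE INVOLUTIONS OF `Pt(t)/Γ₆`**: `[τ′] = [ρ(w)τ] ⟺ [ρ(w)τ′] = [τ]` for `w = w₂, μ`. [cite: Ogg1983RealPoints, §2 (2)] [cite: BayerTravesa2007, §2 p. 318] -/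
theorem specialPoints_mk_eq_mk_moebius_iff {t : ℤ} (p' p : {τ : ℂ // 0 < τ.im ∧ ∃ x : ℍ[ℚ,((-1 : ℤ) : ℚ),((3 : ℤ) : ℚ)],
        x ∈ order (-1) 3 ∧ x.re = 0 ∧ (x * star x).re = t ∧ moebius (rho (-1) 3 (by norm_num) (castQ (-1) 3 x)) τ = τ}) :
    (Quot.mk (fun p q : {τ : ℂ // 0 < τ.im ∧ ∃ x : ℍ[ℚ,((-1 : ℤ) : ℚ),((3 : ℤ) : ℚ)],
        x ∈ order (-1) 3 ∧ x.re = 0 ∧ (x * star x).re = t ∧ moebius (rho (-1) 3 (by norm_num) (castQ (-1) 3 x)) τ = τ} ↦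
      ∃ v : ℍ[ℚ,((-1 : ℤ) : ℚ),((3 : ℤ) : ℚ)], (v ∈ order (-1) 3 ∨ v - ⟨1/2, 1/2, 1/2, -1/2⟩ ∈ order (-1) 3) ∧
        v * star v = 1 ∧ moebius (rho (-1) 3 (by norm_num) (castQ (-1) 3 v)) p.1 = q.1) p' = Quot.mk _ (⟨moebius (rho (-1) 3 (by norm_num) (castQ (-1) 3 (⟨1, 1, 0, 0⟩ : ℍ[ℚ,((-1 : ℤ) : ℚ),((3 : ℤ) : ℚ)]))) p.1, moebius_w2_mem_specialPoints p.2.1 p.2.2⟩ : {τ : ℂ // 0 < τ.im ∧ ∃ x : ℍ[ℚ,((-1 : ℤ) : ℚ),((3 : ℤ) : ℚ)],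
        x ∈ order (-1) 3 ∧ x.re = 0 ∧ (x * star x).re = t ∧ moebius (rho (-1) 3 (by norm_num) (castQ (-1) 3 x)) τ = τ}) ↔ Quot.mk (fun p q : {τ : ℂ // 0 < τ.im ∧ ∃ x : ℍ[ℚ,((-1 : ℤ) : ℚ),((3 : ℤ) : ℚ)],
        x ∈ order (-1) 3 ∧ x.re = 0 ∧ (x * star x).re = t ∧ moebius (rho (-1) 3 (by norm_num) (castQ (-1) 3 x)) τ = τ} ↦
      ∃ v : ℍ[ℚ,((-1 : ℤ) : ℚ),((3 : ℤ) : ℚ)], (v ∈ order (-1) 3 ∨ v - ⟨1/2, 1/2, 1/2, -1/2⟩ ∈ order (-1) 3) ∧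
        v * star v = 1 ∧ moebius (rho (-1) 3 (by norm_num) (castQ (-1) 3 v)) p.1 = q.1) (⟨moebius (rho (-1) 3 (by norm_num) (castQ (-1) 3 (⟨1, 1, 0, 0⟩ : ℍ[ℚ,((-1 : ℤ) : ℚ),((3 : ℤ) : ℚ)]))) p'.1, moebius_w2_mem_specialPoints p'.2.1 p'.2.2⟩ : {τ : ℂ // 0 < τ.im ∧ ∃ x : ℍ[ℚ,((-1 : ℤ) : ℚ),((3 : ℤ) : ℚ)],
        x ∈ order (-1) 3 ∧ x.re = 0 ∧ (x * star x).re = t ∧ moebius (rho (-1) 3 (by norm_num) (castQ (-1) 3 x)) τ = τ}) = Quot.mk _ p) ∧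
    (Quot.mk (fun p q : {τ : ℂ // 0 < τ.im ∧ ∃ x : ℍ[ℚ,((-1 : ℤ) : ℚ),((3 : ℤ) : ℚ)],
        x ∈ order (-1) 3 ∧ x.re = 0 ∧ (x * star x).re = t ∧ moebius (rho (-1) 3 (by norm_num) (castQ (-1) 3 x)) τ = τ} ↦
      ∃ v : ℍ[ℚ,((-1 : ℤ) : ℚ),((3 : ℤ) : ℚ)], (v ∈ order (-1) 3 ∨ v - ⟨1/2, 1/2, 1/2, -1/2⟩ ∈ order (-1) 3) ∧
        v * star v = 1 ∧ moebius (rho (-1) 3 (by norm_num) (castQ (-1) 3 v)) p.1 = q.1) p' = Quot.mk _ (⟨moebius (rho (-1) 3 (by norm_num) (castQ (-1) 3 (⟨3, 0, 1, 1⟩ : ℍ[ℚ,((-1 : ℤ) : ℚ),((3 : ℤ) : ℚ)]))) p.1, moebius_mu_mem_specialPoints p.2.1 p.2.2⟩ : {τ : ℂ // 0 < τ.im ∧ ∃ x : ℍ[ℚ,((-1 : ℤ) : ℚ),((3 : ℤ) : ℚ)],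
        x ∈ order (-1) 3 ∧ x.re = 0 ∧ (x * star x).re = t ∧ moebius (rho (-1) 3 (by norm_num) (castQ (-1) 3 x)) τ = τ}) ↔ Quot.mk (fun p q : {τ : ℂ // 0 < τ.im ∧ ∃ x : ℍ[ℚ,((-1 : ℤ) : ℚ),((3 : ℤ) : ℚ)],
        x ∈ order (-1) 3 ∧ x.re = 0 ∧ (x * star x).re = t ∧ moebius (rho (-1) 3 (by norm_num) (castQ (-1) 3 x)) τ = τ} ↦
      ∃ v : ℍ[ℚ,((-1 : ℤ) : ℚ),((3 : ℤ) : ℚ)], (v ∈ order (-1) 3 ∨ v - ⟨1/2, 1/2, 1/2, -1/2⟩ ∈ order (-1) 3) ∧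
        v * star v = 1 ∧ moebius (rho (-1) 3 (by norm_num) (castQ (-1) 3 v)) p.1 = q.1) (⟨moebius (rho (-1) 3 (by norm_num) (castQ (-1) 3 (⟨3, 0, 1, 1⟩ : ℍ[ℚ,((-1 : ℤ) : ℚ),((3 : ℤ) : ℚ)]))) p'.1, moebius_mu_mem_specialPoints p'.2.1 p'.2.2⟩ : {τ : ℂ // 0 < τ.im ∧ ∃ x : ℍ[ℚ,((-1 : ℤ) : ℚ),((3 : ℤ) : ℚ)],
        x ∈ order (-1) 3 ∧ x.re = 0 ∧ (x * star x).re = t ∧ moebius (rho (-1) 3 (by norm_num) (castQ (-1) 3 x)) τ = τ}) = Quot.mk _ p) := by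
  have hiff := specialPoints_mk_eq_iff t
  obtain ⟨cM, cA, -⟩ := specialPoints_rel_map_w2_mu_w6 t
  constructor
  · constructor
    · intro h
      rw [← (specialPoints_mk_klein p).1]
      exact (hiff _ _).2 (cM _ _ ((hiff _ _).1 h))
    · intro h
      rw [← (specialPoints_mk_klein p').1]
      exact (hiff _ _).2 (cM _ _ ((hiff _ _).1 h))
  · constructor
    · intro h
      rw [← (specialPoints_mk_klein p).2.1]
      exact (hiff _ _).2 (cA _ _ ((hiff _ _).1 h))
    · intro h
      rw [← (specialPoints_mk_klein p').2.1]
      exact (hiff _ _).2 (cA _ _ ((hiff _ _).1 h))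

end Helpers

/-! ## §1 The tower `Pt(t)/Γ₆ → Pt(t)/Γ₆^{(d)} → Pt(t)/Γ₆⁺` -/

section Tower

/-- **`Γ₆`-EQUIVALENT ⟹ `Γ₆^{(d)}`-EQUIVALENT** (`Γ₆ ⊂ Γ₆^{(d)}`: a unit `v ∈ O₆¹` normalises `O₆` and `nr v = 1 = 1²`), so
`Pt(t)/Γ₆ → Pt(t)/Γ₆^{(d)}` is `Quot.factor` — the points of `Z(t)` under `X₆ → X₆^{(d)} = X₆/⟨ω_d⟩`. [cite: BayerTravesa2007, §2 p. 318 («`X₆^{(2)} = X₆/⟨ω₂⟩, X₆^{(3)} = X₆/⟨ω₃⟩, X₆^{(6)} = X₆/⟨ω₆⟩`»)] -/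
theorem atkinLehnerQuotient_rel_of_specialPoints_rel (t : ℤ) (d : ℚ) :
    ∀ p q : {τ : ℂ // 0 < τ.im ∧ ∃ x : ℍ[ℚ,((-1 : ℤ) : ℚ),((3 : ℤ) : ℚ)],
        x ∈ order (-1) 3 ∧ x.re = 0 ∧ (x * star x).re = t ∧ moebius (rho (-1) 3 (by norm_num) (castQ (-1) 3 x)) τ = τ},
      (∃ v : ℍ[ℚ,((-1 : ℤ) : ℚ),((3 : ℤ) : ℚ)], (v ∈ order (-1) 3 ∨ v - ⟨1/2, 1/2, 1/2, -1/2⟩ ∈ order (-1) 3) ∧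
        v * star v = 1 ∧ moebius (rho (-1) 3 (by norm_num) (castQ (-1) 3 v)) p.1 = q.1) →
      ∃ g : ℍ[ℚ,((-1 : ℤ) : ℚ),((3 : ℤ) : ℚ)], g ≠ 0 ∧
        (∀ a : ℍ[ℚ,((-1 : ℤ) : ℚ),((3 : ℤ) : ℚ)], (a ∈ order (-1) 3 ∨ a - ⟨1/2, 1/2, 1/2, -1/2⟩ ∈ order (-1) 3) →
          ∃ b : ℍ[ℚ,((-1 : ℤ) : ℚ),((3 : ℤ) : ℚ)], (b ∈ order (-1) 3 ∨ b - ⟨1/2, 1/2, 1/2, -1/2⟩ ∈ order (-1) 3) ∧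
            g * a = b * g) ∧
        0 < (g * star g).re ∧ (∃ s : ℚ, (g * star g).re = s ^ 2 ∨ (g * star g).re = d * s ^ 2) ∧
        moebius (rho (-1) 3 (by norm_num) (castQ (-1) 3 g)) p.1 = q.1 := by
  rintro p q ⟨v, hv, hv1, h⟩
  have hvn : (v * star v).re = 1 := by rw [hv1, QuaternionAlgebra.re_one]
  have hN := normOne_mul_word_normalises hv hv1 0 0
  simp only [pow_zero, mul_one] at hN
  exact ⟨v, hN.1, hN.2.1, by rw [hvn]; exact one_pos, ⟨1, Or.inl (by rw [hvn]; norm_num)⟩, h⟩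

/-- **`Γ₆^{(d)}`-EQUIVALENT ⟹ `Γ₆⁺`-EQUIVALENT** (`Γ₆^{(d)} ⊂ Γ₆⁺`), so `Pt(t)/Γ₆^{(d)} → Pt(t)/Γ₆⁺` is `Quot.factor` — the
points of `Z(t)` under `X₆^{(d)} → X₆⁺ = X₆/W`. [cite: BayerTravesa2007, §2 p. 318 («and `X₆⁺ = X₆/W`»)] -/
theorem specialPointsPlus_rel_of_atkinLehnerQuotient_rel (t : ℤ) (d : ℚ) :
    ∀ p q : {τ : ℂ // 0 < τ.im ∧ ∃ x : ℍ[ℚ,((-1 : ℤ) : ℚ),((3 : ℤ) : ℚ)],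
        x ∈ order (-1) 3 ∧ x.re = 0 ∧ (x * star x).re = t ∧ moebius (rho (-1) 3 (by norm_num) (castQ (-1) 3 x)) τ = τ},
      (∃ g : ℍ[ℚ,((-1 : ℤ) : ℚ),((3 : ℤ) : ℚ)], g ≠ 0 ∧
        (∀ a : ℍ[ℚ,((-1 : ℤ) : ℚ),((3 : ℤ) : ℚ)], (a ∈ order (-1) 3 ∨ a - ⟨1/2, 1/2, 1/2, -1/2⟩ ∈ order (-1) 3) →
          ∃ b : ℍ[ℚ,((-1 : ℤ) : ℚ),((3 : ℤ) : ℚ)], (b ∈ order (-1) 3 ∨ b - ⟨1/2, 1/2, 1/2, -1/2⟩ ∈ order (-1) 3) ∧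
            g * a = b * g) ∧
        0 < (g * star g).re ∧ (∃ s : ℚ, (g * star g).re = s ^ 2 ∨ (g * star g).re = d * s ^ 2) ∧
        moebius (rho (-1) 3 (by norm_num) (castQ (-1) 3 g)) p.1 = q.1) →
      ∃ g : ℍ[ℚ,((-1 : ℤ) : ℚ),((3 : ℤ) : ℚ)], g ≠ 0 ∧
        (∀ a : ℍ[ℚ,((-1 : ℤ) : ℚ),((3 : ℤ) : ℚ)], (a ∈ order (-1) 3 ∨ a - ⟨1/2, 1/2, 1/2, -1/2⟩ ∈ order (-1) 3) →
          ∃ b : ℍ[ℚ,((-1 : ℤ) : ℚ),((3 : ℤ) : ℚ)], (b ∈ order (-1) 3 ∨ b - ⟨1/2, 1/2, 1/2, -1/2⟩ ∈ order (-1) 3) ∧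
            g * a = b * g) ∧
        0 < (g * star g).re ∧ moebius (rho (-1) 3 (by norm_num) (castQ (-1) 3 g)) p.1 = q.1 := by
  rintro p q ⟨g, hg0, hL, hpos, -, h⟩
  exact ⟨g, hg0, hL, hpos, h⟩

/-- **THE TOWER COMMUTES**: `(Pt(t)/Γ₆^{(d)} → Pt(t)/Γ₆⁺) ∘ (Pt(t)/Γ₆ → Pt(t)/Γ₆^{(d)}) = (Pt(t)/Γ₆ → Pt(t)/Γ₆⁺)` —
`X₆ → X₆^{(d)} → X₆⁺` over `Z(t)`. [cite: BayerTravesa2007, §2 p. 318] -/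
theorem factor_atkinLehnerQuotient_factor (t : ℤ) (d : ℚ) (a : (Quot (fun p q : {τ : ℂ // 0 < τ.im ∧ ∃ x : ℍ[ℚ,((-1 : ℤ) : ℚ),((3 : ℤ) : ℚ)],
        x ∈ order (-1) 3 ∧ x.re = 0 ∧ (x * star x).re = t ∧ moebius (rho (-1) 3 (by norm_num) (castQ (-1) 3 x)) τ = τ} ↦
      ∃ v : ℍ[ℚ,((-1 : ℤ) : ℚ),((3 : ℤ) : ℚ)], (v ∈ order (-1) 3 ∨ v - ⟨1/2, 1/2, 1/2, -1/2⟩ ∈ order (-1) 3) ∧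
        v * star v = 1 ∧ moebius (rho (-1) 3 (by norm_num) (castQ (-1) 3 v)) p.1 = q.1))) :
    Quot.factor (fun p q : {τ : ℂ // 0 < τ.im ∧ ∃ x : ℍ[ℚ,((-1 : ℤ) : ℚ),((3 : ℤ) : ℚ)],
        x ∈ order (-1) 3 ∧ x.re = 0 ∧ (x * star x).re = t ∧ moebius (rho (-1) 3 (by norm_num) (castQ (-1) 3 x)) τ = τ} ↦
      ∃ g : ℍ[ℚ,((-1 : ℤ) : ℚ),((3 : ℤ) : ℚ)], g ≠ 0 ∧
        (∀ a : ℍ[ℚ,((-1 : ℤ) : ℚ),((3 : ℤ) : ℚ)], (a ∈ order (-1) 3 ∨ a - ⟨1/2, 1/2, 1/2, -1/2⟩ ∈ order (-1) 3) →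
          ∃ b : ℍ[ℚ,((-1 : ℤ) : ℚ),((3 : ℤ) : ℚ)], (b ∈ order (-1) 3 ∨ b - ⟨1/2, 1/2, 1/2, -1/2⟩ ∈ order (-1) 3) ∧
            g * a = b * g) ∧
        0 < (g * star g).re ∧ (∃ s : ℚ, (g * star g).re = s ^ 2 ∨ (g * star g).re = d * s ^ 2) ∧
        moebius (rho (-1) 3 (by norm_num) (castQ (-1) 3 g)) p.1 = q.1)
      (fun p q : {τ : ℂ // 0 < τ.im ∧ ∃ x : ℍ[ℚ,((-1 : ℤ) : ℚ),((3 : ℤ) : ℚ)],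
        x ∈ order (-1) 3 ∧ x.re = 0 ∧ (x * star x).re = t ∧ moebius (rho (-1) 3 (by norm_num) (castQ (-1) 3 x)) τ = τ} ↦
      ∃ g : ℍ[ℚ,((-1 : ℤ) : ℚ),((3 : ℤ) : ℚ)], g ≠ 0 ∧
        (∀ a : ℍ[ℚ,((-1 : ℤ) : ℚ),((3 : ℤ) : ℚ)], (a ∈ order (-1) 3 ∨ a - ⟨1/2, 1/2, 1/2, -1/2⟩ ∈ order (-1) 3) →
          ∃ b : ℍ[ℚ,((-1 : ℤ) : ℚ),((3 : ℤ) : ℚ)], (b ∈ order (-1) 3 ∨ b - ⟨1/2, 1/2, 1/2, -1/2⟩ ∈ order (-1) 3) ∧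
            g * a = b * g) ∧
        0 < (g * star g).re ∧ moebius (rho (-1) 3 (by norm_num) (castQ (-1) 3 g)) p.1 = q.1)
      (specialPointsPlus_rel_of_atkinLehnerQuotient_rel t d)
      (Quot.factor (fun p q : {τ : ℂ // 0 < τ.im ∧ ∃ x : ℍ[ℚ,((-1 : ℤ) : ℚ),((3 : ℤ) : ℚ)],
        x ∈ order (-1) 3 ∧ x.re = 0 ∧ (x * star x).re = t ∧ moebius (rho (-1) 3 (by norm_num) (castQ (-1) 3 x)) τ = τ} ↦
      ∃ v : ℍ[ℚ,((-1 : ℤ) : ℚ),((3 : ℤ) : ℚ)], (v ∈ order (-1) 3 ∨ v - ⟨1/2, 1/2, 1/2, -1/2⟩ ∈ order (-1) 3) ∧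
        v * star v = 1 ∧ moebius (rho (-1) 3 (by norm_num) (castQ (-1) 3 v)) p.1 = q.1)
        (fun p q : {τ : ℂ // 0 < τ.im ∧ ∃ x : ℍ[ℚ,((-1 : ℤ) : ℚ),((3 : ℤ) : ℚ)],
        x ∈ order (-1) 3 ∧ x.re = 0 ∧ (x * star x).re = t ∧ moebius (rho (-1) 3 (by norm_num) (castQ (-1) 3 x)) τ = τ} ↦
      ∃ g : ℍ[ℚ,((-1 : ℤ) : ℚ),((3 : ℤ) : ℚ)], g ≠ 0 ∧
        (∀ a : ℍ[ℚ,((-1 : ℤ) : ℚ),((3 : ℤ) : ℚ)], (a ∈ order (-1) 3 ∨ a - ⟨1/2, 1/2, 1/2, -1/2⟩ ∈ order (-1) 3) →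
          ∃ b : ℍ[ℚ,((-1 : ℤ) : ℚ),((3 : ℤ) : ℚ)], (b ∈ order (-1) 3 ∨ b - ⟨1/2, 1/2, 1/2, -1/2⟩ ∈ order (-1) 3) ∧
            g * a = b * g) ∧
        0 < (g * star g).re ∧ (∃ s : ℚ, (g * star g).re = s ^ 2 ∨ (g * star g).re = d * s ^ 2) ∧
        moebius (rho (-1) 3 (by norm_num) (castQ (-1) 3 g)) p.1 = q.1)
        (atkinLehnerQuotient_rel_of_specialPoints_rel t d) a) =
    Quot.factor (fun p q : {τ : ℂ // 0 < τ.im ∧ ∃ x : ℍ[ℚ,((-1 : ℤ) : ℚ),((3 : ℤ) : ℚ)],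
        x ∈ order (-1) 3 ∧ x.re = 0 ∧ (x * star x).re = t ∧ moebius (rho (-1) 3 (by norm_num) (castQ (-1) 3 x)) τ = τ} ↦
      ∃ v : ℍ[ℚ,((-1 : ℤ) : ℚ),((3 : ℤ) : ℚ)], (v ∈ order (-1) 3 ∨ v - ⟨1/2, 1/2, 1/2, -1/2⟩ ∈ order (-1) 3) ∧
        v * star v = 1 ∧ moebius (rho (-1) 3 (by norm_num) (castQ (-1) 3 v)) p.1 = q.1)
      (fun p q : {τ : ℂ // 0 < τ.im ∧ ∃ x : ℍ[ℚ,((-1 : ℤ) : ℚ),((3 : ℤ) : ℚ)],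
        x ∈ order (-1) 3 ∧ x.re = 0 ∧ (x * star x).re = t ∧ moebius (rho (-1) 3 (by norm_num) (castQ (-1) 3 x)) τ = τ} ↦
      ∃ g : ℍ[ℚ,((-1 : ℤ) : ℚ),((3 : ℤ) : ℚ)], g ≠ 0 ∧
        (∀ a : ℍ[ℚ,((-1 : ℤ) : ℚ),((3 : ℤ) : ℚ)], (a ∈ order (-1) 3 ∨ a - ⟨1/2, 1/2, 1/2, -1/2⟩ ∈ order (-1) 3) →
          ∃ b : ℍ[ℚ,((-1 : ℤ) : ℚ),((3 : ℤ) : ℚ)], (b ∈ order (-1) 3 ∨ b - ⟨1/2, 1/2, 1/2, -1/2⟩ ∈ order (-1) 3) ∧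
            g * a = b * g) ∧
        0 < (g * star g).re ∧ moebius (rho (-1) 3 (by norm_num) (castQ (-1) 3 g)) p.1 = q.1)
      (specialPointsPlus_rel_of_specialPoints_rel t) a := by
  induction a using Quot.ind with
  | _ p => rfl

/-- **`Pt(t)/Γ₆^{(d)}` IS FINITE** (`t > 0`): an image of the finite `Pt(t)/Γ₆`. [cite: KudlaRapoportYang2006, Introduction p. 9 («`Z(t)` is a finite set of points»)] [cite: BayerTravesa2007, §2 p. 318] -/
theorem finite_atkinLehnerQuotient {t : ℤ} (ht : 0 < t) (d : ℚ) :
    Finite (Quot (fun p q : {τ : ℂ // 0 < τ.im ∧ ∃ x : ℍ[ℚ,((-1 : ℤ) : ℚ),((3 : ℤ) : ℚ)],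
        x ∈ order (-1) 3 ∧ x.re = 0 ∧ (x * star x).re = t ∧ moebius (rho (-1) 3 (by norm_num) (castQ (-1) 3 x)) τ = τ} ↦
      ∃ g : ℍ[ℚ,((-1 : ℤ) : ℚ),((3 : ℤ) : ℚ)], g ≠ 0 ∧
        (∀ a : ℍ[ℚ,((-1 : ℤ) : ℚ),((3 : ℤ) : ℚ)], (a ∈ order (-1) 3 ∨ a - ⟨1/2, 1/2, 1/2, -1/2⟩ ∈ order (-1) 3) →
          ∃ b : ℍ[ℚ,((-1 : ℤ) : ℚ),((3 : ℤ) : ℚ)], (b ∈ order (-1) 3 ∨ b - ⟨1/2, 1/2, 1/2, -1/2⟩ ∈ order (-1) 3) ∧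
            g * a = b * g) ∧
        0 < (g * star g).re ∧ (∃ s : ℚ, (g * star g).re = s ^ 2 ∨ (g * star g).re = d * s ^ 2) ∧
        moebius (rho (-1) 3 (by norm_num) (castQ (-1) 3 g)) p.1 = q.1)) := by
  haveI := finite_specialPoints ht
  exact Finite.of_surjective _ (factor_surjective₂₁ _ _ (atkinLehnerQuotient_rel_of_specialPoints_rel t d))

end Tower

/-! ## §2 `Γ₆^{(d)}`-equivalence by words: `Γ₆^{(d)} = ℚ^×·Γ₆·{1, w_d}` -/

section Words

/-- **`p ∼_{Γ₆^{(2)}} q ⟺ q = ρ(v)p` OR `q = ρ(v)ρ(w₂)p` FOR SOME `v ∈ Γ₆`** (`Γ₆^{(2)} = ℚ^×·Γ₆·{1, w₂}`: inside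
`Γ₆⁺ = ℚ_{>0}Γ₆{1, w₂, μ, w₂μ}` the norm class `ℚ^{×2}{1, 2}` singles out the words `1, w₂`; the scalar acts trivially).
[cite: BayerTravesa2007, §2 p. 318 («`X₆^{(2)} = X₆/⟨ω₂⟩`»)] [cite: VignerasLNM800, Ch. IV §3 B] -/
theorem atkinLehnerQuotientTwo_rel_iff {t : ℤ} (p q : {τ : ℂ // 0 < τ.im ∧ ∃ x : ℍ[ℚ,((-1 : ℤ) : ℚ),((3 : ℤ) : ℚ)],
        x ∈ order (-1) 3 ∧ x.re = 0 ∧ (x * star x).re = t ∧ moebius (rho (-1) 3 (by norm_num) (castQ (-1) 3 x)) τ = τ}) :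
    (∃ g : ℍ[ℚ,((-1 : ℤ) : ℚ),((3 : ℤ) : ℚ)], g ≠ 0 ∧
        (∀ a : ℍ[ℚ,((-1 : ℤ) : ℚ),((3 : ℤ) : ℚ)], (a ∈ order (-1) 3 ∨ a - ⟨1/2, 1/2, 1/2, -1/2⟩ ∈ order (-1) 3) →
          ∃ b : ℍ[ℚ,((-1 : ℤ) : ℚ),((3 : ℤ) : ℚ)], (b ∈ order (-1) 3 ∨ b - ⟨1/2, 1/2, 1/2, -1/2⟩ ∈ order (-1) 3) ∧
            g * a = b * g) ∧
        0 < (g * star g).re ∧ (∃ s : ℚ, (g * star g).re = s ^ 2 ∨ (g * star g).re = 2 * s ^ 2) ∧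
        moebius (rho (-1) 3 (by norm_num) (castQ (-1) 3 g)) p.1 = q.1) ↔
    ∃ v : ℍ[ℚ,((-1 : ℤ) : ℚ),((3 : ℤ) : ℚ)], (v ∈ order (-1) 3 ∨ v - ⟨1/2, 1/2, 1/2, -1/2⟩ ∈ order (-1) 3) ∧ v * star v = 1 ∧
      (moebius (rho (-1) 3 (by norm_num) (castQ (-1) 3 v)) p.1 = q.1 ∨
        moebius (rho (-1) 3 (by norm_num) (castQ (-1) 3 v)) (moebius (rho (-1) 3 (by norm_num) (castQ (-1) 3 (⟨1, 1, 0, 0⟩ : ℍ[ℚ,((-1 : ℤ) : ℚ),((3 : ℤ) : ℚ)]))) p.1) = q.1) := by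
  have hwD : ((⟨1, 1, 0, 0⟩ : ℍ[ℚ,((-1 : ℤ) : ℚ),((3 : ℤ) : ℚ)]) * star ⟨1, 1, 0, 0⟩).re = 2 := norm_w2₂₁
  constructor
  · rintro ⟨g, hg0, hL, hpos, ⟨s, hs⟩, h⟩
    obtain ⟨r, v, k, l, hr, hv, hv1, hk, hl, rfl⟩ := exists_eq_smul_normOne_mul_word_of_normalises hg0 hL hpos
    have hvn : (v * star v).re = 1 := by rw [hv1, QuaternionAlgebra.re_one]
    rw [re_smul_mul_word_mul_star, hvn, one_mul, norm_atkinLehner_word] at hs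
    rw [moebius_smul_mul_word_apply hr.ne' (by rw [hvn]; exact one_pos) k l p.2.1] at h
    refine ⟨v, hv, hv1, ?_⟩
    rcases atkinLehner_word_of_norm_shape_two hk hl hr.ne' hs with ⟨rfl, rfl⟩ | ⟨rfl, rfl⟩
    · left
      rw [pow_zero, pow_zero, mul_one, moebius_rho_castQ_one_apply] at h
      exact h
    · right
      rw [pow_one, pow_zero, mul_one] at h
      exact h
  · rintro ⟨v, hv, hv1, h⟩
    have hvn : (v * star v).re = 1 := by rw [hv1, QuaternionAlgebra.re_one]
    rcases h with h | h
    · have hN := normOne_mul_word_normalises hv hv1 0 0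
      simp only [pow_zero, mul_one] at hN
      exact ⟨v, hN.1, hN.2.1, by rw [hvn]; exact one_pos, ⟨1, Or.inl (by rw [hvn]; norm_num)⟩, h⟩
    · have hN := normOne_mul_word_normalises hv hv1 1 0
      simp only [pow_one, pow_zero, mul_one] at hN
      set g : ℍ[ℚ,((-1 : ℤ) : ℚ),((3 : ℤ) : ℚ)] := v * (⟨1, 1, 0, 0⟩ : ℍ[ℚ,((-1 : ℤ) : ℚ),((3 : ℤ) : ℚ)]) with hg
      have hn : 0 < (g * star g).re := by rw [hN.2.2.2]; norm_num
      have hs : ∃ s : ℚ, (g * star g).re = s ^ 2 ∨ (g * star g).re = 2 * s ^ 2 :=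
        ⟨1, Or.inr (by rw [hN.2.2.2]; norm_num)⟩
      have hgp : moebius (rho (-1) 3 (by norm_num) (castQ (-1) 3 g)) p.1 = q.1 := by
        rw [hg, moebius_rho_castQ_mul_apply (by rw [hwD]; norm_num) (by rw [hvn]; exact one_pos) p.2.1]
        exact h
      exact ⟨g, hN.1, hN.2.1, hn, hs, hgp⟩

/-- **`p ∼_{Γ₆^{(3)}} q ⟺ q = ρ(v)p` OR `q = ρ(v)ρ(μ)p` FOR SOME `v ∈ Γ₆`** (`Γ₆^{(3)} = ℚ^×·Γ₆·{1, μ}`: inside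
`Γ₆⁺ = ℚ_{>0}Γ₆{1, w₂, μ, w₂μ}` the norm class `ℚ^{×2}{1, 3}` singles out the words `1, μ`; the scalar acts trivially).
[cite: BayerTravesa2007, §2 p. 318 («`X₆^{(3)} = X₆/⟨ω₃⟩`»)] [cite: VignerasLNM800, Ch. IV §3 B] -/
theorem atkinLehnerQuotientThree_rel_iff {t : ℤ} (p q : {τ : ℂ // 0 < τ.im ∧ ∃ x : ℍ[ℚ,((-1 : ℤ) : ℚ),((3 : ℤ) : ℚ)],
        x ∈ order (-1) 3 ∧ x.re = 0 ∧ (x * star x).re = t ∧ moebius (rho (-1) 3 (by norm_num) (castQ (-1) 3 x)) τ = τ}) :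
    (∃ g : ℍ[ℚ,((-1 : ℤ) : ℚ),((3 : ℤ) : ℚ)], g ≠ 0 ∧
        (∀ a : ℍ[ℚ,((-1 : ℤ) : ℚ),((3 : ℤ) : ℚ)], (a ∈ order (-1) 3 ∨ a - ⟨1/2, 1/2, 1/2, -1/2⟩ ∈ order (-1) 3) →
          ∃ b : ℍ[ℚ,((-1 : ℤ) : ℚ),((3 : ℤ) : ℚ)], (b ∈ order (-1) 3 ∨ b - ⟨1/2, 1/2, 1/2, -1/2⟩ ∈ order (-1) 3) ∧
            g * a = b * g) ∧
        0 < (g * star g).re ∧ (∃ s : ℚ, (g * star g).re = s ^ 2 ∨ (g * star g).re = 3 * s ^ 2) ∧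
        moebius (rho (-1) 3 (by norm_num) (castQ (-1) 3 g)) p.1 = q.1) ↔
    ∃ v : ℍ[ℚ,((-1 : ℤ) : ℚ),((3 : ℤ) : ℚ)], (v ∈ order (-1) 3 ∨ v - ⟨1/2, 1/2, 1/2, -1/2⟩ ∈ order (-1) 3) ∧ v * star v = 1 ∧
      (moebius (rho (-1) 3 (by norm_num) (castQ (-1) 3 v)) p.1 = q.1 ∨
        moebius (rho (-1) 3 (by norm_num) (castQ (-1) 3 v)) (moebius (rho (-1) 3 (by norm_num) (castQ (-1) 3 (⟨3, 0, 1, 1⟩ : ℍ[ℚ,((-1 : ℤ) : ℚ),((3 : ℤ) : ℚ)]))) p.1) = q.1) := by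
  have hwD : ((⟨3, 0, 1, 1⟩ : ℍ[ℚ,((-1 : ℤ) : ℚ),((3 : ℤ) : ℚ)]) * star ⟨3, 0, 1, 1⟩).re = 3 := norm_mu₂₁
  constructor
  · rintro ⟨g, hg0, hL, hpos, ⟨s, hs⟩, h⟩
    obtain ⟨r, v, k, l, hr, hv, hv1, hk, hl, rfl⟩ := exists_eq_smul_normOne_mul_word_of_normalises hg0 hL hpos
    have hvn : (v * star v).re = 1 := by rw [hv1, QuaternionAlgebra.re_one]
    rw [re_smul_mul_word_mul_star, hvn, one_mul, norm_atkinLehner_word] at hs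
    rw [moebius_smul_mul_word_apply hr.ne' (by rw [hvn]; exact one_pos) k l p.2.1] at h
    refine ⟨v, hv, hv1, ?_⟩
    rcases atkinLehner_word_of_norm_shape_three hk hl hr.ne' hs with ⟨rfl, rfl⟩ | ⟨rfl, rfl⟩
    · left
      rw [pow_zero, pow_zero, mul_one, moebius_rho_castQ_one_apply] at h
      exact h
    · right
      rw [pow_zero, pow_one, one_mul] at h
      exact h
  · rintro ⟨v, hv, hv1, h⟩
    have hvn : (v * star v).re = 1 := by rw [hv1, QuaternionAlgebra.re_one]
    rcases h with h | h
    · have hN := normOne_mul_word_normalises hv hv1 0 0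
      simp only [pow_zero, mul_one] at hN
      exact ⟨v, hN.1, hN.2.1, by rw [hvn]; exact one_pos, ⟨1, Or.inl (by rw [hvn]; norm_num)⟩, h⟩
    · have hN := normOne_mul_word_normalises hv hv1 0 1
      simp only [pow_zero, pow_one, one_mul] at hN
      set g : ℍ[ℚ,((-1 : ℤ) : ℚ),((3 : ℤ) : ℚ)] := v * (⟨3, 0, 1, 1⟩ : ℍ[ℚ,((-1 : ℤ) : ℚ),((3 : ℤ) : ℚ)]) with hg
      have hn : 0 < (g * star g).re := by rw [hN.2.2.2]; norm_num
      have hs : ∃ s : ℚ, (g * star g).re = s ^ 2 ∨ (g * star g).re = 3 * s ^ 2 :=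
        ⟨1, Or.inr (by rw [hN.2.2.2]; norm_num)⟩
      have hgp : moebius (rho (-1) 3 (by norm_num) (castQ (-1) 3 g)) p.1 = q.1 := by
        rw [hg, moebius_rho_castQ_mul_apply (by rw [hwD]; norm_num) (by rw [hvn]; exact one_pos) p.2.1]
        exact h
      exact ⟨g, hN.1, hN.2.1, hn, hs, hgp⟩

/-- **`p ∼_{Γ₆^{(6)}} q ⟺ q = ρ(v)p` OR `q = ρ(v)ρ(w₆)p` FOR SOME `v ∈ Γ₆`** (`Γ₆^{(6)} = ℚ^×·Γ₆·{1, w₆}`: inside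
`Γ₆⁺ = ℚ_{>0}Γ₆{1, w₂, μ, w₂μ}` the norm class `ℚ^{×2}{1, 6}` singles out the words `1, w₆`; the scalar acts trivially).
[cite: BayerTravesa2007, §2 p. 318 («`X₆^{(6)} = X₆/⟨ω₆⟩`»)] [cite: VignerasLNM800, Ch. IV §3 B] -/
theorem atkinLehnerQuotientSix_rel_iff {t : ℤ} (p q : {τ : ℂ // 0 < τ.im ∧ ∃ x : ℍ[ℚ,((-1 : ℤ) : ℚ),((3 : ℤ) : ℚ)],
        x ∈ order (-1) 3 ∧ x.re = 0 ∧ (x * star x).re = t ∧ moebius (rho (-1) 3 (by norm_num) (castQ (-1) 3 x)) τ = τ}) :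
    (∃ g : ℍ[ℚ,((-1 : ℤ) : ℚ),((3 : ℤ) : ℚ)], g ≠ 0 ∧
        (∀ a : ℍ[ℚ,((-1 : ℤ) : ℚ),((3 : ℤ) : ℚ)], (a ∈ order (-1) 3 ∨ a - ⟨1/2, 1/2, 1/2, -1/2⟩ ∈ order (-1) 3) →
          ∃ b : ℍ[ℚ,((-1 : ℤ) : ℚ),((3 : ℤ) : ℚ)], (b ∈ order (-1) 3 ∨ b - ⟨1/2, 1/2, 1/2, -1/2⟩ ∈ order (-1) 3) ∧
            g * a = b * g) ∧
        0 < (g * star g).re ∧ (∃ s : ℚ, (g * star g).re = s ^ 2 ∨ (g * star g).re = 6 * s ^ 2) ∧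
        moebius (rho (-1) 3 (by norm_num) (castQ (-1) 3 g)) p.1 = q.1) ↔
    ∃ v : ℍ[ℚ,((-1 : ℤ) : ℚ),((3 : ℤ) : ℚ)], (v ∈ order (-1) 3 ∨ v - ⟨1/2, 1/2, 1/2, -1/2⟩ ∈ order (-1) 3) ∧ v * star v = 1 ∧
      (moebius (rho (-1) 3 (by norm_num) (castQ (-1) 3 v)) p.1 = q.1 ∨
        moebius (rho (-1) 3 (by norm_num) (castQ (-1) 3 v)) (moebius (rho (-1) 3 (by norm_num) (castQ (-1) 3 (⟨3, 3, 0, 2⟩ : ℍ[ℚ,((-1 : ℤ) : ℚ),((3 : ℤ) : ℚ)]))) p.1) = q.1) := by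
  have hwD : ((⟨3, 3, 0, 2⟩ : ℍ[ℚ,((-1 : ℤ) : ℚ),((3 : ℤ) : ℚ)]) * star ⟨3, 3, 0, 2⟩).re = 6 := norm_w6₂₁
  have hw6 : (⟨1, 1, 0, 0⟩ : ℍ[ℚ,((-1 : ℤ) : ℚ),((3 : ℤ) : ℚ)]) * ⟨3, 0, 1, 1⟩ = ⟨3, 3, 0, 2⟩ := (pureVec_mul_w6 0 0 0).1
  constructor
  · rintro ⟨g, hg0, hL, hpos, ⟨s, hs⟩, h⟩
    obtain ⟨r, v, k, l, hr, hv, hv1, hk, hl, rfl⟩ := exists_eq_smul_normOne_mul_word_of_normalises hg0 hL hpos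
    have hvn : (v * star v).re = 1 := by rw [hv1, QuaternionAlgebra.re_one]
    rw [re_smul_mul_word_mul_star, hvn, one_mul, norm_atkinLehner_word] at hs
    rw [moebius_smul_mul_word_apply hr.ne' (by rw [hvn]; exact one_pos) k l p.2.1] at h
    refine ⟨v, hv, hv1, ?_⟩
    rcases atkinLehner_word_of_norm_shape_six hk hl hr.ne' hs with ⟨rfl, rfl⟩ | ⟨rfl, rfl⟩
    · left
      rw [pow_zero, pow_zero, mul_one, moebius_rho_castQ_one_apply] at h
      exact h
    · right
      rw [pow_one, pow_one, hw6] at h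
      exact h
  · rintro ⟨v, hv, hv1, h⟩
    have hvn : (v * star v).re = 1 := by rw [hv1, QuaternionAlgebra.re_one]
    rcases h with h | h
    · have hN := normOne_mul_word_normalises hv hv1 0 0
      simp only [pow_zero, mul_one] at hN
      exact ⟨v, hN.1, hN.2.1, by rw [hvn]; exact one_pos, ⟨1, Or.inl (by rw [hvn]; norm_num)⟩, h⟩
    · have hN := normOne_mul_word_normalises hv hv1 1 1
      simp only [pow_one] at hN
      rw [hw6] at hN
      set g : ℍ[ℚ,((-1 : ℤ) : ℚ),((3 : ℤ) : ℚ)] := v * (⟨3, 3, 0, 2⟩ : ℍ[ℚ,((-1 : ℤ) : ℚ),((3 : ℤ) : ℚ)]) with hg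
      have hn : 0 < (g * star g).re := by rw [hN.2.2.2]; norm_num
      have hs : ∃ s : ℚ, (g * star g).re = s ^ 2 ∨ (g * star g).re = 6 * s ^ 2 :=
        ⟨1, Or.inr (by rw [hN.2.2.2]; norm_num)⟩
      have hgp : moebius (rho (-1) 3 (by norm_num) (castQ (-1) 3 g)) p.1 = q.1 := by
        rw [hg, moebius_rho_castQ_mul_apply (by rw [hwD]; norm_num) (by rw [hvn]; exact one_pos) p.2.1]
        exact h
      exact ⟨g, hN.1, hN.2.1, hn, hs, hgp⟩

end Words

/-! ## §3 The fibres of `Pt(t)/Γ₆ → Pt(t)/Γ₆^{(d)}`: `{[τ], [ρ(w_d)τ]}`, one class exactly at the `Z(t_d)`-points -/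

section Fibres

/-- **THE FIBRE OF `X₆ → X₆^{(2)}` THROUGH `[τ]` ON `Z(t)` IS `{[τ], [ρ(w₂)τ]}`**: `[τ′]` lies over `[τ]₂` iff
`[τ′] = [τ]` or `[τ′] = [ρ(w₂)τ]` (`Γ₆^{(2)} = ℚ^×Γ₆{1, w₂}`, `ω₂² = 1` on classes). [cite: BayerTravesa2007, §2 p. 318 («involutions of the curve `X₆`, denoted `ω_d` … `X₆^{(2)} = X₆/⟨ω₂⟩`»)] [cite: Ogg1983RealPoints, §2 (2)–(3)] -/
theorem factor_mk_eq_mk_iff_atkinLehnerQuotientTwo {t : ℤ} (p' p : {τ : ℂ // 0 < τ.im ∧ ∃ x : ℍ[ℚ,((-1 : ℤ) : ℚ),((3 : ℤ) : ℚ)],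
        x ∈ order (-1) 3 ∧ x.re = 0 ∧ (x * star x).re = t ∧ moebius (rho (-1) 3 (by norm_num) (castQ (-1) 3 x)) τ = τ}) :
    Quot.factor (fun p q : {τ : ℂ // 0 < τ.im ∧ ∃ x : ℍ[ℚ,((-1 : ℤ) : ℚ),((3 : ℤ) : ℚ)],
        x ∈ order (-1) 3 ∧ x.re = 0 ∧ (x * star x).re = t ∧ moebius (rho (-1) 3 (by norm_num) (castQ (-1) 3 x)) τ = τ} ↦
      ∃ v : ℍ[ℚ,((-1 : ℤ) : ℚ),((3 : ℤ) : ℚ)], (v ∈ order (-1) 3 ∨ v - ⟨1/2, 1/2, 1/2, -1/2⟩ ∈ order (-1) 3) ∧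
        v * star v = 1 ∧ moebius (rho (-1) 3 (by norm_num) (castQ (-1) 3 v)) p.1 = q.1)
      (fun p q : {τ : ℂ // 0 < τ.im ∧ ∃ x : ℍ[ℚ,((-1 : ℤ) : ℚ),((3 : ℤ) : ℚ)],
        x ∈ order (-1) 3 ∧ x.re = 0 ∧ (x * star x).re = t ∧ moebius (rho (-1) 3 (by norm_num) (castQ (-1) 3 x)) τ = τ} ↦
      ∃ g : ℍ[ℚ,((-1 : ℤ) : ℚ),((3 : ℤ) : ℚ)], g ≠ 0 ∧
        (∀ a : ℍ[ℚ,((-1 : ℤ) : ℚ),((3 : ℤ) : ℚ)], (a ∈ order (-1) 3 ∨ a - ⟨1/2, 1/2, 1/2, -1/2⟩ ∈ order (-1) 3) →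
          ∃ b : ℍ[ℚ,((-1 : ℤ) : ℚ),((3 : ℤ) : ℚ)], (b ∈ order (-1) 3 ∨ b - ⟨1/2, 1/2, 1/2, -1/2⟩ ∈ order (-1) 3) ∧
            g * a = b * g) ∧
        0 < (g * star g).re ∧ (∃ s : ℚ, (g * star g).re = s ^ 2 ∨ (g * star g).re = 2 * s ^ 2) ∧
        moebius (rho (-1) 3 (by norm_num) (castQ (-1) 3 g)) p.1 = q.1)
      (atkinLehnerQuotient_rel_of_specialPoints_rel t 2) (Quot.mk _ p') = Quot.mk _ p ↔
    (Quot.mk (fun p q : {τ : ℂ // 0 < τ.im ∧ ∃ x : ℍ[ℚ,((-1 : ℤ) : ℚ),((3 : ℤ) : ℚ)],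
        x ∈ order (-1) 3 ∧ x.re = 0 ∧ (x * star x).re = t ∧ moebius (rho (-1) 3 (by norm_num) (castQ (-1) 3 x)) τ = τ} ↦
      ∃ v : ℍ[ℚ,((-1 : ℤ) : ℚ),((3 : ℤ) : ℚ)], (v ∈ order (-1) 3 ∨ v - ⟨1/2, 1/2, 1/2, -1/2⟩ ∈ order (-1) 3) ∧
        v * star v = 1 ∧ moebius (rho (-1) 3 (by norm_num) (castQ (-1) 3 v)) p.1 = q.1) p' = Quot.mk _ p ∨
      Quot.mk (fun p q : {τ : ℂ // 0 < τ.im ∧ ∃ x : ℍ[ℚ,((-1 : ℤ) : ℚ),((3 : ℤ) : ℚ)],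
        x ∈ order (-1) 3 ∧ x.re = 0 ∧ (x * star x).re = t ∧ moebius (rho (-1) 3 (by norm_num) (castQ (-1) 3 x)) τ = τ} ↦
      ∃ v : ℍ[ℚ,((-1 : ℤ) : ℚ),((3 : ℤ) : ℚ)], (v ∈ order (-1) 3 ∨ v - ⟨1/2, 1/2, 1/2, -1/2⟩ ∈ order (-1) 3) ∧
        v * star v = 1 ∧ moebius (rho (-1) 3 (by norm_num) (castQ (-1) 3 v)) p.1 = q.1) p' = Quot.mk _ (⟨moebius (rho (-1) 3 (by norm_num) (castQ (-1) 3 (⟨1, 1, 0, 0⟩ : ℍ[ℚ,((-1 : ℤ) : ℚ),((3 : ℤ) : ℚ)]))) p.1, moebius_w2_mem_specialPoints p.2.1 p.2.2⟩ : {τ : ℂ // 0 < τ.im ∧ ∃ x : ℍ[ℚ,((-1 : ℤ) : ℚ),((3 : ℤ) : ℚ)],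
        x ∈ order (-1) 3 ∧ x.re = 0 ∧ (x * star x).re = t ∧ moebius (rho (-1) 3 (by norm_num) (castQ (-1) 3 x)) τ = τ})) := by
  have hiff := specialPoints_mk_eq_iff t
  show Quot.mk _ p' = Quot.mk _ p ↔ _
  rw [atkinLehnerQuotient_mk_eq_iff, atkinLehnerQuotientTwo_rel_iff, (specialPoints_mk_eq_mk_moebius_iff p' p).1, hiff, hiff]
  constructor
  · rintro ⟨v, hv, hv1, h | h⟩
    · exact Or.inl ⟨v, hv, hv1, h⟩
    · exact Or.inr ⟨v, hv, hv1, h⟩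
  · rintro (⟨v, hv, hv1, h⟩ | ⟨v, hv, hv1, h⟩)
    · exact ⟨v, hv, hv1, Or.inl h⟩
    · exact ⟨v, hv, hv1, Or.inr h⟩

/-- **ONE CLASS IN THE FIBRE OF `X₆ → X₆^{(2)}` EXACTLY AT THE `Z(1)`-POINTS**: `#{[τ], [ρ(w₂)τ]} = 1 ⟺ ω₂[τ] = [τ] ⟺
τ ∈ Pt(1)` (Ogg's fixed points of `w(2)`; `…XSixSpecialPointsBurnside`). [cite: Ogg1983RealPoints, §2 pp. 283–284 and (3)] [cite: BayerTravesa2007, §2 p. 318 and §7] -/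
theorem card_fibre_atkinLehnerQuotientTwo_eq_one_iff {t : ℤ} (p : {τ : ℂ // 0 < τ.im ∧ ∃ x : ℍ[ℚ,((-1 : ℤ) : ℚ),((3 : ℤ) : ℚ)],
        x ∈ order (-1) 3 ∧ x.re = 0 ∧ (x * star x).re = t ∧ moebius (rho (-1) 3 (by norm_num) (castQ (-1) 3 x)) τ = τ}) :
    Nat.card {a : (Quot (fun p q : {τ : ℂ // 0 < τ.im ∧ ∃ x : ℍ[ℚ,((-1 : ℤ) : ℚ),((3 : ℤ) : ℚ)],
        x ∈ order (-1) 3 ∧ x.re = 0 ∧ (x * star x).re = t ∧ moebius (rho (-1) 3 (by norm_num) (castQ (-1) 3 x)) τ = τ} ↦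
      ∃ v : ℍ[ℚ,((-1 : ℤ) : ℚ),((3 : ℤ) : ℚ)], (v ∈ order (-1) 3 ∨ v - ⟨1/2, 1/2, 1/2, -1/2⟩ ∈ order (-1) 3) ∧
        v * star v = 1 ∧ moebius (rho (-1) 3 (by norm_num) (castQ (-1) 3 v)) p.1 = q.1)) //
      Quot.factor (fun p q : {τ : ℂ // 0 < τ.im ∧ ∃ x : ℍ[ℚ,((-1 : ℤ) : ℚ),((3 : ℤ) : ℚ)],
        x ∈ order (-1) 3 ∧ x.re = 0 ∧ (x * star x).re = t ∧ moebius (rho (-1) 3 (by norm_num) (castQ (-1) 3 x)) τ = τ} ↦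
      ∃ v : ℍ[ℚ,((-1 : ℤ) : ℚ),((3 : ℤ) : ℚ)], (v ∈ order (-1) 3 ∨ v - ⟨1/2, 1/2, 1/2, -1/2⟩ ∈ order (-1) 3) ∧
        v * star v = 1 ∧ moebius (rho (-1) 3 (by norm_num) (castQ (-1) 3 v)) p.1 = q.1)
      (fun p q : {τ : ℂ // 0 < τ.im ∧ ∃ x : ℍ[ℚ,((-1 : ℤ) : ℚ),((3 : ℤ) : ℚ)],
        x ∈ order (-1) 3 ∧ x.re = 0 ∧ (x * star x).re = t ∧ moebius (rho (-1) 3 (by norm_num) (castQ (-1) 3 x)) τ = τ} ↦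
      ∃ g : ℍ[ℚ,((-1 : ℤ) : ℚ),((3 : ℤ) : ℚ)], g ≠ 0 ∧
        (∀ a : ℍ[ℚ,((-1 : ℤ) : ℚ),((3 : ℤ) : ℚ)], (a ∈ order (-1) 3 ∨ a - ⟨1/2, 1/2, 1/2, -1/2⟩ ∈ order (-1) 3) →
          ∃ b : ℍ[ℚ,((-1 : ℤ) : ℚ),((3 : ℤ) : ℚ)], (b ∈ order (-1) 3 ∨ b - ⟨1/2, 1/2, 1/2, -1/2⟩ ∈ order (-1) 3) ∧
            g * a = b * g) ∧
        0 < (g * star g).re ∧ (∃ s : ℚ, (g * star g).re = s ^ 2 ∨ (g * star g).re = 2 * s ^ 2) ∧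
        moebius (rho (-1) 3 (by norm_num) (castQ (-1) 3 g)) p.1 = q.1)
      (atkinLehnerQuotient_rel_of_specialPoints_rel t 2) a = Quot.mk _ p} = 1 ↔
    (∃ y : ℍ[ℚ,((-1 : ℤ) : ℚ),((3 : ℤ) : ℚ)], y ∈ order (-1) 3 ∧ y.re = 0 ∧ (y * star y).re = 1 ∧
        moebius (rho (-1) 3 (by norm_num) (castQ (-1) 3 y)) p.1 = p.1) := by
  have hF : ∀ b : (Quot (fun p q : {τ : ℂ // 0 < τ.im ∧ ∃ x : ℍ[ℚ,((-1 : ℤ) : ℚ),((3 : ℤ) : ℚ)],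
        x ∈ order (-1) 3 ∧ x.re = 0 ∧ (x * star x).re = t ∧ moebius (rho (-1) 3 (by norm_num) (castQ (-1) 3 x)) τ = τ} ↦
      ∃ v : ℍ[ℚ,((-1 : ℤ) : ℚ),((3 : ℤ) : ℚ)], (v ∈ order (-1) 3 ∨ v - ⟨1/2, 1/2, 1/2, -1/2⟩ ∈ order (-1) 3) ∧
        v * star v = 1 ∧ moebius (rho (-1) 3 (by norm_num) (castQ (-1) 3 v)) p.1 = q.1)),
      Quot.factor (fun p q : {τ : ℂ // 0 < τ.im ∧ ∃ x : ℍ[ℚ,((-1 : ℤ) : ℚ),((3 : ℤ) : ℚ)],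
        x ∈ order (-1) 3 ∧ x.re = 0 ∧ (x * star x).re = t ∧ moebius (rho (-1) 3 (by norm_num) (castQ (-1) 3 x)) τ = τ} ↦
      ∃ v : ℍ[ℚ,((-1 : ℤ) : ℚ),((3 : ℤ) : ℚ)], (v ∈ order (-1) 3 ∨ v - ⟨1/2, 1/2, 1/2, -1/2⟩ ∈ order (-1) 3) ∧
        v * star v = 1 ∧ moebius (rho (-1) 3 (by norm_num) (castQ (-1) 3 v)) p.1 = q.1)
      (fun p q : {τ : ℂ // 0 < τ.im ∧ ∃ x : ℍ[ℚ,((-1 : ℤ) : ℚ),((3 : ℤ) : ℚ)],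
        x ∈ order (-1) 3 ∧ x.re = 0 ∧ (x * star x).re = t ∧ moebius (rho (-1) 3 (by norm_num) (castQ (-1) 3 x)) τ = τ} ↦
      ∃ g : ℍ[ℚ,((-1 : ℤ) : ℚ),((3 : ℤ) : ℚ)], g ≠ 0 ∧
        (∀ a : ℍ[ℚ,((-1 : ℤ) : ℚ),((3 : ℤ) : ℚ)], (a ∈ order (-1) 3 ∨ a - ⟨1/2, 1/2, 1/2, -1/2⟩ ∈ order (-1) 3) →
          ∃ b : ℍ[ℚ,((-1 : ℤ) : ℚ),((3 : ℤ) : ℚ)], (b ∈ order (-1) 3 ∨ b - ⟨1/2, 1/2, 1/2, -1/2⟩ ∈ order (-1) 3) ∧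
            g * a = b * g) ∧
        0 < (g * star g).re ∧ (∃ s : ℚ, (g * star g).re = s ^ 2 ∨ (g * star g).re = 2 * s ^ 2) ∧
        moebius (rho (-1) 3 (by norm_num) (castQ (-1) 3 g)) p.1 = q.1)
      (atkinLehnerQuotient_rel_of_specialPoints_rel t 2) b = Quot.mk _ p ↔
      (b = Quot.mk _ p ∨ b = Quot.mk _ (⟨moebius (rho (-1) 3 (by norm_num) (castQ (-1) 3 (⟨1, 1, 0, 0⟩ : ℍ[ℚ,((-1 : ℤ) : ℚ),((3 : ℤ) : ℚ)]))) p.1, moebius_w2_mem_specialPoints p.2.1 p.2.2⟩ : {τ : ℂ // 0 < τ.im ∧ ∃ x : ℍ[ℚ,((-1 : ℤ) : ℚ),((3 : ℤ) : ℚ)],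
        x ∈ order (-1) 3 ∧ x.re = 0 ∧ (x * star x).re = t ∧ moebius (rho (-1) 3 (by norm_num) (castQ (-1) 3 x)) τ = τ})) := by
    intro b
    induction b using Quot.ind with
    | _ p' => exact factor_mk_eq_mk_iff_atkinLehnerQuotientTwo p' p
  rw [(card_eq_one_iff_of_iff_eq_or_eq₂₁ hF).1, specialPoints_mk_eq_iff, ← normOne_moebius_w2_fixed_iff p.2.1]

/-- **TWO CLASSES IN THE FIBRE OF `X₆ → X₆^{(2)}` AWAY FROM `Z(1)`**: `ω₂` moves `[τ]` iff `τ ∉ Pt(1)`. [cite: Ogg1983RealPoints, §2 pp. 283–284 and (3)] [cite: BayerTravesa2007, §2 p. 318] -/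
theorem card_fibre_atkinLehnerQuotientTwo_eq_two_iff {t : ℤ} (p : {τ : ℂ // 0 < τ.im ∧ ∃ x : ℍ[ℚ,((-1 : ℤ) : ℚ),((3 : ℤ) : ℚ)],
        x ∈ order (-1) 3 ∧ x.re = 0 ∧ (x * star x).re = t ∧ moebius (rho (-1) 3 (by norm_num) (castQ (-1) 3 x)) τ = τ}) :
    Nat.card {a : (Quot (fun p q : {τ : ℂ // 0 < τ.im ∧ ∃ x : ℍ[ℚ,((-1 : ℤ) : ℚ),((3 : ℤ) : ℚ)],
        x ∈ order (-1) 3 ∧ x.re = 0 ∧ (x * star x).re = t ∧ moebius (rho (-1) 3 (by norm_num) (castQ (-1) 3 x)) τ = τ} ↦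
      ∃ v : ℍ[ℚ,((-1 : ℤ) : ℚ),((3 : ℤ) : ℚ)], (v ∈ order (-1) 3 ∨ v - ⟨1/2, 1/2, 1/2, -1/2⟩ ∈ order (-1) 3) ∧
        v * star v = 1 ∧ moebius (rho (-1) 3 (by norm_num) (castQ (-1) 3 v)) p.1 = q.1)) //
      Quot.factor (fun p q : {τ : ℂ // 0 < τ.im ∧ ∃ x : ℍ[ℚ,((-1 : ℤ) : ℚ),((3 : ℤ) : ℚ)],
        x ∈ order (-1) 3 ∧ x.re = 0 ∧ (x * star x).re = t ∧ moebius (rho (-1) 3 (by norm_num) (castQ (-1) 3 x)) τ = τ} ↦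
      ∃ v : ℍ[ℚ,((-1 : ℤ) : ℚ),((3 : ℤ) : ℚ)], (v ∈ order (-1) 3 ∨ v - ⟨1/2, 1/2, 1/2, -1/2⟩ ∈ order (-1) 3) ∧
        v * star v = 1 ∧ moebius (rho (-1) 3 (by norm_num) (castQ (-1) 3 v)) p.1 = q.1)
      (fun p q : {τ : ℂ // 0 < τ.im ∧ ∃ x : ℍ[ℚ,((-1 : ℤ) : ℚ),((3 : ℤ) : ℚ)],
        x ∈ order (-1) 3 ∧ x.re = 0 ∧ (x * star x).re = t ∧ moebius (rho (-1) 3 (by norm_num) (castQ (-1) 3 x)) τ = τ} ↦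
      ∃ g : ℍ[ℚ,((-1 : ℤ) : ℚ),((3 : ℤ) : ℚ)], g ≠ 0 ∧
        (∀ a : ℍ[ℚ,((-1 : ℤ) : ℚ),((3 : ℤ) : ℚ)], (a ∈ order (-1) 3 ∨ a - ⟨1/2, 1/2, 1/2, -1/2⟩ ∈ order (-1) 3) →
          ∃ b : ℍ[ℚ,((-1 : ℤ) : ℚ),((3 : ℤ) : ℚ)], (b ∈ order (-1) 3 ∨ b - ⟨1/2, 1/2, 1/2, -1/2⟩ ∈ order (-1) 3) ∧
            g * a = b * g) ∧
        0 < (g * star g).re ∧ (∃ s : ℚ, (g * star g).re = s ^ 2 ∨ (g * star g).re = 2 * s ^ 2) ∧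
        moebius (rho (-1) 3 (by norm_num) (castQ (-1) 3 g)) p.1 = q.1)
      (atkinLehnerQuotient_rel_of_specialPoints_rel t 2) a = Quot.mk _ p} = 2 ↔
    ¬ (∃ y : ℍ[ℚ,((-1 : ℤ) : ℚ),((3 : ℤ) : ℚ)], y ∈ order (-1) 3 ∧ y.re = 0 ∧ (y * star y).re = 1 ∧
        moebius (rho (-1) 3 (by norm_num) (castQ (-1) 3 y)) p.1 = p.1) := by
  have hF : ∀ b : (Quot (fun p q : {τ : ℂ // 0 < τ.im ∧ ∃ x : ℍ[ℚ,((-1 : ℤ) : ℚ),((3 : ℤ) : ℚ)],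
        x ∈ order (-1) 3 ∧ x.re = 0 ∧ (x * star x).re = t ∧ moebius (rho (-1) 3 (by norm_num) (castQ (-1) 3 x)) τ = τ} ↦
      ∃ v : ℍ[ℚ,((-1 : ℤ) : ℚ),((3 : ℤ) : ℚ)], (v ∈ order (-1) 3 ∨ v - ⟨1/2, 1/2, 1/2, -1/2⟩ ∈ order (-1) 3) ∧
        v * star v = 1 ∧ moebius (rho (-1) 3 (by norm_num) (castQ (-1) 3 v)) p.1 = q.1)),
      Quot.factor (fun p q : {τ : ℂ // 0 < τ.im ∧ ∃ x : ℍ[ℚ,((-1 : ℤ) : ℚ),((3 : ℤ) : ℚ)],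
        x ∈ order (-1) 3 ∧ x.re = 0 ∧ (x * star x).re = t ∧ moebius (rho (-1) 3 (by norm_num) (castQ (-1) 3 x)) τ = τ} ↦
      ∃ v : ℍ[ℚ,((-1 : ℤ) : ℚ),((3 : ℤ) : ℚ)], (v ∈ order (-1) 3 ∨ v - ⟨1/2, 1/2, 1/2, -1/2⟩ ∈ order (-1) 3) ∧
        v * star v = 1 ∧ moebius (rho (-1) 3 (by norm_num) (castQ (-1) 3 v)) p.1 = q.1)
      (fun p q : {τ : ℂ // 0 < τ.im ∧ ∃ x : ℍ[ℚ,((-1 : ℤ) : ℚ),((3 : ℤ) : ℚ)],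
        x ∈ order (-1) 3 ∧ x.re = 0 ∧ (x * star x).re = t ∧ moebius (rho (-1) 3 (by norm_num) (castQ (-1) 3 x)) τ = τ} ↦
      ∃ g : ℍ[ℚ,((-1 : ℤ) : ℚ),((3 : ℤ) : ℚ)], g ≠ 0 ∧
        (∀ a : ℍ[ℚ,((-1 : ℤ) : ℚ),((3 : ℤ) : ℚ)], (a ∈ order (-1) 3 ∨ a - ⟨1/2, 1/2, 1/2, -1/2⟩ ∈ order (-1) 3) →
          ∃ b : ℍ[ℚ,((-1 : ℤ) : ℚ),((3 : ℤ) : ℚ)], (b ∈ order (-1) 3 ∨ b - ⟨1/2, 1/2, 1/2, -1/2⟩ ∈ order (-1) 3) ∧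
            g * a = b * g) ∧
        0 < (g * star g).re ∧ (∃ s : ℚ, (g * star g).re = s ^ 2 ∨ (g * star g).re = 2 * s ^ 2) ∧
        moebius (rho (-1) 3 (by norm_num) (castQ (-1) 3 g)) p.1 = q.1)
      (atkinLehnerQuotient_rel_of_specialPoints_rel t 2) b = Quot.mk _ p ↔
      (b = Quot.mk _ p ∨ b = Quot.mk _ (⟨moebius (rho (-1) 3 (by norm_num) (castQ (-1) 3 (⟨1, 1, 0, 0⟩ : ℍ[ℚ,((-1 : ℤ) : ℚ),((3 : ℤ) : ℚ)]))) p.1, moebius_w2_mem_specialPoints p.2.1 p.2.2⟩ : {τ : ℂ // 0 < τ.im ∧ ∃ x : ℍ[ℚ,((-1 : ℤ) : ℚ),((3 : ℤ) : ℚ)],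
        x ∈ order (-1) 3 ∧ x.re = 0 ∧ (x * star x).re = t ∧ moebius (rho (-1) 3 (by norm_num) (castQ (-1) 3 x)) τ = τ})) := by
    intro b
    induction b using Quot.ind with
    | _ p' => exact factor_mk_eq_mk_iff_atkinLehnerQuotientTwo p' p
  rw [(card_eq_one_iff_of_iff_eq_or_eq₂₁ hF).2.1, ← card_fibre_atkinLehnerQuotientTwo_eq_one_iff p,
    (card_eq_one_iff_of_iff_eq_or_eq₂₁ hF).1]

/-- Every fibre of `X₆ → X₆^{(2)}` on `Z(t)` has one or two classes (a double cover). [cite: Ogg1983RealPoints, §2 (3)–(4)] [cite: BayerTravesa2007, §2 p. 318] -/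
theorem card_fibre_atkinLehnerQuotientTwo_eq_one_or_eq_two {t : ℤ} (c : (Quot (fun p q : {τ : ℂ // 0 < τ.im ∧ ∃ x : ℍ[ℚ,((-1 : ℤ) : ℚ),((3 : ℤ) : ℚ)],
        x ∈ order (-1) 3 ∧ x.re = 0 ∧ (x * star x).re = t ∧ moebius (rho (-1) 3 (by norm_num) (castQ (-1) 3 x)) τ = τ} ↦
      ∃ g : ℍ[ℚ,((-1 : ℤ) : ℚ),((3 : ℤ) : ℚ)], g ≠ 0 ∧
        (∀ a : ℍ[ℚ,((-1 : ℤ) : ℚ),((3 : ℤ) : ℚ)], (a ∈ order (-1) 3 ∨ a - ⟨1/2, 1/2, 1/2, -1/2⟩ ∈ order (-1) 3) →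
          ∃ b : ℍ[ℚ,((-1 : ℤ) : ℚ),((3 : ℤ) : ℚ)], (b ∈ order (-1) 3 ∨ b - ⟨1/2, 1/2, 1/2, -1/2⟩ ∈ order (-1) 3) ∧
            g * a = b * g) ∧
        0 < (g * star g).re ∧ (∃ s : ℚ, (g * star g).re = s ^ 2 ∨ (g * star g).re = 2 * s ^ 2) ∧
        moebius (rho (-1) 3 (by norm_num) (castQ (-1) 3 g)) p.1 = q.1))) :
    Nat.card {a : (Quot (fun p q : {τ : ℂ // 0 < τ.im ∧ ∃ x : ℍ[ℚ,((-1 : ℤ) : ℚ),((3 : ℤ) : ℚ)],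
        x ∈ order (-1) 3 ∧ x.re = 0 ∧ (x * star x).re = t ∧ moebius (rho (-1) 3 (by norm_num) (castQ (-1) 3 x)) τ = τ} ↦
      ∃ v : ℍ[ℚ,((-1 : ℤ) : ℚ),((3 : ℤ) : ℚ)], (v ∈ order (-1) 3 ∨ v - ⟨1/2, 1/2, 1/2, -1/2⟩ ∈ order (-1) 3) ∧
        v * star v = 1 ∧ moebius (rho (-1) 3 (by norm_num) (castQ (-1) 3 v)) p.1 = q.1)) //
      Quot.factor (fun p q : {τ : ℂ // 0 < τ.im ∧ ∃ x : ℍ[ℚ,((-1 : ℤ) : ℚ),((3 : ℤ) : ℚ)],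
        x ∈ order (-1) 3 ∧ x.re = 0 ∧ (x * star x).re = t ∧ moebius (rho (-1) 3 (by norm_num) (castQ (-1) 3 x)) τ = τ} ↦
      ∃ v : ℍ[ℚ,((-1 : ℤ) : ℚ),((3 : ℤ) : ℚ)], (v ∈ order (-1) 3 ∨ v - ⟨1/2, 1/2, 1/2, -1/2⟩ ∈ order (-1) 3) ∧
        v * star v = 1 ∧ moebius (rho (-1) 3 (by norm_num) (castQ (-1) 3 v)) p.1 = q.1)
      (fun p q : {τ : ℂ // 0 < τ.im ∧ ∃ x : ℍ[ℚ,((-1 : ℤ) : ℚ),((3 : ℤ) : ℚ)],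
        x ∈ order (-1) 3 ∧ x.re = 0 ∧ (x * star x).re = t ∧ moebius (rho (-1) 3 (by norm_num) (castQ (-1) 3 x)) τ = τ} ↦
      ∃ g : ℍ[ℚ,((-1 : ℤ) : ℚ),((3 : ℤ) : ℚ)], g ≠ 0 ∧
        (∀ a : ℍ[ℚ,((-1 : ℤ) : ℚ),((3 : ℤ) : ℚ)], (a ∈ order (-1) 3 ∨ a - ⟨1/2, 1/2, 1/2, -1/2⟩ ∈ order (-1) 3) →
          ∃ b : ℍ[ℚ,((-1 : ℤ) : ℚ),((3 : ℤ) : ℚ)], (b ∈ order (-1) 3 ∨ b - ⟨1/2, 1/2, 1/2, -1/2⟩ ∈ order (-1) 3) ∧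
            g * a = b * g) ∧
        0 < (g * star g).re ∧ (∃ s : ℚ, (g * star g).re = s ^ 2 ∨ (g * star g).re = 2 * s ^ 2) ∧
        moebius (rho (-1) 3 (by norm_num) (castQ (-1) 3 g)) p.1 = q.1)
      (atkinLehnerQuotient_rel_of_specialPoints_rel t 2) a = c} = 1 ∨
    Nat.card {a : (Quot (fun p q : {τ : ℂ // 0 < τ.im ∧ ∃ x : ℍ[ℚ,((-1 : ℤ) : ℚ),((3 : ℤ) : ℚ)],
        x ∈ order (-1) 3 ∧ x.re = 0 ∧ (x * star x).re = t ∧ moebius (rho (-1) 3 (by norm_num) (castQ (-1) 3 x)) τ = τ} ↦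
      ∃ v : ℍ[ℚ,((-1 : ℤ) : ℚ),((3 : ℤ) : ℚ)], (v ∈ order (-1) 3 ∨ v - ⟨1/2, 1/2, 1/2, -1/2⟩ ∈ order (-1) 3) ∧
        v * star v = 1 ∧ moebius (rho (-1) 3 (by norm_num) (castQ (-1) 3 v)) p.1 = q.1)) //
      Quot.factor (fun p q : {τ : ℂ // 0 < τ.im ∧ ∃ x : ℍ[ℚ,((-1 : ℤ) : ℚ),((3 : ℤ) : ℚ)],
        x ∈ order (-1) 3 ∧ x.re = 0 ∧ (x * star x).re = t ∧ moebius (rho (-1) 3 (by norm_num) (castQ (-1) 3 x)) τ = τ} ↦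
      ∃ v : ℍ[ℚ,((-1 : ℤ) : ℚ),((3 : ℤ) : ℚ)], (v ∈ order (-1) 3 ∨ v - ⟨1/2, 1/2, 1/2, -1/2⟩ ∈ order (-1) 3) ∧
        v * star v = 1 ∧ moebius (rho (-1) 3 (by norm_num) (castQ (-1) 3 v)) p.1 = q.1)
      (fun p q : {τ : ℂ // 0 < τ.im ∧ ∃ x : ℍ[ℚ,((-1 : ℤ) : ℚ),((3 : ℤ) : ℚ)],
        x ∈ order (-1) 3 ∧ x.re = 0 ∧ (x * star x).re = t ∧ moebius (rho (-1) 3 (by norm_num) (castQ (-1) 3 x)) τ = τ} ↦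
      ∃ g : ℍ[ℚ,((-1 : ℤ) : ℚ),((3 : ℤ) : ℚ)], g ≠ 0 ∧
        (∀ a : ℍ[ℚ,((-1 : ℤ) : ℚ),((3 : ℤ) : ℚ)], (a ∈ order (-1) 3 ∨ a - ⟨1/2, 1/2, 1/2, -1/2⟩ ∈ order (-1) 3) →
          ∃ b : ℍ[ℚ,((-1 : ℤ) : ℚ),((3 : ℤ) : ℚ)], (b ∈ order (-1) 3 ∨ b - ⟨1/2, 1/2, 1/2, -1/2⟩ ∈ order (-1) 3) ∧
            g * a = b * g) ∧
        0 < (g * star g).re ∧ (∃ s : ℚ, (g * star g).re = s ^ 2 ∨ (g * star g).re = 2 * s ^ 2) ∧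
        moebius (rho (-1) 3 (by norm_num) (castQ (-1) 3 g)) p.1 = q.1)
      (atkinLehnerQuotient_rel_of_specialPoints_rel t 2) a = c} = 2 := by
  induction c using Quot.ind with
  | _ p =>
    have hF : ∀ b : (Quot (fun p q : {τ : ℂ // 0 < τ.im ∧ ∃ x : ℍ[ℚ,((-1 : ℤ) : ℚ),((3 : ℤ) : ℚ)],
        x ∈ order (-1) 3 ∧ x.re = 0 ∧ (x * star x).re = t ∧ moebius (rho (-1) 3 (by norm_num) (castQ (-1) 3 x)) τ = τ} ↦
      ∃ v : ℍ[ℚ,((-1 : ℤ) : ℚ),((3 : ℤ) : ℚ)], (v ∈ order (-1) 3 ∨ v - ⟨1/2, 1/2, 1/2, -1/2⟩ ∈ order (-1) 3) ∧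
        v * star v = 1 ∧ moebius (rho (-1) 3 (by norm_num) (castQ (-1) 3 v)) p.1 = q.1)),
        Quot.factor (fun p q : {τ : ℂ // 0 < τ.im ∧ ∃ x : ℍ[ℚ,((-1 : ℤ) : ℚ),((3 : ℤ) : ℚ)],
        x ∈ order (-1) 3 ∧ x.re = 0 ∧ (x * star x).re = t ∧ moebius (rho (-1) 3 (by norm_num) (castQ (-1) 3 x)) τ = τ} ↦
      ∃ v : ℍ[ℚ,((-1 : ℤ) : ℚ),((3 : ℤ) : ℚ)], (v ∈ order (-1) 3 ∨ v - ⟨1/2, 1/2, 1/2, -1/2⟩ ∈ order (-1) 3) ∧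
        v * star v = 1 ∧ moebius (rho (-1) 3 (by norm_num) (castQ (-1) 3 v)) p.1 = q.1)
      (fun p q : {τ : ℂ // 0 < τ.im ∧ ∃ x : ℍ[ℚ,((-1 : ℤ) : ℚ),((3 : ℤ) : ℚ)],
        x ∈ order (-1) 3 ∧ x.re = 0 ∧ (x * star x).re = t ∧ moebius (rho (-1) 3 (by norm_num) (castQ (-1) 3 x)) τ = τ} ↦
      ∃ g : ℍ[ℚ,((-1 : ℤ) : ℚ),((3 : ℤ) : ℚ)], g ≠ 0 ∧
        (∀ a : ℍ[ℚ,((-1 : ℤ) : ℚ),((3 : ℤ) : ℚ)], (a ∈ order (-1) 3 ∨ a - ⟨1/2, 1/2, 1/2, -1/2⟩ ∈ order (-1) 3) →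
          ∃ b : ℍ[ℚ,((-1 : ℤ) : ℚ),((3 : ℤ) : ℚ)], (b ∈ order (-1) 3 ∨ b - ⟨1/2, 1/2, 1/2, -1/2⟩ ∈ order (-1) 3) ∧
            g * a = b * g) ∧
        0 < (g * star g).re ∧ (∃ s : ℚ, (g * star g).re = s ^ 2 ∨ (g * star g).re = 2 * s ^ 2) ∧
        moebius (rho (-1) 3 (by norm_num) (castQ (-1) 3 g)) p.1 = q.1)
      (atkinLehnerQuotient_rel_of_specialPoints_rel t 2) b = Quot.mk _ p ↔
        (b = Quot.mk _ p ∨ b = Quot.mk _ (⟨moebius (rho (-1) 3 (by norm_num) (castQ (-1) 3 (⟨1, 1, 0, 0⟩ : ℍ[ℚ,((-1 : ℤ) : ℚ),((3 : ℤ) : ℚ)]))) p.1, moebius_w2_mem_specialPoints p.2.1 p.2.2⟩ : {τ : ℂ // 0 < τ.im ∧ ∃ x : ℍ[ℚ,((-1 : ℤ) : ℚ),((3 : ℤ) : ℚ)],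
        x ∈ order (-1) 3 ∧ x.re = 0 ∧ (x * star x).re = t ∧ moebius (rho (-1) 3 (by norm_num) (castQ (-1) 3 x)) τ = τ})) := by
      intro b
      induction b using Quot.ind with
      | _ p' => exact factor_mk_eq_mk_iff_atkinLehnerQuotientTwo p' p
    exact (card_eq_one_iff_of_iff_eq_or_eq₂₁ hF).2.2

/-- **CLASS EQUATION OF `X₆ → X₆^{(2)}` ON `Z(t)`** (`t > 0`): `#(Pt(t)/Γ₆) + #{one-class fibres} = 2·#(Pt(t)/Γ₆^{(2)})`.
[cite: Ogg1983RealPoints, §2 (3)–(4)] [cite: BayerTravesa2007, §2 p. 318] -/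
theorem card_specialPoints_add_card_oneFibres_eq_two_mul_card_atkinLehnerQuotientTwo {t : ℤ} (ht : 0 < t) :
    Nat.card (Quot (fun p q : {τ : ℂ // 0 < τ.im ∧ ∃ x : ℍ[ℚ,((-1 : ℤ) : ℚ),((3 : ℤ) : ℚ)],
        x ∈ order (-1) 3 ∧ x.re = 0 ∧ (x * star x).re = t ∧ moebius (rho (-1) 3 (by norm_num) (castQ (-1) 3 x)) τ = τ} ↦
      ∃ v : ℍ[ℚ,((-1 : ℤ) : ℚ),((3 : ℤ) : ℚ)], (v ∈ order (-1) 3 ∨ v - ⟨1/2, 1/2, 1/2, -1/2⟩ ∈ order (-1) 3) ∧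
        v * star v = 1 ∧ moebius (rho (-1) 3 (by norm_num) (castQ (-1) 3 v)) p.1 = q.1)) +
    Nat.card {c : (Quot (fun p q : {τ : ℂ // 0 < τ.im ∧ ∃ x : ℍ[ℚ,((-1 : ℤ) : ℚ),((3 : ℤ) : ℚ)],
        x ∈ order (-1) 3 ∧ x.re = 0 ∧ (x * star x).re = t ∧ moebius (rho (-1) 3 (by norm_num) (castQ (-1) 3 x)) τ = τ} ↦
      ∃ g : ℍ[ℚ,((-1 : ℤ) : ℚ),((3 : ℤ) : ℚ)], g ≠ 0 ∧
        (∀ a : ℍ[ℚ,((-1 : ℤ) : ℚ),((3 : ℤ) : ℚ)], (a ∈ order (-1) 3 ∨ a - ⟨1/2, 1/2, 1/2, -1/2⟩ ∈ order (-1) 3) →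
          ∃ b : ℍ[ℚ,((-1 : ℤ) : ℚ),((3 : ℤ) : ℚ)], (b ∈ order (-1) 3 ∨ b - ⟨1/2, 1/2, 1/2, -1/2⟩ ∈ order (-1) 3) ∧
            g * a = b * g) ∧
        0 < (g * star g).re ∧ (∃ s : ℚ, (g * star g).re = s ^ 2 ∨ (g * star g).re = 2 * s ^ 2) ∧
        moebius (rho (-1) 3 (by norm_num) (castQ (-1) 3 g)) p.1 = q.1)) //
      Nat.card {a : (Quot (fun p q : {τ : ℂ // 0 < τ.im ∧ ∃ x : ℍ[ℚ,((-1 : ℤ) : ℚ),((3 : ℤ) : ℚ)],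
        x ∈ order (-1) 3 ∧ x.re = 0 ∧ (x * star x).re = t ∧ moebius (rho (-1) 3 (by norm_num) (castQ (-1) 3 x)) τ = τ} ↦
      ∃ v : ℍ[ℚ,((-1 : ℤ) : ℚ),((3 : ℤ) : ℚ)], (v ∈ order (-1) 3 ∨ v - ⟨1/2, 1/2, 1/2, -1/2⟩ ∈ order (-1) 3) ∧
        v * star v = 1 ∧ moebius (rho (-1) 3 (by norm_num) (castQ (-1) 3 v)) p.1 = q.1)) //
        Quot.factor (fun p q : {τ : ℂ // 0 < τ.im ∧ ∃ x : ℍ[ℚ,((-1 : ℤ) : ℚ),((3 : ℤ) : ℚ)],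
        x ∈ order (-1) 3 ∧ x.re = 0 ∧ (x * star x).re = t ∧ moebius (rho (-1) 3 (by norm_num) (castQ (-1) 3 x)) τ = τ} ↦
      ∃ v : ℍ[ℚ,((-1 : ℤ) : ℚ),((3 : ℤ) : ℚ)], (v ∈ order (-1) 3 ∨ v - ⟨1/2, 1/2, 1/2, -1/2⟩ ∈ order (-1) 3) ∧
        v * star v = 1 ∧ moebius (rho (-1) 3 (by norm_num) (castQ (-1) 3 v)) p.1 = q.1)
      (fun p q : {τ : ℂ // 0 < τ.im ∧ ∃ x : ℍ[ℚ,((-1 : ℤ) : ℚ),((3 : ℤ) : ℚ)],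
        x ∈ order (-1) 3 ∧ x.re = 0 ∧ (x * star x).re = t ∧ moebius (rho (-1) 3 (by norm_num) (castQ (-1) 3 x)) τ = τ} ↦
      ∃ g : ℍ[ℚ,((-1 : ℤ) : ℚ),((3 : ℤ) : ℚ)], g ≠ 0 ∧
        (∀ a : ℍ[ℚ,((-1 : ℤ) : ℚ),((3 : ℤ) : ℚ)], (a ∈ order (-1) 3 ∨ a - ⟨1/2, 1/2, 1/2, -1/2⟩ ∈ order (-1) 3) →
          ∃ b : ℍ[ℚ,((-1 : ℤ) : ℚ),((3 : ℤ) : ℚ)], (b ∈ order (-1) 3 ∨ b - ⟨1/2, 1/2, 1/2, -1/2⟩ ∈ order (-1) 3) ∧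
            g * a = b * g) ∧
        0 < (g * star g).re ∧ (∃ s : ℚ, (g * star g).re = s ^ 2 ∨ (g * star g).re = 2 * s ^ 2) ∧
        moebius (rho (-1) 3 (by norm_num) (castQ (-1) 3 g)) p.1 = q.1)
      (atkinLehnerQuotient_rel_of_specialPoints_rel t 2) a = c} = 1} =
    2 * Nat.card (Quot (fun p q : {τ : ℂ // 0 < τ.im ∧ ∃ x : ℍ[ℚ,((-1 : ℤ) : ℚ),((3 : ℤ) : ℚ)],
        x ∈ order (-1) 3 ∧ x.re = 0 ∧ (x * star x).re = t ∧ moebius (rho (-1) 3 (by norm_num) (castQ (-1) 3 x)) τ = τ} ↦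
      ∃ g : ℍ[ℚ,((-1 : ℤ) : ℚ),((3 : ℤ) : ℚ)], g ≠ 0 ∧
        (∀ a : ℍ[ℚ,((-1 : ℤ) : ℚ),((3 : ℤ) : ℚ)], (a ∈ order (-1) 3 ∨ a - ⟨1/2, 1/2, 1/2, -1/2⟩ ∈ order (-1) 3) →
          ∃ b : ℍ[ℚ,((-1 : ℤ) : ℚ),((3 : ℤ) : ℚ)], (b ∈ order (-1) 3 ∨ b - ⟨1/2, 1/2, 1/2, -1/2⟩ ∈ order (-1) 3) ∧
            g * a = b * g) ∧
        0 < (g * star g).re ∧ (∃ s : ℚ, (g * star g).re = s ^ 2 ∨ (g * star g).re = 2 * s ^ 2) ∧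
        moebius (rho (-1) 3 (by norm_num) (castQ (-1) 3 g)) p.1 = q.1)) := by
  haveI := finite_specialPoints ht
  haveI := finite_atkinLehnerQuotient ht 2
  exact card_add_card_eq_two_mul₂₁ _ card_fibre_atkinLehnerQuotientTwo_eq_one_or_eq_two

/-- **THE ONE-CLASS FIBRES OF `X₆ → X₆^{(2)}` ON `Z(t)` ARE COUNTED BY `#((Pt(t) ∩ Pt(1))/Γ₆)`** (`t > 0`) — the fibrewise
count agrees with Burnside's (`…XSixAtkinLehnerQuotientsSpecialPoints`:
`#(Pt(t)/Γ₆) + #((Pt(t) ∩ Pt(1))/Γ₆) = 2·#(Pt(t)/Γ₆^{(2)})`). [cite: Ogg1983RealPoints, §2 (3)–(4)] [cite: BayerTravesa2007, §2 p. 318 and §7 Table 9] -/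
theorem card_oneFibres_atkinLehnerQuotientTwo_eq_card_inter {t : ℤ} (ht : 0 < t) :
    Nat.card {c : (Quot (fun p q : {τ : ℂ // 0 < τ.im ∧ ∃ x : ℍ[ℚ,((-1 : ℤ) : ℚ),((3 : ℤ) : ℚ)],
        x ∈ order (-1) 3 ∧ x.re = 0 ∧ (x * star x).re = t ∧ moebius (rho (-1) 3 (by norm_num) (castQ (-1) 3 x)) τ = τ} ↦
      ∃ g : ℍ[ℚ,((-1 : ℤ) : ℚ),((3 : ℤ) : ℚ)], g ≠ 0 ∧
        (∀ a : ℍ[ℚ,((-1 : ℤ) : ℚ),((3 : ℤ) : ℚ)], (a ∈ order (-1) 3 ∨ a - ⟨1/2, 1/2, 1/2, -1/2⟩ ∈ order (-1) 3) →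
          ∃ b : ℍ[ℚ,((-1 : ℤ) : ℚ),((3 : ℤ) : ℚ)], (b ∈ order (-1) 3 ∨ b - ⟨1/2, 1/2, 1/2, -1/2⟩ ∈ order (-1) 3) ∧
            g * a = b * g) ∧
        0 < (g * star g).re ∧ (∃ s : ℚ, (g * star g).re = s ^ 2 ∨ (g * star g).re = 2 * s ^ 2) ∧
        moebius (rho (-1) 3 (by norm_num) (castQ (-1) 3 g)) p.1 = q.1)) //
      Nat.card {a : (Quot (fun p q : {τ : ℂ // 0 < τ.im ∧ ∃ x : ℍ[ℚ,((-1 : ℤ) : ℚ),((3 : ℤ) : ℚ)],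
        x ∈ order (-1) 3 ∧ x.re = 0 ∧ (x * star x).re = t ∧ moebius (rho (-1) 3 (by norm_num) (castQ (-1) 3 x)) τ = τ} ↦
      ∃ v : ℍ[ℚ,((-1 : ℤ) : ℚ),((3 : ℤ) : ℚ)], (v ∈ order (-1) 3 ∨ v - ⟨1/2, 1/2, 1/2, -1/2⟩ ∈ order (-1) 3) ∧
        v * star v = 1 ∧ moebius (rho (-1) 3 (by norm_num) (castQ (-1) 3 v)) p.1 = q.1)) //
        Quot.factor (fun p q : {τ : ℂ // 0 < τ.im ∧ ∃ x : ℍ[ℚ,((-1 : ℤ) : ℚ),((3 : ℤ) : ℚ)],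
        x ∈ order (-1) 3 ∧ x.re = 0 ∧ (x * star x).re = t ∧ moebius (rho (-1) 3 (by norm_num) (castQ (-1) 3 x)) τ = τ} ↦
      ∃ v : ℍ[ℚ,((-1 : ℤ) : ℚ),((3 : ℤ) : ℚ)], (v ∈ order (-1) 3 ∨ v - ⟨1/2, 1/2, 1/2, -1/2⟩ ∈ order (-1) 3) ∧
        v * star v = 1 ∧ moebius (rho (-1) 3 (by norm_num) (castQ (-1) 3 v)) p.1 = q.1)
      (fun p q : {τ : ℂ // 0 < τ.im ∧ ∃ x : ℍ[ℚ,((-1 : ℤ) : ℚ),((3 : ℤ) : ℚ)],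
        x ∈ order (-1) 3 ∧ x.re = 0 ∧ (x * star x).re = t ∧ moebius (rho (-1) 3 (by norm_num) (castQ (-1) 3 x)) τ = τ} ↦
      ∃ g : ℍ[ℚ,((-1 : ℤ) : ℚ),((3 : ℤ) : ℚ)], g ≠ 0 ∧
        (∀ a : ℍ[ℚ,((-1 : ℤ) : ℚ),((3 : ℤ) : ℚ)], (a ∈ order (-1) 3 ∨ a - ⟨1/2, 1/2, 1/2, -1/2⟩ ∈ order (-1) 3) →
          ∃ b : ℍ[ℚ,((-1 : ℤ) : ℚ),((3 : ℤ) : ℚ)], (b ∈ order (-1) 3 ∨ b - ⟨1/2, 1/2, 1/2, -1/2⟩ ∈ order (-1) 3) ∧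
            g * a = b * g) ∧
        0 < (g * star g).re ∧ (∃ s : ℚ, (g * star g).re = s ^ 2 ∨ (g * star g).re = 2 * s ^ 2) ∧
        moebius (rho (-1) 3 (by norm_num) (castQ (-1) 3 g)) p.1 = q.1)
      (atkinLehnerQuotient_rel_of_specialPoints_rel t 2) a = c} = 1} =
    Nat.card (Quot (fun p q : {τ : ℂ // 0 < τ.im ∧ (∃ x : ℍ[ℚ,((-1 : ℤ) : ℚ),((3 : ℤ) : ℚ)],
        x ∈ order (-1) 3 ∧ x.re = 0 ∧ (x * star x).re = t ∧ moebius (rho (-1) 3 (by norm_num) (castQ (-1) 3 x)) τ = τ) ∧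
        (∃ y : ℍ[ℚ,((-1 : ℤ) : ℚ),((3 : ℤ) : ℚ)], y ∈ order (-1) 3 ∧ y.re = 0 ∧ (y * star y).re = ((1 : ℤ) : ℚ) ∧
          moebius (rho (-1) 3 (by norm_num) (castQ (-1) 3 y)) τ = τ)} ↦
      ∃ v : ℍ[ℚ,((-1 : ℤ) : ℚ),((3 : ℤ) : ℚ)], (v ∈ order (-1) 3 ∨ v - ⟨1/2, 1/2, 1/2, -1/2⟩ ∈ order (-1) 3) ∧
        v * star v = 1 ∧ moebius (rho (-1) 3 (by norm_num) (castQ (-1) 3 v)) p.1 = q.1)) := by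
  have h1 := card_specialPoints_add_card_oneFibres_eq_two_mul_card_atkinLehnerQuotientTwo ht
  have h2 := card_specialPoints_add_card_inter_eq_two_mul_card_atkinLehnerQuotientTwo ht
  omega

/-- **THE FIBRE OF `X₆ → X₆^{(3)}` THROUGH `[τ]` ON `Z(t)` IS `{[τ], [ρ(μ)τ]}`**: `[τ′]` lies over `[τ]₃` iff
`[τ′] = [τ]` or `[τ′] = [ρ(μ)τ]` (`Γ₆^{(3)} = ℚ^×Γ₆{1, μ}`, `ω₃² = 1` on classes). [cite: BayerTravesa2007, §2 p. 318 («involutions of the curve `X₆`, denoted `ω_d` … `X₆^{(3)} = X₆/⟨ω₃⟩`»)] [cite: Ogg1983RealPoints, §2 (2)–(3)] -/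
theorem factor_mk_eq_mk_iff_atkinLehnerQuotientThree {t : ℤ} (p' p : {τ : ℂ // 0 < τ.im ∧ ∃ x : ℍ[ℚ,((-1 : ℤ) : ℚ),((3 : ℤ) : ℚ)],
        x ∈ order (-1) 3 ∧ x.re = 0 ∧ (x * star x).re = t ∧ moebius (rho (-1) 3 (by norm_num) (castQ (-1) 3 x)) τ = τ}) :
    Quot.factor (fun p q : {τ : ℂ // 0 < τ.im ∧ ∃ x : ℍ[ℚ,((-1 : ℤ) : ℚ),((3 : ℤ) : ℚ)],
        x ∈ order (-1) 3 ∧ x.re = 0 ∧ (x * star x).re = t ∧ moebius (rho (-1) 3 (by norm_num) (castQ (-1) 3 x)) τ = τ} ↦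
      ∃ v : ℍ[ℚ,((-1 : ℤ) : ℚ),((3 : ℤ) : ℚ)], (v ∈ order (-1) 3 ∨ v - ⟨1/2, 1/2, 1/2, -1/2⟩ ∈ order (-1) 3) ∧
        v * star v = 1 ∧ moebius (rho (-1) 3 (by norm_num) (castQ (-1) 3 v)) p.1 = q.1)
      (fun p q : {τ : ℂ // 0 < τ.im ∧ ∃ x : ℍ[ℚ,((-1 : ℤ) : ℚ),((3 : ℤ) : ℚ)],
        x ∈ order (-1) 3 ∧ x.re = 0 ∧ (x * star x).re = t ∧ moebius (rho (-1) 3 (by norm_num) (castQ (-1) 3 x)) τ = τ} ↦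
      ∃ g : ℍ[ℚ,((-1 : ℤ) : ℚ),((3 : ℤ) : ℚ)], g ≠ 0 ∧
        (∀ a : ℍ[ℚ,((-1 : ℤ) : ℚ),((3 : ℤ) : ℚ)], (a ∈ order (-1) 3 ∨ a - ⟨1/2, 1/2, 1/2, -1/2⟩ ∈ order (-1) 3) →
          ∃ b : ℍ[ℚ,((-1 : ℤ) : ℚ),((3 : ℤ) : ℚ)], (b ∈ order (-1) 3 ∨ b - ⟨1/2, 1/2, 1/2, -1/2⟩ ∈ order (-1) 3) ∧
            g * a = b * g) ∧
        0 < (g * star g).re ∧ (∃ s : ℚ, (g * star g).re = s ^ 2 ∨ (g * star g).re = 3 * s ^ 2) ∧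
        moebius (rho (-1) 3 (by norm_num) (castQ (-1) 3 g)) p.1 = q.1)
      (atkinLehnerQuotient_rel_of_specialPoints_rel t 3) (Quot.mk _ p') = Quot.mk _ p ↔
    (Quot.mk (fun p q : {τ : ℂ // 0 < τ.im ∧ ∃ x : ℍ[ℚ,((-1 : ℤ) : ℚ),((3 : ℤ) : ℚ)],
        x ∈ order (-1) 3 ∧ x.re = 0 ∧ (x * star x).re = t ∧ moebius (rho (-1) 3 (by norm_num) (castQ (-1) 3 x)) τ = τ} ↦
      ∃ v : ℍ[ℚ,((-1 : ℤ) : ℚ),((3 : ℤ) : ℚ)], (v ∈ order (-1) 3 ∨ v - ⟨1/2, 1/2, 1/2, -1/2⟩ ∈ order (-1) 3) ∧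
        v * star v = 1 ∧ moebius (rho (-1) 3 (by norm_num) (castQ (-1) 3 v)) p.1 = q.1) p' = Quot.mk _ p ∨
      Quot.mk (fun p q : {τ : ℂ // 0 < τ.im ∧ ∃ x : ℍ[ℚ,((-1 : ℤ) : ℚ),((3 : ℤ) : ℚ)],
        x ∈ order (-1) 3 ∧ x.re = 0 ∧ (x * star x).re = t ∧ moebius (rho (-1) 3 (by norm_num) (castQ (-1) 3 x)) τ = τ} ↦
      ∃ v : ℍ[ℚ,((-1 : ℤ) : ℚ),((3 : ℤ) : ℚ)], (v ∈ order (-1) 3 ∨ v - ⟨1/2, 1/2, 1/2, -1/2⟩ ∈ order (-1) 3) ∧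
        v * star v = 1 ∧ moebius (rho (-1) 3 (by norm_num) (castQ (-1) 3 v)) p.1 = q.1) p' = Quot.mk _ (⟨moebius (rho (-1) 3 (by norm_num) (castQ (-1) 3 (⟨3, 0, 1, 1⟩ : ℍ[ℚ,((-1 : ℤ) : ℚ),((3 : ℤ) : ℚ)]))) p.1, moebius_mu_mem_specialPoints p.2.1 p.2.2⟩ : {τ : ℂ // 0 < τ.im ∧ ∃ x : ℍ[ℚ,((-1 : ℤ) : ℚ),((3 : ℤ) : ℚ)],
        x ∈ order (-1) 3 ∧ x.re = 0 ∧ (x * star x).re = t ∧ moebius (rho (-1) 3 (by norm_num) (castQ (-1) 3 x)) τ = τ})) := by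
  have hiff := specialPoints_mk_eq_iff t
  show Quot.mk _ p' = Quot.mk _ p ↔ _
  rw [atkinLehnerQuotient_mk_eq_iff, atkinLehnerQuotientThree_rel_iff, (specialPoints_mk_eq_mk_moebius_iff p' p).2, hiff, hiff]
  constructor
  · rintro ⟨v, hv, hv1, h | h⟩
    · exact Or.inl ⟨v, hv, hv1, h⟩
    · exact Or.inr ⟨v, hv, hv1, h⟩
  · rintro (⟨v, hv, hv1, h⟩ | ⟨v, hv, hv1, h⟩)
    · exact ⟨v, hv, hv1, Or.inl h⟩
    · exact ⟨v, hv, hv1, Or.inr h⟩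

/-- **ONE CLASS IN THE FIBRE OF `X₆ → X₆^{(3)}` EXACTLY AT THE `Z(3)`-POINTS**: `#{[τ], [ρ(μ)τ]} = 1 ⟺ ω₃[τ] = [τ] ⟺
τ ∈ Pt(3)` (Ogg's fixed points of `w(3)`; `…XSixSpecialPointsBurnside`). [cite: Ogg1983RealPoints, §2 pp. 283–284 and (3)] [cite: BayerTravesa2007, §2 p. 318 and §7] -/
theorem card_fibre_atkinLehnerQuotientThree_eq_one_iff {t : ℤ} (p : {τ : ℂ // 0 < τ.im ∧ ∃ x : ℍ[ℚ,((-1 : ℤ) : ℚ),((3 : ℤ) : ℚ)],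
        x ∈ order (-1) 3 ∧ x.re = 0 ∧ (x * star x).re = t ∧ moebius (rho (-1) 3 (by norm_num) (castQ (-1) 3 x)) τ = τ}) :
    Nat.card {a : (Quot (fun p q : {τ : ℂ // 0 < τ.im ∧ ∃ x : ℍ[ℚ,((-1 : ℤ) : ℚ),((3 : ℤ) : ℚ)],
        x ∈ order (-1) 3 ∧ x.re = 0 ∧ (x * star x).re = t ∧ moebius (rho (-1) 3 (by norm_num) (castQ (-1) 3 x)) τ = τ} ↦
      ∃ v : ℍ[ℚ,((-1 : ℤ) : ℚ),((3 : ℤ) : ℚ)], (v ∈ order (-1) 3 ∨ v - ⟨1/2, 1/2, 1/2, -1/2⟩ ∈ order (-1) 3) ∧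
        v * star v = 1 ∧ moebius (rho (-1) 3 (by norm_num) (castQ (-1) 3 v)) p.1 = q.1)) //
      Quot.factor (fun p q : {τ : ℂ // 0 < τ.im ∧ ∃ x : ℍ[ℚ,((-1 : ℤ) : ℚ),((3 : ℤ) : ℚ)],
        x ∈ order (-1) 3 ∧ x.re = 0 ∧ (x * star x).re = t ∧ moebius (rho (-1) 3 (by norm_num) (castQ (-1) 3 x)) τ = τ} ↦
      ∃ v : ℍ[ℚ,((-1 : ℤ) : ℚ),((3 : ℤ) : ℚ)], (v ∈ order (-1) 3 ∨ v - ⟨1/2, 1/2, 1/2, -1/2⟩ ∈ order (-1) 3) ∧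
        v * star v = 1 ∧ moebius (rho (-1) 3 (by norm_num) (castQ (-1) 3 v)) p.1 = q.1)
      (fun p q : {τ : ℂ // 0 < τ.im ∧ ∃ x : ℍ[ℚ,((-1 : ℤ) : ℚ),((3 : ℤ) : ℚ)],
        x ∈ order (-1) 3 ∧ x.re = 0 ∧ (x * star x).re = t ∧ moebius (rho (-1) 3 (by norm_num) (castQ (-1) 3 x)) τ = τ} ↦
      ∃ g : ℍ[ℚ,((-1 : ℤ) : ℚ),((3 : ℤ) : ℚ)], g ≠ 0 ∧
        (∀ a : ℍ[ℚ,((-1 : ℤ) : ℚ),((3 : ℤ) : ℚ)], (a ∈ order (-1) 3 ∨ a - ⟨1/2, 1/2, 1/2, -1/2⟩ ∈ order (-1) 3) →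
          ∃ b : ℍ[ℚ,((-1 : ℤ) : ℚ),((3 : ℤ) : ℚ)], (b ∈ order (-1) 3 ∨ b - ⟨1/2, 1/2, 1/2, -1/2⟩ ∈ order (-1) 3) ∧
            g * a = b * g) ∧
        0 < (g * star g).re ∧ (∃ s : ℚ, (g * star g).re = s ^ 2 ∨ (g * star g).re = 3 * s ^ 2) ∧
        moebius (rho (-1) 3 (by norm_num) (castQ (-1) 3 g)) p.1 = q.1)
      (atkinLehnerQuotient_rel_of_specialPoints_rel t 3) a = Quot.mk _ p} = 1 ↔
    (∃ y : ℍ[ℚ,((-1 : ℤ) : ℚ),((3 : ℤ) : ℚ)], y ∈ order (-1) 3 ∧ y.re = 0 ∧ (y * star y).re = 3 ∧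
        moebius (rho (-1) 3 (by norm_num) (castQ (-1) 3 y)) p.1 = p.1) := by
  have hF : ∀ b : (Quot (fun p q : {τ : ℂ // 0 < τ.im ∧ ∃ x : ℍ[ℚ,((-1 : ℤ) : ℚ),((3 : ℤ) : ℚ)],
        x ∈ order (-1) 3 ∧ x.re = 0 ∧ (x * star x).re = t ∧ moebius (rho (-1) 3 (by norm_num) (castQ (-1) 3 x)) τ = τ} ↦
      ∃ v : ℍ[ℚ,((-1 : ℤ) : ℚ),((3 : ℤ) : ℚ)], (v ∈ order (-1) 3 ∨ v - ⟨1/2, 1/2, 1/2, -1/2⟩ ∈ order (-1) 3) ∧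
        v * star v = 1 ∧ moebius (rho (-1) 3 (by norm_num) (castQ (-1) 3 v)) p.1 = q.1)),
      Quot.factor (fun p q : {τ : ℂ // 0 < τ.im ∧ ∃ x : ℍ[ℚ,((-1 : ℤ) : ℚ),((3 : ℤ) : ℚ)],
        x ∈ order (-1) 3 ∧ x.re = 0 ∧ (x * star x).re = t ∧ moebius (rho (-1) 3 (by norm_num) (castQ (-1) 3 x)) τ = τ} ↦
      ∃ v : ℍ[ℚ,((-1 : ℤ) : ℚ),((3 : ℤ) : ℚ)], (v ∈ order (-1) 3 ∨ v - ⟨1/2, 1/2, 1/2, -1/2⟩ ∈ order (-1) 3) ∧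
        v * star v = 1 ∧ moebius (rho (-1) 3 (by norm_num) (castQ (-1) 3 v)) p.1 = q.1)
      (fun p q : {τ : ℂ // 0 < τ.im ∧ ∃ x : ℍ[ℚ,((-1 : ℤ) : ℚ),((3 : ℤ) : ℚ)],
        x ∈ order (-1) 3 ∧ x.re = 0 ∧ (x * star x).re = t ∧ moebius (rho (-1) 3 (by norm_num) (castQ (-1) 3 x)) τ = τ} ↦
      ∃ g : ℍ[ℚ,((-1 : ℤ) : ℚ),((3 : ℤ) : ℚ)], g ≠ 0 ∧
        (∀ a : ℍ[ℚ,((-1 : ℤ) : ℚ),((3 : ℤ) : ℚ)], (a ∈ order (-1) 3 ∨ a - ⟨1/2, 1/2, 1/2, -1/2⟩ ∈ order (-1) 3) →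
          ∃ b : ℍ[ℚ,((-1 : ℤ) : ℚ),((3 : ℤ) : ℚ)], (b ∈ order (-1) 3 ∨ b - ⟨1/2, 1/2, 1/2, -1/2⟩ ∈ order (-1) 3) ∧
            g * a = b * g) ∧
        0 < (g * star g).re ∧ (∃ s : ℚ, (g * star g).re = s ^ 2 ∨ (g * star g).re = 3 * s ^ 2) ∧
        moebius (rho (-1) 3 (by norm_num) (castQ (-1) 3 g)) p.1 = q.1)
      (atkinLehnerQuotient_rel_of_specialPoints_rel t 3) b = Quot.mk _ p ↔
      (b = Quot.mk _ p ∨ b = Quot.mk _ (⟨moebius (rho (-1) 3 (by norm_num) (castQ (-1) 3 (⟨3, 0, 1, 1⟩ : ℍ[ℚ,((-1 : ℤ) : ℚ),((3 : ℤ) : ℚ)]))) p.1, moebius_mu_mem_specialPoints p.2.1 p.2.2⟩ : {τ : ℂ // 0 < τ.im ∧ ∃ x : ℍ[ℚ,((-1 : ℤ) : ℚ),((3 : ℤ) : ℚ)],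
        x ∈ order (-1) 3 ∧ x.re = 0 ∧ (x * star x).re = t ∧ moebius (rho (-1) 3 (by norm_num) (castQ (-1) 3 x)) τ = τ})) := by
    intro b
    induction b using Quot.ind with
    | _ p' => exact factor_mk_eq_mk_iff_atkinLehnerQuotientThree p' p
  rw [(card_eq_one_iff_of_iff_eq_or_eq₂₁ hF).1, specialPoints_mk_eq_iff, ← normOne_moebius_mu_fixed_iff p.2.1]

/-- **TWO CLASSES IN THE FIBRE OF `X₆ → X₆^{(3)}` AWAY FROM `Z(3)`**: `ω₃` moves `[τ]` iff `τ ∉ Pt(3)`. [cite: Ogg1983RealPoints, §2 pp. 283–284 and (3)] [cite: BayerTravesa2007, §2 p. 318] -/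
theorem card_fibre_atkinLehnerQuotientThree_eq_two_iff {t : ℤ} (p : {τ : ℂ // 0 < τ.im ∧ ∃ x : ℍ[ℚ,((-1 : ℤ) : ℚ),((3 : ℤ) : ℚ)],
        x ∈ order (-1) 3 ∧ x.re = 0 ∧ (x * star x).re = t ∧ moebius (rho (-1) 3 (by norm_num) (castQ (-1) 3 x)) τ = τ}) :
    Nat.card {a : (Quot (fun p q : {τ : ℂ // 0 < τ.im ∧ ∃ x : ℍ[ℚ,((-1 : ℤ) : ℚ),((3 : ℤ) : ℚ)],
        x ∈ order (-1) 3 ∧ x.re = 0 ∧ (x * star x).re = t ∧ moebius (rho (-1) 3 (by norm_num) (castQ (-1) 3 x)) τ = τ} ↦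
      ∃ v : ℍ[ℚ,((-1 : ℤ) : ℚ),((3 : ℤ) : ℚ)], (v ∈ order (-1) 3 ∨ v - ⟨1/2, 1/2, 1/2, -1/2⟩ ∈ order (-1) 3) ∧
        v * star v = 1 ∧ moebius (rho (-1) 3 (by norm_num) (castQ (-1) 3 v)) p.1 = q.1)) //
      Quot.factor (fun p q : {τ : ℂ // 0 < τ.im ∧ ∃ x : ℍ[ℚ,((-1 : ℤ) : ℚ),((3 : ℤ) : ℚ)],
        x ∈ order (-1) 3 ∧ x.re = 0 ∧ (x * star x).re = t ∧ moebius (rho (-1) 3 (by norm_num) (castQ (-1) 3 x)) τ = τ} ↦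
      ∃ v : ℍ[ℚ,((-1 : ℤ) : ℚ),((3 : ℤ) : ℚ)], (v ∈ order (-1) 3 ∨ v - ⟨1/2, 1/2, 1/2, -1/2⟩ ∈ order (-1) 3) ∧
        v * star v = 1 ∧ moebius (rho (-1) 3 (by norm_num) (castQ (-1) 3 v)) p.1 = q.1)
      (fun p q : {τ : ℂ // 0 < τ.im ∧ ∃ x : ℍ[ℚ,((-1 : ℤ) : ℚ),((3 : ℤ) : ℚ)],
        x ∈ order (-1) 3 ∧ x.re = 0 ∧ (x * star x).re = t ∧ moebius (rho (-1) 3 (by norm_num) (castQ (-1) 3 x)) τ = τ} ↦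
      ∃ g : ℍ[ℚ,((-1 : ℤ) : ℚ),((3 : ℤ) : ℚ)], g ≠ 0 ∧
        (∀ a : ℍ[ℚ,((-1 : ℤ) : ℚ),((3 : ℤ) : ℚ)], (a ∈ order (-1) 3 ∨ a - ⟨1/2, 1/2, 1/2, -1/2⟩ ∈ order (-1) 3) →
          ∃ b : ℍ[ℚ,((-1 : ℤ) : ℚ),((3 : ℤ) : ℚ)], (b ∈ order (-1) 3 ∨ b - ⟨1/2, 1/2, 1/2, -1/2⟩ ∈ order (-1) 3) ∧
            g * a = b * g) ∧
        0 < (g * star g).re ∧ (∃ s : ℚ, (g * star g).re = s ^ 2 ∨ (g * star g).re = 3 * s ^ 2) ∧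
        moebius (rho (-1) 3 (by norm_num) (castQ (-1) 3 g)) p.1 = q.1)
      (atkinLehnerQuotient_rel_of_specialPoints_rel t 3) a = Quot.mk _ p} = 2 ↔
    ¬ (∃ y : ℍ[ℚ,((-1 : ℤ) : ℚ),((3 : ℤ) : ℚ)], y ∈ order (-1) 3 ∧ y.re = 0 ∧ (y * star y).re = 3 ∧
        moebius (rho (-1) 3 (by norm_num) (castQ (-1) 3 y)) p.1 = p.1) := by
  have hF : ∀ b : (Quot (fun p q : {τ : ℂ // 0 < τ.im ∧ ∃ x : ℍ[ℚ,((-1 : ℤ) : ℚ),((3 : ℤ) : ℚ)],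
        x ∈ order (-1) 3 ∧ x.re = 0 ∧ (x * star x).re = t ∧ moebius (rho (-1) 3 (by norm_num) (castQ (-1) 3 x)) τ = τ} ↦
      ∃ v : ℍ[ℚ,((-1 : ℤ) : ℚ),((3 : ℤ) : ℚ)], (v ∈ order (-1) 3 ∨ v - ⟨1/2, 1/2, 1/2, -1/2⟩ ∈ order (-1) 3) ∧
        v * star v = 1 ∧ moebius (rho (-1) 3 (by norm_num) (castQ (-1) 3 v)) p.1 = q.1)),
      Quot.factor (fun p q : {τ : ℂ // 0 < τ.im ∧ ∃ x : ℍ[ℚ,((-1 : ℤ) : ℚ),((3 : ℤ) : ℚ)],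
        x ∈ order (-1) 3 ∧ x.re = 0 ∧ (x * star x).re = t ∧ moebius (rho (-1) 3 (by norm_num) (castQ (-1) 3 x)) τ = τ} ↦
      ∃ v : ℍ[ℚ,((-1 : ℤ) : ℚ),((3 : ℤ) : ℚ)], (v ∈ order (-1) 3 ∨ v - ⟨1/2, 1/2, 1/2, -1/2⟩ ∈ order (-1) 3) ∧
        v * star v = 1 ∧ moebius (rho (-1) 3 (by norm_num) (castQ (-1) 3 v)) p.1 = q.1)
      (fun p q : {τ : ℂ // 0 < τ.im ∧ ∃ x : ℍ[ℚ,((-1 : ℤ) : ℚ),((3 : ℤ) : ℚ)],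
        x ∈ order (-1) 3 ∧ x.re = 0 ∧ (x * star x).re = t ∧ moebius (rho (-1) 3 (by norm_num) (castQ (-1) 3 x)) τ = τ} ↦
      ∃ g : ℍ[ℚ,((-1 : ℤ) : ℚ),((3 : ℤ) : ℚ)], g ≠ 0 ∧
        (∀ a : ℍ[ℚ,((-1 : ℤ) : ℚ),((3 : ℤ) : ℚ)], (a ∈ order (-1) 3 ∨ a - ⟨1/2, 1/2, 1/2, -1/2⟩ ∈ order (-1) 3) →
          ∃ b : ℍ[ℚ,((-1 : ℤ) : ℚ),((3 : ℤ) : ℚ)], (b ∈ order (-1) 3 ∨ b - ⟨1/2, 1/2, 1/2, -1/2⟩ ∈ order (-1) 3) ∧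
            g * a = b * g) ∧
        0 < (g * star g).re ∧ (∃ s : ℚ, (g * star g).re = s ^ 2 ∨ (g * star g).re = 3 * s ^ 2) ∧
        moebius (rho (-1) 3 (by norm_num) (castQ (-1) 3 g)) p.1 = q.1)
      (atkinLehnerQuotient_rel_of_specialPoints_rel t 3) b = Quot.mk _ p ↔
      (b = Quot.mk _ p ∨ b = Quot.mk _ (⟨moebius (rho (-1) 3 (by norm_num) (castQ (-1) 3 (⟨3, 0, 1, 1⟩ : ℍ[ℚ,((-1 : ℤ) : ℚ),((3 : ℤ) : ℚ)]))) p.1, moebius_mu_mem_specialPoints p.2.1 p.2.2⟩ : {τ : ℂ // 0 < τ.im ∧ ∃ x : ℍ[ℚ,((-1 : ℤ) : ℚ),((3 : ℤ) : ℚ)],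
        x ∈ order (-1) 3 ∧ x.re = 0 ∧ (x * star x).re = t ∧ moebius (rho (-1) 3 (by norm_num) (castQ (-1) 3 x)) τ = τ})) := by
    intro b
    induction b using Quot.ind with
    | _ p' => exact factor_mk_eq_mk_iff_atkinLehnerQuotientThree p' p
  rw [(card_eq_one_iff_of_iff_eq_or_eq₂₁ hF).2.1, ← card_fibre_atkinLehnerQuotientThree_eq_one_iff p,
    (card_eq_one_iff_of_iff_eq_or_eq₂₁ hF).1]

/-- Every fibre of `X₆ → X₆^{(3)}` on `Z(t)` has one or two classes (a double cover). [cite: Ogg1983RealPoints, §2 (3)–(4)] [cite: BayerTravesa2007, §2 p. 318] -/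
theorem card_fibre_atkinLehnerQuotientThree_eq_one_or_eq_two {t : ℤ} (c : (Quot (fun p q : {τ : ℂ // 0 < τ.im ∧ ∃ x : ℍ[ℚ,((-1 : ℤ) : ℚ),((3 : ℤ) : ℚ)],
        x ∈ order (-1) 3 ∧ x.re = 0 ∧ (x * star x).re = t ∧ moebius (rho (-1) 3 (by norm_num) (castQ (-1) 3 x)) τ = τ} ↦
      ∃ g : ℍ[ℚ,((-1 : ℤ) : ℚ),((3 : ℤ) : ℚ)], g ≠ 0 ∧
        (∀ a : ℍ[ℚ,((-1 : ℤ) : ℚ),((3 : ℤ) : ℚ)], (a ∈ order (-1) 3 ∨ a - ⟨1/2, 1/2, 1/2, -1/2⟩ ∈ order (-1) 3) →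
          ∃ b : ℍ[ℚ,((-1 : ℤ) : ℚ),((3 : ℤ) : ℚ)], (b ∈ order (-1) 3 ∨ b - ⟨1/2, 1/2, 1/2, -1/2⟩ ∈ order (-1) 3) ∧
            g * a = b * g) ∧
        0 < (g * star g).re ∧ (∃ s : ℚ, (g * star g).re = s ^ 2 ∨ (g * star g).re = 3 * s ^ 2) ∧
        moebius (rho (-1) 3 (by norm_num) (castQ (-1) 3 g)) p.1 = q.1))) :
    Nat.card {a : (Quot (fun p q : {τ : ℂ // 0 < τ.im ∧ ∃ x : ℍ[ℚ,((-1 : ℤ) : ℚ),((3 : ℤ) : ℚ)],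
        x ∈ order (-1) 3 ∧ x.re = 0 ∧ (x * star x).re = t ∧ moebius (rho (-1) 3 (by norm_num) (castQ (-1) 3 x)) τ = τ} ↦
      ∃ v : ℍ[ℚ,((-1 : ℤ) : ℚ),((3 : ℤ) : ℚ)], (v ∈ order (-1) 3 ∨ v - ⟨1/2, 1/2, 1/2, -1/2⟩ ∈ order (-1) 3) ∧
        v * star v = 1 ∧ moebius (rho (-1) 3 (by norm_num) (castQ (-1) 3 v)) p.1 = q.1)) //
      Quot.factor (fun p q : {τ : ℂ // 0 < τ.im ∧ ∃ x : ℍ[ℚ,((-1 : ℤ) : ℚ),((3 : ℤ) : ℚ)],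
        x ∈ order (-1) 3 ∧ x.re = 0 ∧ (x * star x).re = t ∧ moebius (rho (-1) 3 (by norm_num) (castQ (-1) 3 x)) τ = τ} ↦
      ∃ v : ℍ[ℚ,((-1 : ℤ) : ℚ),((3 : ℤ) : ℚ)], (v ∈ order (-1) 3 ∨ v - ⟨1/2, 1/2, 1/2, -1/2⟩ ∈ order (-1) 3) ∧
        v * star v = 1 ∧ moebius (rho (-1) 3 (by norm_num) (castQ (-1) 3 v)) p.1 = q.1)
      (fun p q : {τ : ℂ // 0 < τ.im ∧ ∃ x : ℍ[ℚ,((-1 : ℤ) : ℚ),((3 : ℤ) : ℚ)],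
        x ∈ order (-1) 3 ∧ x.re = 0 ∧ (x * star x).re = t ∧ moebius (rho (-1) 3 (by norm_num) (castQ (-1) 3 x)) τ = τ} ↦
      ∃ g : ℍ[ℚ,((-1 : ℤ) : ℚ),((3 : ℤ) : ℚ)], g ≠ 0 ∧
        (∀ a : ℍ[ℚ,((-1 : ℤ) : ℚ),((3 : ℤ) : ℚ)], (a ∈ order (-1) 3 ∨ a - ⟨1/2, 1/2, 1/2, -1/2⟩ ∈ order (-1) 3) →
          ∃ b : ℍ[ℚ,((-1 : ℤ) : ℚ),((3 : ℤ) : ℚ)], (b ∈ order (-1) 3 ∨ b - ⟨1/2, 1/2, 1/2, -1/2⟩ ∈ order (-1) 3) ∧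
            g * a = b * g) ∧
        0 < (g * star g).re ∧ (∃ s : ℚ, (g * star g).re = s ^ 2 ∨ (g * star g).re = 3 * s ^ 2) ∧
        moebius (rho (-1) 3 (by norm_num) (castQ (-1) 3 g)) p.1 = q.1)
      (atkinLehnerQuotient_rel_of_specialPoints_rel t 3) a = c} = 1 ∨
    Nat.card {a : (Quot (fun p q : {τ : ℂ // 0 < τ.im ∧ ∃ x : ℍ[ℚ,((-1 : ℤ) : ℚ),((3 : ℤ) : ℚ)],
        x ∈ order (-1) 3 ∧ x.re = 0 ∧ (x * star x).re = t ∧ moebius (rho (-1) 3 (by norm_num) (castQ (-1) 3 x)) τ = τ} ↦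
      ∃ v : ℍ[ℚ,((-1 : ℤ) : ℚ),((3 : ℤ) : ℚ)], (v ∈ order (-1) 3 ∨ v - ⟨1/2, 1/2, 1/2, -1/2⟩ ∈ order (-1) 3) ∧
        v * star v = 1 ∧ moebius (rho (-1) 3 (by norm_num) (castQ (-1) 3 v)) p.1 = q.1)) //
      Quot.factor (fun p q : {τ : ℂ // 0 < τ.im ∧ ∃ x : ℍ[ℚ,((-1 : ℤ) : ℚ),((3 : ℤ) : ℚ)],
        x ∈ order (-1) 3 ∧ x.re = 0 ∧ (x * star x).re = t ∧ moebius (rho (-1) 3 (by norm_num) (castQ (-1) 3 x)) τ = τ} ↦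
      ∃ v : ℍ[ℚ,((-1 : ℤ) : ℚ),((3 : ℤ) : ℚ)], (v ∈ order (-1) 3 ∨ v - ⟨1/2, 1/2, 1/2, -1/2⟩ ∈ order (-1) 3) ∧
        v * star v = 1 ∧ moebius (rho (-1) 3 (by norm_num) (castQ (-1) 3 v)) p.1 = q.1)
      (fun p q : {τ : ℂ // 0 < τ.im ∧ ∃ x : ℍ[ℚ,((-1 : ℤ) : ℚ),((3 : ℤ) : ℚ)],
        x ∈ order (-1) 3 ∧ x.re = 0 ∧ (x * star x).re = t ∧ moebius (rho (-1) 3 (by norm_num) (castQ (-1) 3 x)) τ = τ} ↦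
      ∃ g : ℍ[ℚ,((-1 : ℤ) : ℚ),((3 : ℤ) : ℚ)], g ≠ 0 ∧
        (∀ a : ℍ[ℚ,((-1 : ℤ) : ℚ),((3 : ℤ) : ℚ)], (a ∈ order (-1) 3 ∨ a - ⟨1/2, 1/2, 1/2, -1/2⟩ ∈ order (-1) 3) →
          ∃ b : ℍ[ℚ,((-1 : ℤ) : ℚ),((3 : ℤ) : ℚ)], (b ∈ order (-1) 3 ∨ b - ⟨1/2, 1/2, 1/2, -1/2⟩ ∈ order (-1) 3) ∧
            g * a = b * g) ∧
        0 < (g * star g).re ∧ (∃ s : ℚ, (g * star g).re = s ^ 2 ∨ (g * star g).re = 3 * s ^ 2) ∧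
        moebius (rho (-1) 3 (by norm_num) (castQ (-1) 3 g)) p.1 = q.1)
      (atkinLehnerQuotient_rel_of_specialPoints_rel t 3) a = c} = 2 := by
  induction c using Quot.ind with
  | _ p =>
    have hF : ∀ b : (Quot (fun p q : {τ : ℂ // 0 < τ.im ∧ ∃ x : ℍ[ℚ,((-1 : ℤ) : ℚ),((3 : ℤ) : ℚ)],
        x ∈ order (-1) 3 ∧ x.re = 0 ∧ (x * star x).re = t ∧ moebius (rho (-1) 3 (by norm_num) (castQ (-1) 3 x)) τ = τ} ↦
      ∃ v : ℍ[ℚ,((-1 : ℤ) : ℚ),((3 : ℤ) : ℚ)], (v ∈ order (-1) 3 ∨ v - ⟨1/2, 1/2, 1/2, -1/2⟩ ∈ order (-1) 3) ∧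
        v * star v = 1 ∧ moebius (rho (-1) 3 (by norm_num) (castQ (-1) 3 v)) p.1 = q.1)),
        Quot.factor (fun p q : {τ : ℂ // 0 < τ.im ∧ ∃ x : ℍ[ℚ,((-1 : ℤ) : ℚ),((3 : ℤ) : ℚ)],
        x ∈ order (-1) 3 ∧ x.re = 0 ∧ (x * star x).re = t ∧ moebius (rho (-1) 3 (by norm_num) (castQ (-1) 3 x)) τ = τ} ↦
      ∃ v : ℍ[ℚ,((-1 : ℤ) : ℚ),((3 : ℤ) : ℚ)], (v ∈ order (-1) 3 ∨ v - ⟨1/2, 1/2, 1/2, -1/2⟩ ∈ order (-1) 3) ∧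
        v * star v = 1 ∧ moebius (rho (-1) 3 (by norm_num) (castQ (-1) 3 v)) p.1 = q.1)
      (fun p q : {τ : ℂ // 0 < τ.im ∧ ∃ x : ℍ[ℚ,((-1 : ℤ) : ℚ),((3 : ℤ) : ℚ)],
        x ∈ order (-1) 3 ∧ x.re = 0 ∧ (x * star x).re = t ∧ moebius (rho (-1) 3 (by norm_num) (castQ (-1) 3 x)) τ = τ} ↦
      ∃ g : ℍ[ℚ,((-1 : ℤ) : ℚ),((3 : ℤ) : ℚ)], g ≠ 0 ∧
        (∀ a : ℍ[ℚ,((-1 : ℤ) : ℚ),((3 : ℤ) : ℚ)], (a ∈ order (-1) 3 ∨ a - ⟨1/2, 1/2, 1/2, -1/2⟩ ∈ order (-1) 3) →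
          ∃ b : ℍ[ℚ,((-1 : ℤ) : ℚ),((3 : ℤ) : ℚ)], (b ∈ order (-1) 3 ∨ b - ⟨1/2, 1/2, 1/2, -1/2⟩ ∈ order (-1) 3) ∧
            g * a = b * g) ∧
        0 < (g * star g).re ∧ (∃ s : ℚ, (g * star g).re = s ^ 2 ∨ (g * star g).re = 3 * s ^ 2) ∧
        moebius (rho (-1) 3 (by norm_num) (castQ (-1) 3 g)) p.1 = q.1)
      (atkinLehnerQuotient_rel_of_specialPoints_rel t 3) b = Quot.mk _ p ↔
        (b = Quot.mk _ p ∨ b = Quot.mk _ (⟨moebius (rho (-1) 3 (by norm_num) (castQ (-1) 3 (⟨3, 0, 1, 1⟩ : ℍ[ℚ,((-1 : ℤ) : ℚ),((3 : ℤ) : ℚ)]))) p.1, moebius_mu_mem_specialPoints p.2.1 p.2.2⟩ : {τ : ℂ // 0 < τ.im ∧ ∃ x : ℍ[ℚ,((-1 : ℤ) : ℚ),((3 : ℤ) : ℚ)],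
        x ∈ order (-1) 3 ∧ x.re = 0 ∧ (x * star x).re = t ∧ moebius (rho (-1) 3 (by norm_num) (castQ (-1) 3 x)) τ = τ})) := by
      intro b
      induction b using Quot.ind with
      | _ p' => exact factor_mk_eq_mk_iff_atkinLehnerQuotientThree p' p
    exact (card_eq_one_iff_of_iff_eq_or_eq₂₁ hF).2.2

/-- **CLASS EQUATION OF `X₆ → X₆^{(3)}` ON `Z(t)`** (`t > 0`): `#(Pt(t)/Γ₆) + #{one-class fibres} = 2·#(Pt(t)/Γ₆^{(3)})`.
[cite: Ogg1983RealPoints, §2 (3)–(4)] [cite: BayerTravesa2007, §2 p. 318] -/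
theorem card_specialPoints_add_card_oneFibres_eq_two_mul_card_atkinLehnerQuotientThree {t : ℤ} (ht : 0 < t) :
    Nat.card (Quot (fun p q : {τ : ℂ // 0 < τ.im ∧ ∃ x : ℍ[ℚ,((-1 : ℤ) : ℚ),((3 : ℤ) : ℚ)],
        x ∈ order (-1) 3 ∧ x.re = 0 ∧ (x * star x).re = t ∧ moebius (rho (-1) 3 (by norm_num) (castQ (-1) 3 x)) τ = τ} ↦
      ∃ v : ℍ[ℚ,((-1 : ℤ) : ℚ),((3 : ℤ) : ℚ)], (v ∈ order (-1) 3 ∨ v - ⟨1/2, 1/2, 1/2, -1/2⟩ ∈ order (-1) 3) ∧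
        v * star v = 1 ∧ moebius (rho (-1) 3 (by norm_num) (castQ (-1) 3 v)) p.1 = q.1)) +
    Nat.card {c : (Quot (fun p q : {τ : ℂ // 0 < τ.im ∧ ∃ x : ℍ[ℚ,((-1 : ℤ) : ℚ),((3 : ℤ) : ℚ)],
        x ∈ order (-1) 3 ∧ x.re = 0 ∧ (x * star x).re = t ∧ moebius (rho (-1) 3 (by norm_num) (castQ (-1) 3 x)) τ = τ} ↦
      ∃ g : ℍ[ℚ,((-1 : ℤ) : ℚ),((3 : ℤ) : ℚ)], g ≠ 0 ∧
        (∀ a : ℍ[ℚ,((-1 : ℤ) : ℚ),((3 : ℤ) : ℚ)], (a ∈ order (-1) 3 ∨ a - ⟨1/2, 1/2, 1/2, -1/2⟩ ∈ order (-1) 3) →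
          ∃ b : ℍ[ℚ,((-1 : ℤ) : ℚ),((3 : ℤ) : ℚ)], (b ∈ order (-1) 3 ∨ b - ⟨1/2, 1/2, 1/2, -1/2⟩ ∈ order (-1) 3) ∧
            g * a = b * g) ∧
        0 < (g * star g).re ∧ (∃ s : ℚ, (g * star g).re = s ^ 2 ∨ (g * star g).re = 3 * s ^ 2) ∧
        moebius (rho (-1) 3 (by norm_num) (castQ (-1) 3 g)) p.1 = q.1)) //
      Nat.card {a : (Quot (fun p q : {τ : ℂ // 0 < τ.im ∧ ∃ x : ℍ[ℚ,((-1 : ℤ) : ℚ),((3 : ℤ) : ℚ)],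
        x ∈ order (-1) 3 ∧ x.re = 0 ∧ (x * star x).re = t ∧ moebius (rho (-1) 3 (by norm_num) (castQ (-1) 3 x)) τ = τ} ↦
      ∃ v : ℍ[ℚ,((-1 : ℤ) : ℚ),((3 : ℤ) : ℚ)], (v ∈ order (-1) 3 ∨ v - ⟨1/2, 1/2, 1/2, -1/2⟩ ∈ order (-1) 3) ∧
        v * star v = 1 ∧ moebius (rho (-1) 3 (by norm_num) (castQ (-1) 3 v)) p.1 = q.1)) //
        Quot.factor (fun p q : {τ : ℂ // 0 < τ.im ∧ ∃ x : ℍ[ℚ,((-1 : ℤ) : ℚ),((3 : ℤ) : ℚ)],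
        x ∈ order (-1) 3 ∧ x.re = 0 ∧ (x * star x).re = t ∧ moebius (rho (-1) 3 (by norm_num) (castQ (-1) 3 x)) τ = τ} ↦
      ∃ v : ℍ[ℚ,((-1 : ℤ) : ℚ),((3 : ℤ) : ℚ)], (v ∈ order (-1) 3 ∨ v - ⟨1/2, 1/2, 1/2, -1/2⟩ ∈ order (-1) 3) ∧
        v * star v = 1 ∧ moebius (rho (-1) 3 (by norm_num) (castQ (-1) 3 v)) p.1 = q.1)
      (fun p q : {τ : ℂ // 0 < τ.im ∧ ∃ x : ℍ[ℚ,((-1 : ℤ) : ℚ),((3 : ℤ) : ℚ)],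
        x ∈ order (-1) 3 ∧ x.re = 0 ∧ (x * star x).re = t ∧ moebius (rho (-1) 3 (by norm_num) (castQ (-1) 3 x)) τ = τ} ↦
      ∃ g : ℍ[ℚ,((-1 : ℤ) : ℚ),((3 : ℤ) : ℚ)], g ≠ 0 ∧
        (∀ a : ℍ[ℚ,((-1 : ℤ) : ℚ),((3 : ℤ) : ℚ)], (a ∈ order (-1) 3 ∨ a - ⟨1/2, 1/2, 1/2, -1/2⟩ ∈ order (-1) 3) →
          ∃ b : ℍ[ℚ,((-1 : ℤ) : ℚ),((3 : ℤ) : ℚ)], (b ∈ order (-1) 3 ∨ b - ⟨1/2, 1/2, 1/2, -1/2⟩ ∈ order (-1) 3) ∧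
            g * a = b * g) ∧
        0 < (g * star g).re ∧ (∃ s : ℚ, (g * star g).re = s ^ 2 ∨ (g * star g).re = 3 * s ^ 2) ∧
        moebius (rho (-1) 3 (by norm_num) (castQ (-1) 3 g)) p.1 = q.1)
      (atkinLehnerQuotient_rel_of_specialPoints_rel t 3) a = c} = 1} =
    2 * Nat.card (Quot (fun p q : {τ : ℂ // 0 < τ.im ∧ ∃ x : ℍ[ℚ,((-1 : ℤ) : ℚ),((3 : ℤ) : ℚ)],
        x ∈ order (-1) 3 ∧ x.re = 0 ∧ (x * star x).re = t ∧ moebius (rho (-1) 3 (by norm_num) (castQ (-1) 3 x)) τ = τ} ↦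
      ∃ g : ℍ[ℚ,((-1 : ℤ) : ℚ),((3 : ℤ) : ℚ)], g ≠ 0 ∧
        (∀ a : ℍ[ℚ,((-1 : ℤ) : ℚ),((3 : ℤ) : ℚ)], (a ∈ order (-1) 3 ∨ a - ⟨1/2, 1/2, 1/2, -1/2⟩ ∈ order (-1) 3) →
          ∃ b : ℍ[ℚ,((-1 : ℤ) : ℚ),((3 : ℤ) : ℚ)], (b ∈ order (-1) 3 ∨ b - ⟨1/2, 1/2, 1/2, -1/2⟩ ∈ order (-1) 3) ∧
            g * a = b * g) ∧
        0 < (g * star g).re ∧ (∃ s : ℚ, (g * star g).re = s ^ 2 ∨ (g * star g).re = 3 * s ^ 2) ∧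
        moebius (rho (-1) 3 (by norm_num) (castQ (-1) 3 g)) p.1 = q.1)) := by
  haveI := finite_specialPoints ht
  haveI := finite_atkinLehnerQuotient ht 3
  exact card_add_card_eq_two_mul₂₁ _ card_fibre_atkinLehnerQuotientThree_eq_one_or_eq_two

/-- **THE ONE-CLASS FIBRES OF `X₆ → X₆^{(3)}` ON `Z(t)` ARE COUNTED BY `#((Pt(t) ∩ Pt(3))/Γ₆)`** (`t > 0`) — the fibrewise
count agrees with Burnside's (`…XSixAtkinLehnerQuotientsSpecialPoints`:
`#(Pt(t)/Γ₆) + #((Pt(t) ∩ Pt(3))/Γ₆) = 2·#(Pt(t)/Γ₆^{(3)})`). [cite: Ogg1983RealPoints, §2 (3)–(4)] [cite: BayerTravesa2007, §2 p. 318 and §7 Table 9] -/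
theorem card_oneFibres_atkinLehnerQuotientThree_eq_card_inter {t : ℤ} (ht : 0 < t) :
    Nat.card {c : (Quot (fun p q : {τ : ℂ // 0 < τ.im ∧ ∃ x : ℍ[ℚ,((-1 : ℤ) : ℚ),((3 : ℤ) : ℚ)],
        x ∈ order (-1) 3 ∧ x.re = 0 ∧ (x * star x).re = t ∧ moebius (rho (-1) 3 (by norm_num) (castQ (-1) 3 x)) τ = τ} ↦
      ∃ g : ℍ[ℚ,((-1 : ℤ) : ℚ),((3 : ℤ) : ℚ)], g ≠ 0 ∧
        (∀ a : ℍ[ℚ,((-1 : ℤ) : ℚ),((3 : ℤ) : ℚ)], (a ∈ order (-1) 3 ∨ a - ⟨1/2, 1/2, 1/2, -1/2⟩ ∈ order (-1) 3) →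
          ∃ b : ℍ[ℚ,((-1 : ℤ) : ℚ),((3 : ℤ) : ℚ)], (b ∈ order (-1) 3 ∨ b - ⟨1/2, 1/2, 1/2, -1/2⟩ ∈ order (-1) 3) ∧
            g * a = b * g) ∧
        0 < (g * star g).re ∧ (∃ s : ℚ, (g * star g).re = s ^ 2 ∨ (g * star g).re = 3 * s ^ 2) ∧
        moebius (rho (-1) 3 (by norm_num) (castQ (-1) 3 g)) p.1 = q.1)) //
      Nat.card {a : (Quot (fun p q : {τ : ℂ // 0 < τ.im ∧ ∃ x : ℍ[ℚ,((-1 : ℤ) : ℚ),((3 : ℤ) : ℚ)],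
        x ∈ order (-1) 3 ∧ x.re = 0 ∧ (x * star x).re = t ∧ moebius (rho (-1) 3 (by norm_num) (castQ (-1) 3 x)) τ = τ} ↦
      ∃ v : ℍ[ℚ,((-1 : ℤ) : ℚ),((3 : ℤ) : ℚ)], (v ∈ order (-1) 3 ∨ v - ⟨1/2, 1/2, 1/2, -1/2⟩ ∈ order (-1) 3) ∧
        v * star v = 1 ∧ moebius (rho (-1) 3 (by norm_num) (castQ (-1) 3 v)) p.1 = q.1)) //
        Quot.factor (fun p q : {τ : ℂ // 0 < τ.im ∧ ∃ x : ℍ[ℚ,((-1 : ℤ) : ℚ),((3 : ℤ) : ℚ)],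
        x ∈ order (-1) 3 ∧ x.re = 0 ∧ (x * star x).re = t ∧ moebius (rho (-1) 3 (by norm_num) (castQ (-1) 3 x)) τ = τ} ↦
      ∃ v : ℍ[ℚ,((-1 : ℤ) : ℚ),((3 : ℤ) : ℚ)], (v ∈ order (-1) 3 ∨ v - ⟨1/2, 1/2, 1/2, -1/2⟩ ∈ order (-1) 3) ∧
        v * star v = 1 ∧ moebius (rho (-1) 3 (by norm_num) (castQ (-1) 3 v)) p.1 = q.1)
      (fun p q : {τ : ℂ // 0 < τ.im ∧ ∃ x : ℍ[ℚ,((-1 : ℤ) : ℚ),((3 : ℤ) : ℚ)],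
        x ∈ order (-1) 3 ∧ x.re = 0 ∧ (x * star x).re = t ∧ moebius (rho (-1) 3 (by norm_num) (castQ (-1) 3 x)) τ = τ} ↦
      ∃ g : ℍ[ℚ,((-1 : ℤ) : ℚ),((3 : ℤ) : ℚ)], g ≠ 0 ∧
        (∀ a : ℍ[ℚ,((-1 : ℤ) : ℚ),((3 : ℤ) : ℚ)], (a ∈ order (-1) 3 ∨ a - ⟨1/2, 1/2, 1/2, -1/2⟩ ∈ order (-1) 3) →
          ∃ b : ℍ[ℚ,((-1 : ℤ) : ℚ),((3 : ℤ) : ℚ)], (b ∈ order (-1) 3 ∨ b - ⟨1/2, 1/2, 1/2, -1/2⟩ ∈ order (-1) 3) ∧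
            g * a = b * g) ∧
        0 < (g * star g).re ∧ (∃ s : ℚ, (g * star g).re = s ^ 2 ∨ (g * star g).re = 3 * s ^ 2) ∧
        moebius (rho (-1) 3 (by norm_num) (castQ (-1) 3 g)) p.1 = q.1)
      (atkinLehnerQuotient_rel_of_specialPoints_rel t 3) a = c} = 1} =
    Nat.card (Quot (fun p q : {τ : ℂ // 0 < τ.im ∧ (∃ x : ℍ[ℚ,((-1 : ℤ) : ℚ),((3 : ℤ) : ℚ)],
        x ∈ order (-1) 3 ∧ x.re = 0 ∧ (x * star x).re = t ∧ moebius (rho (-1) 3 (by norm_num) (castQ (-1) 3 x)) τ = τ) ∧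
        (∃ y : ℍ[ℚ,((-1 : ℤ) : ℚ),((3 : ℤ) : ℚ)], y ∈ order (-1) 3 ∧ y.re = 0 ∧ (y * star y).re = ((3 : ℤ) : ℚ) ∧
          moebius (rho (-1) 3 (by norm_num) (castQ (-1) 3 y)) τ = τ)} ↦
      ∃ v : ℍ[ℚ,((-1 : ℤ) : ℚ),((3 : ℤ) : ℚ)], (v ∈ order (-1) 3 ∨ v - ⟨1/2, 1/2, 1/2, -1/2⟩ ∈ order (-1) 3) ∧
        v * star v = 1 ∧ moebius (rho (-1) 3 (by norm_num) (castQ (-1) 3 v)) p.1 = q.1)) := by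
  have h1 := card_specialPoints_add_card_oneFibres_eq_two_mul_card_atkinLehnerQuotientThree ht
  have h2 := card_specialPoints_add_card_inter_eq_two_mul_card_atkinLehnerQuotientThree ht
  omega

/-- **`ω₆` IS AN INVOLUTION OF `Pt(t)/Γ₆`**: `[τ′] = [ρ(w₆)τ] ⟺ [ρ(w₆)τ′] = [τ]` (`ω₆ = ω₂ω₃` with `ω₂, ω₃` commuting
involutions). [cite: Ogg1983RealPoints, §2 (2)] [cite: BayerTravesa2007, §2 p. 318] -/
theorem specialPoints_mk_eq_mk_moebius_w6_iff {t : ℤ} (p' p : {τ : ℂ // 0 < τ.im ∧ ∃ x : ℍ[ℚ,((-1 : ℤ) : ℚ),((3 : ℤ) : ℚ)],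
        x ∈ order (-1) 3 ∧ x.re = 0 ∧ (x * star x).re = t ∧ moebius (rho (-1) 3 (by norm_num) (castQ (-1) 3 x)) τ = τ}) :
    Quot.mk (fun p q : {τ : ℂ // 0 < τ.im ∧ ∃ x : ℍ[ℚ,((-1 : ℤ) : ℚ),((3 : ℤ) : ℚ)],
        x ∈ order (-1) 3 ∧ x.re = 0 ∧ (x * star x).re = t ∧ moebius (rho (-1) 3 (by norm_num) (castQ (-1) 3 x)) τ = τ} ↦
      ∃ v : ℍ[ℚ,((-1 : ℤ) : ℚ),((3 : ℤ) : ℚ)], (v ∈ order (-1) 3 ∨ v - ⟨1/2, 1/2, 1/2, -1/2⟩ ∈ order (-1) 3) ∧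
        v * star v = 1 ∧ moebius (rho (-1) 3 (by norm_num) (castQ (-1) 3 v)) p.1 = q.1) p' = Quot.mk _ (⟨moebius (rho (-1) 3 (by norm_num) (castQ (-1) 3 (⟨3, 3, 0, 2⟩ : ℍ[ℚ,((-1 : ℤ) : ℚ),((3 : ℤ) : ℚ)]))) p.1, moebius_w6_mem_specialPoints p.2.1 p.2.2⟩ : {τ : ℂ // 0 < τ.im ∧ ∃ x : ℍ[ℚ,((-1 : ℤ) : ℚ),((3 : ℤ) : ℚ)],
        x ∈ order (-1) 3 ∧ x.re = 0 ∧ (x * star x).re = t ∧ moebius (rho (-1) 3 (by norm_num) (castQ (-1) 3 x)) τ = τ}) ↔ Quot.mk (fun p q : {τ : ℂ // 0 < τ.im ∧ ∃ x : ℍ[ℚ,((-1 : ℤ) : ℚ),((3 : ℤ) : ℚ)],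
        x ∈ order (-1) 3 ∧ x.re = 0 ∧ (x * star x).re = t ∧ moebius (rho (-1) 3 (by norm_num) (castQ (-1) 3 x)) τ = τ} ↦
      ∃ v : ℍ[ℚ,((-1 : ℤ) : ℚ),((3 : ℤ) : ℚ)], (v ∈ order (-1) 3 ∨ v - ⟨1/2, 1/2, 1/2, -1/2⟩ ∈ order (-1) 3) ∧
        v * star v = 1 ∧ moebius (rho (-1) 3 (by norm_num) (castQ (-1) 3 v)) p.1 = q.1) (⟨moebius (rho (-1) 3 (by norm_num) (castQ (-1) 3 (⟨3, 3, 0, 2⟩ : ℍ[ℚ,((-1 : ℤ) : ℚ),((3 : ℤ) : ℚ)]))) p'.1, moebius_w6_mem_specialPoints p'.2.1 p'.2.2⟩ : {τ : ℂ // 0 < τ.im ∧ ∃ x : ℍ[ℚ,((-1 : ℤ) : ℚ),((3 : ℤ) : ℚ)],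
        x ∈ order (-1) 3 ∧ x.re = 0 ∧ (x * star x).re = t ∧ moebius (rho (-1) 3 (by norm_num) (castQ (-1) 3 x)) τ = τ}) = Quot.mk _ p := by
  rw [(specialPoints_mk_klein p).2.2.2, (specialPoints_mk_klein p').2.2.2, (specialPoints_mk_eq_mk_moebius_iff _ _).1, (specialPoints_mk_eq_mk_moebius_iff _ _).2, (specialPoints_mk_klein p').2.2.1]

/-- **`ω₆[τ] = [τ] ⟺ τ ∈ Pt(6)`**: the lifted fixed points of `ω₆` are the `Z(6)`-points (`ρ(w₆) = ρ(w₂)ρ(μ)`;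
`normOne_moebius_w2_mu_fixed_iff`). [cite: Ogg1983RealPoints, §2 pp. 283–284 («`μ² = −m`»)] [cite: BayerTravesa2007, §7 Table 9] -/
theorem specialPoints_mk_moebius_w6_eq_iff {t : ℤ} (p : {τ : ℂ // 0 < τ.im ∧ ∃ x : ℍ[ℚ,((-1 : ℤ) : ℚ),((3 : ℤ) : ℚ)],
        x ∈ order (-1) 3 ∧ x.re = 0 ∧ (x * star x).re = t ∧ moebius (rho (-1) 3 (by norm_num) (castQ (-1) 3 x)) τ = τ}) :
    Quot.mk (fun p q : {τ : ℂ // 0 < τ.im ∧ ∃ x : ℍ[ℚ,((-1 : ℤ) : ℚ),((3 : ℤ) : ℚ)],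
        x ∈ order (-1) 3 ∧ x.re = 0 ∧ (x * star x).re = t ∧ moebius (rho (-1) 3 (by norm_num) (castQ (-1) 3 x)) τ = τ} ↦
      ∃ v : ℍ[ℚ,((-1 : ℤ) : ℚ),((3 : ℤ) : ℚ)], (v ∈ order (-1) 3 ∨ v - ⟨1/2, 1/2, 1/2, -1/2⟩ ∈ order (-1) 3) ∧
        v * star v = 1 ∧ moebius (rho (-1) 3 (by norm_num) (castQ (-1) 3 v)) p.1 = q.1) (⟨moebius (rho (-1) 3 (by norm_num) (castQ (-1) 3 (⟨3, 3, 0, 2⟩ : ℍ[ℚ,((-1 : ℤ) : ℚ),((3 : ℤ) : ℚ)]))) p.1, moebius_w6_mem_specialPoints p.2.1 p.2.2⟩ : {τ : ℂ // 0 < τ.im ∧ ∃ x : ℍ[ℚ,((-1 : ℤ) : ℚ),((3 : ℤ) : ℚ)],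
        x ∈ order (-1) 3 ∧ x.re = 0 ∧ (x * star x).re = t ∧ moebius (rho (-1) 3 (by norm_num) (castQ (-1) 3 x)) τ = τ}) = Quot.mk _ p ↔
    (∃ y : ℍ[ℚ,((-1 : ℤ) : ℚ),((3 : ℤ) : ℚ)], y ∈ order (-1) 3 ∧ y.re = 0 ∧ (y * star y).re = 6 ∧
        moebius (rho (-1) 3 (by norm_num) (castQ (-1) 3 y)) p.1 = p.1) := by
  rw [(specialPoints_mk_klein p).2.2.2, specialPoints_mk_eq_iff, ← normOne_moebius_w2_mu_fixed_iff p.2.1]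

/-- **THE FIBRE OF `X₆ → X₆^{(6)}` THROUGH `[τ]` ON `Z(t)` IS `{[τ], [ρ(w₆)τ]}`**: `[τ′]` lies over `[τ]₆` iff
`[τ′] = [τ]` or `[τ′] = [ρ(w₆)τ]` (`Γ₆^{(6)} = ℚ^×Γ₆{1, w₆}`, `ω₆² = 1` on classes). [cite: BayerTravesa2007, §2 p. 318 («involutions of the curve `X₆`, denoted `ω_d` … `X₆^{(6)} = X₆/⟨ω₆⟩`»)] [cite: Ogg1983RealPoints, §2 (2)–(3)] -/
theorem factor_mk_eq_mk_iff_atkinLehnerQuotientSix {t : ℤ} (p' p : {τ : ℂ // 0 < τ.im ∧ ∃ x : ℍ[ℚ,((-1 : ℤ) : ℚ),((3 : ℤ) : ℚ)],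
        x ∈ order (-1) 3 ∧ x.re = 0 ∧ (x * star x).re = t ∧ moebius (rho (-1) 3 (by norm_num) (castQ (-1) 3 x)) τ = τ}) :
    Quot.factor (fun p q : {τ : ℂ // 0 < τ.im ∧ ∃ x : ℍ[ℚ,((-1 : ℤ) : ℚ),((3 : ℤ) : ℚ)],
        x ∈ order (-1) 3 ∧ x.re = 0 ∧ (x * star x).re = t ∧ moebius (rho (-1) 3 (by norm_num) (castQ (-1) 3 x)) τ = τ} ↦
      ∃ v : ℍ[ℚ,((-1 : ℤ) : ℚ),((3 : ℤ) : ℚ)], (v ∈ order (-1) 3 ∨ v - ⟨1/2, 1/2, 1/2, -1/2⟩ ∈ order (-1) 3) ∧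
        v * star v = 1 ∧ moebius (rho (-1) 3 (by norm_num) (castQ (-1) 3 v)) p.1 = q.1)
      (fun p q : {τ : ℂ // 0 < τ.im ∧ ∃ x : ℍ[ℚ,((-1 : ℤ) : ℚ),((3 : ℤ) : ℚ)],
        x ∈ order (-1) 3 ∧ x.re = 0 ∧ (x * star x).re = t ∧ moebius (rho (-1) 3 (by norm_num) (castQ (-1) 3 x)) τ = τ} ↦
      ∃ g : ℍ[ℚ,((-1 : ℤ) : ℚ),((3 : ℤ) : ℚ)], g ≠ 0 ∧
        (∀ a : ℍ[ℚ,((-1 : ℤ) : ℚ),((3 : ℤ) : ℚ)], (a ∈ order (-1) 3 ∨ a - ⟨1/2, 1/2, 1/2, -1/2⟩ ∈ order (-1) 3) →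
          ∃ b : ℍ[ℚ,((-1 : ℤ) : ℚ),((3 : ℤ) : ℚ)], (b ∈ order (-1) 3 ∨ b - ⟨1/2, 1/2, 1/2, -1/2⟩ ∈ order (-1) 3) ∧
            g * a = b * g) ∧
        0 < (g * star g).re ∧ (∃ s : ℚ, (g * star g).re = s ^ 2 ∨ (g * star g).re = 6 * s ^ 2) ∧
        moebius (rho (-1) 3 (by norm_num) (castQ (-1) 3 g)) p.1 = q.1)
      (atkinLehnerQuotient_rel_of_specialPoints_rel t 6) (Quot.mk _ p') = Quot.mk _ p ↔
    (Quot.mk (fun p q : {τ : ℂ // 0 < τ.im ∧ ∃ x : ℍ[ℚ,((-1 : ℤ) : ℚ),((3 : ℤ) : ℚ)],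
        x ∈ order (-1) 3 ∧ x.re = 0 ∧ (x * star x).re = t ∧ moebius (rho (-1) 3 (by norm_num) (castQ (-1) 3 x)) τ = τ} ↦
      ∃ v : ℍ[ℚ,((-1 : ℤ) : ℚ),((3 : ℤ) : ℚ)], (v ∈ order (-1) 3 ∨ v - ⟨1/2, 1/2, 1/2, -1/2⟩ ∈ order (-1) 3) ∧
        v * star v = 1 ∧ moebius (rho (-1) 3 (by norm_num) (castQ (-1) 3 v)) p.1 = q.1) p' = Quot.mk _ p ∨
      Quot.mk (fun p q : {τ : ℂ // 0 < τ.im ∧ ∃ x : ℍ[ℚ,((-1 : ℤ) : ℚ),((3 : ℤ) : ℚ)],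
        x ∈ order (-1) 3 ∧ x.re = 0 ∧ (x * star x).re = t ∧ moebius (rho (-1) 3 (by norm_num) (castQ (-1) 3 x)) τ = τ} ↦
      ∃ v : ℍ[ℚ,((-1 : ℤ) : ℚ),((3 : ℤ) : ℚ)], (v ∈ order (-1) 3 ∨ v - ⟨1/2, 1/2, 1/2, -1/2⟩ ∈ order (-1) 3) ∧
        v * star v = 1 ∧ moebius (rho (-1) 3 (by norm_num) (castQ (-1) 3 v)) p.1 = q.1) p' = Quot.mk _ (⟨moebius (rho (-1) 3 (by norm_num) (castQ (-1) 3 (⟨3, 3, 0, 2⟩ : ℍ[ℚ,((-1 : ℤ) : ℚ),((3 : ℤ) : ℚ)]))) p.1, moebius_w6_mem_specialPoints p.2.1 p.2.2⟩ : {τ : ℂ // 0 < τ.im ∧ ∃ x : ℍ[ℚ,((-1 : ℤ) : ℚ),((3 : ℤ) : ℚ)],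
        x ∈ order (-1) 3 ∧ x.re = 0 ∧ (x * star x).re = t ∧ moebius (rho (-1) 3 (by norm_num) (castQ (-1) 3 x)) τ = τ})) := by
  have hiff := specialPoints_mk_eq_iff t
  show Quot.mk _ p' = Quot.mk _ p ↔ _
  rw [atkinLehnerQuotient_mk_eq_iff, atkinLehnerQuotientSix_rel_iff, specialPoints_mk_eq_mk_moebius_w6_iff, hiff, hiff]
  constructor
  · rintro ⟨v, hv, hv1, h | h⟩
    · exact Or.inl ⟨v, hv, hv1, h⟩
    · exact Or.inr ⟨v, hv, hv1, h⟩
  · rintro (⟨v, hv, hv1, h⟩ | ⟨v, hv, hv1, h⟩)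
    · exact ⟨v, hv, hv1, Or.inl h⟩
    · exact ⟨v, hv, hv1, Or.inr h⟩

/-- **ONE CLASS IN THE FIBRE OF `X₆ → X₆^{(6)}` EXACTLY AT THE `Z(6)`-POINTS**: `#{[τ], [ρ(w₆)τ]} = 1 ⟺ ω₆[τ] = [τ] ⟺
τ ∈ Pt(6)` (Ogg's fixed points of `w(6)`; `…XSixSpecialPointsBurnside`). [cite: Ogg1983RealPoints, §2 pp. 283–284 and (3)] [cite: BayerTravesa2007, §2 p. 318 and §7] -/
theorem card_fibre_atkinLehnerQuotientSix_eq_one_iff {t : ℤ} (p : {τ : ℂ // 0 < τ.im ∧ ∃ x : ℍ[ℚ,((-1 : ℤ) : ℚ),((3 : ℤ) : ℚ)],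
        x ∈ order (-1) 3 ∧ x.re = 0 ∧ (x * star x).re = t ∧ moebius (rho (-1) 3 (by norm_num) (castQ (-1) 3 x)) τ = τ}) :
    Nat.card {a : (Quot (fun p q : {τ : ℂ // 0 < τ.im ∧ ∃ x : ℍ[ℚ,((-1 : ℤ) : ℚ),((3 : ℤ) : ℚ)],
        x ∈ order (-1) 3 ∧ x.re = 0 ∧ (x * star x).re = t ∧ moebius (rho (-1) 3 (by norm_num) (castQ (-1) 3 x)) τ = τ} ↦
      ∃ v : ℍ[ℚ,((-1 : ℤ) : ℚ),((3 : ℤ) : ℚ)], (v ∈ order (-1) 3 ∨ v - ⟨1/2, 1/2, 1/2, -1/2⟩ ∈ order (-1) 3) ∧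
        v * star v = 1 ∧ moebius (rho (-1) 3 (by norm_num) (castQ (-1) 3 v)) p.1 = q.1)) //
      Quot.factor (fun p q : {τ : ℂ // 0 < τ.im ∧ ∃ x : ℍ[ℚ,((-1 : ℤ) : ℚ),((3 : ℤ) : ℚ)],
        x ∈ order (-1) 3 ∧ x.re = 0 ∧ (x * star x).re = t ∧ moebius (rho (-1) 3 (by norm_num) (castQ (-1) 3 x)) τ = τ} ↦
      ∃ v : ℍ[ℚ,((-1 : ℤ) : ℚ),((3 : ℤ) : ℚ)], (v ∈ order (-1) 3 ∨ v - ⟨1/2, 1/2, 1/2, -1/2⟩ ∈ order (-1) 3) ∧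
        v * star v = 1 ∧ moebius (rho (-1) 3 (by norm_num) (castQ (-1) 3 v)) p.1 = q.1)
      (fun p q : {τ : ℂ // 0 < τ.im ∧ ∃ x : ℍ[ℚ,((-1 : ℤ) : ℚ),((3 : ℤ) : ℚ)],
        x ∈ order (-1) 3 ∧ x.re = 0 ∧ (x * star x).re = t ∧ moebius (rho (-1) 3 (by norm_num) (castQ (-1) 3 x)) τ = τ} ↦
      ∃ g : ℍ[ℚ,((-1 : ℤ) : ℚ),((3 : ℤ) : ℚ)], g ≠ 0 ∧
        (∀ a : ℍ[ℚ,((-1 : ℤ) : ℚ),((3 : ℤ) : ℚ)], (a ∈ order (-1) 3 ∨ a - ⟨1/2, 1/2, 1/2, -1/2⟩ ∈ order (-1) 3) →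
          ∃ b : ℍ[ℚ,((-1 : ℤ) : ℚ),((3 : ℤ) : ℚ)], (b ∈ order (-1) 3 ∨ b - ⟨1/2, 1/2, 1/2, -1/2⟩ ∈ order (-1) 3) ∧
            g * a = b * g) ∧
        0 < (g * star g).re ∧ (∃ s : ℚ, (g * star g).re = s ^ 2 ∨ (g * star g).re = 6 * s ^ 2) ∧
        moebius (rho (-1) 3 (by norm_num) (castQ (-1) 3 g)) p.1 = q.1)
      (atkinLehnerQuotient_rel_of_specialPoints_rel t 6) a = Quot.mk _ p} = 1 ↔
    (∃ y : ℍ[ℚ,((-1 : ℤ) : ℚ),((3 : ℤ) : ℚ)], y ∈ order (-1) 3 ∧ y.re = 0 ∧ (y * star y).re = 6 ∧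
        moebius (rho (-1) 3 (by norm_num) (castQ (-1) 3 y)) p.1 = p.1) := by
  have hF : ∀ b : (Quot (fun p q : {τ : ℂ // 0 < τ.im ∧ ∃ x : ℍ[ℚ,((-1 : ℤ) : ℚ),((3 : ℤ) : ℚ)],
        x ∈ order (-1) 3 ∧ x.re = 0 ∧ (x * star x).re = t ∧ moebius (rho (-1) 3 (by norm_num) (castQ (-1) 3 x)) τ = τ} ↦
      ∃ v : ℍ[ℚ,((-1 : ℤ) : ℚ),((3 : ℤ) : ℚ)], (v ∈ order (-1) 3 ∨ v - ⟨1/2, 1/2, 1/2, -1/2⟩ ∈ order (-1) 3) ∧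
        v * star v = 1 ∧ moebius (rho (-1) 3 (by norm_num) (castQ (-1) 3 v)) p.1 = q.1)),
      Quot.factor (fun p q : {τ : ℂ // 0 < τ.im ∧ ∃ x : ℍ[ℚ,((-1 : ℤ) : ℚ),((3 : ℤ) : ℚ)],
        x ∈ order (-1) 3 ∧ x.re = 0 ∧ (x * star x).re = t ∧ moebius (rho (-1) 3 (by norm_num) (castQ (-1) 3 x)) τ = τ} ↦
      ∃ v : ℍ[ℚ,((-1 : ℤ) : ℚ),((3 : ℤ) : ℚ)], (v ∈ order (-1) 3 ∨ v - ⟨1/2, 1/2, 1/2, -1/2⟩ ∈ order (-1) 3) ∧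
        v * star v = 1 ∧ moebius (rho (-1) 3 (by norm_num) (castQ (-1) 3 v)) p.1 = q.1)
      (fun p q : {τ : ℂ // 0 < τ.im ∧ ∃ x : ℍ[ℚ,((-1 : ℤ) : ℚ),((3 : ℤ) : ℚ)],
        x ∈ order (-1) 3 ∧ x.re = 0 ∧ (x * star x).re = t ∧ moebius (rho (-1) 3 (by norm_num) (castQ (-1) 3 x)) τ = τ} ↦
      ∃ g : ℍ[ℚ,((-1 : ℤ) : ℚ),((3 : ℤ) : ℚ)], g ≠ 0 ∧
        (∀ a : ℍ[ℚ,((-1 : ℤ) : ℚ),((3 : ℤ) : ℚ)], (a ∈ order (-1) 3 ∨ a - ⟨1/2, 1/2, 1/2, -1/2⟩ ∈ order (-1) 3) →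
          ∃ b : ℍ[ℚ,((-1 : ℤ) : ℚ),((3 : ℤ) : ℚ)], (b ∈ order (-1) 3 ∨ b - ⟨1/2, 1/2, 1/2, -1/2⟩ ∈ order (-1) 3) ∧
            g * a = b * g) ∧
        0 < (g * star g).re ∧ (∃ s : ℚ, (g * star g).re = s ^ 2 ∨ (g * star g).re = 6 * s ^ 2) ∧
        moebius (rho (-1) 3 (by norm_num) (castQ (-1) 3 g)) p.1 = q.1)
      (atkinLehnerQuotient_rel_of_specialPoints_rel t 6) b = Quot.mk _ p ↔
      (b = Quot.mk _ p ∨ b = Quot.mk _ (⟨moebius (rho (-1) 3 (by norm_num) (castQ (-1) 3 (⟨3, 3, 0, 2⟩ : ℍ[ℚ,((-1 : ℤ) : ℚ),((3 : ℤ) : ℚ)]))) p.1, moebius_w6_mem_specialPoints p.2.1 p.2.2⟩ : {τ : ℂ // 0 < τ.im ∧ ∃ x : ℍ[ℚ,((-1 : ℤ) : ℚ),((3 : ℤ) : ℚ)],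
        x ∈ order (-1) 3 ∧ x.re = 0 ∧ (x * star x).re = t ∧ moebius (rho (-1) 3 (by norm_num) (castQ (-1) 3 x)) τ = τ})) := by
    intro b
    induction b using Quot.ind with
    | _ p' => exact factor_mk_eq_mk_iff_atkinLehnerQuotientSix p' p
  rw [(card_eq_one_iff_of_iff_eq_or_eq₂₁ hF).1, specialPoints_mk_moebius_w6_eq_iff]

/-- **TWO CLASSES IN THE FIBRE OF `X₆ → X₆^{(6)}` AWAY FROM `Z(6)`**: `ω₆` moves `[τ]` iff `τ ∉ Pt(6)`. [cite: Ogg1983RealPoints, §2 pp. 283–284 and (3)] [cite: BayerTravesa2007, §2 p. 318] -/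
theorem card_fibre_atkinLehnerQuotientSix_eq_two_iff {t : ℤ} (p : {τ : ℂ // 0 < τ.im ∧ ∃ x : ℍ[ℚ,((-1 : ℤ) : ℚ),((3 : ℤ) : ℚ)],
        x ∈ order (-1) 3 ∧ x.re = 0 ∧ (x * star x).re = t ∧ moebius (rho (-1) 3 (by norm_num) (castQ (-1) 3 x)) τ = τ}) :
    Nat.card {a : (Quot (fun p q : {τ : ℂ // 0 < τ.im ∧ ∃ x : ℍ[ℚ,((-1 : ℤ) : ℚ),((3 : ℤ) : ℚ)],
        x ∈ order (-1) 3 ∧ x.re = 0 ∧ (x * star x).re = t ∧ moebius (rho (-1) 3 (by norm_num) (castQ (-1) 3 x)) τ = τ} ↦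
      ∃ v : ℍ[ℚ,((-1 : ℤ) : ℚ),((3 : ℤ) : ℚ)], (v ∈ order (-1) 3 ∨ v - ⟨1/2, 1/2, 1/2, -1/2⟩ ∈ order (-1) 3) ∧
        v * star v = 1 ∧ moebius (rho (-1) 3 (by norm_num) (castQ (-1) 3 v)) p.1 = q.1)) //
      Quot.factor (fun p q : {τ : ℂ // 0 < τ.im ∧ ∃ x : ℍ[ℚ,((-1 : ℤ) : ℚ),((3 : ℤ) : ℚ)],
        x ∈ order (-1) 3 ∧ x.re = 0 ∧ (x * star x).re = t ∧ moebius (rho (-1) 3 (by norm_num) (castQ (-1) 3 x)) τ = τ} ↦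
      ∃ v : ℍ[ℚ,((-1 : ℤ) : ℚ),((3 : ℤ) : ℚ)], (v ∈ order (-1) 3 ∨ v - ⟨1/2, 1/2, 1/2, -1/2⟩ ∈ order (-1) 3) ∧
        v * star v = 1 ∧ moebius (rho (-1) 3 (by norm_num) (castQ (-1) 3 v)) p.1 = q.1)
      (fun p q : {τ : ℂ // 0 < τ.im ∧ ∃ x : ℍ[ℚ,((-1 : ℤ) : ℚ),((3 : ℤ) : ℚ)],
        x ∈ order (-1) 3 ∧ x.re = 0 ∧ (x * star x).re = t ∧ moebius (rho (-1) 3 (by norm_num) (castQ (-1) 3 x)) τ = τ} ↦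
      ∃ g : ℍ[ℚ,((-1 : ℤ) : ℚ),((3 : ℤ) : ℚ)], g ≠ 0 ∧
        (∀ a : ℍ[ℚ,((-1 : ℤ) : ℚ),((3 : ℤ) : ℚ)], (a ∈ order (-1) 3 ∨ a - ⟨1/2, 1/2, 1/2, -1/2⟩ ∈ order (-1) 3) →
          ∃ b : ℍ[ℚ,((-1 : ℤ) : ℚ),((3 : ℤ) : ℚ)], (b ∈ order (-1) 3 ∨ b - ⟨1/2, 1/2, 1/2, -1/2⟩ ∈ order (-1) 3) ∧
            g * a = b * g) ∧
        0 < (g * star g).re ∧ (∃ s : ℚ, (g * star g).re = s ^ 2 ∨ (g * star g).re = 6 * s ^ 2) ∧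
        moebius (rho (-1) 3 (by norm_num) (castQ (-1) 3 g)) p.1 = q.1)
      (atkinLehnerQuotient_rel_of_specialPoints_rel t 6) a = Quot.mk _ p} = 2 ↔
    ¬ (∃ y : ℍ[ℚ,((-1 : ℤ) : ℚ),((3 : ℤ) : ℚ)], y ∈ order (-1) 3 ∧ y.re = 0 ∧ (y * star y).re = 6 ∧
        moebius (rho (-1) 3 (by norm_num) (castQ (-1) 3 y)) p.1 = p.1) := by
  have hF : ∀ b : (Quot (fun p q : {τ : ℂ // 0 < τ.im ∧ ∃ x : ℍ[ℚ,((-1 : ℤ) : ℚ),((3 : ℤ) : ℚ)],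
        x ∈ order (-1) 3 ∧ x.re = 0 ∧ (x * star x).re = t ∧ moebius (rho (-1) 3 (by norm_num) (castQ (-1) 3 x)) τ = τ} ↦
      ∃ v : ℍ[ℚ,((-1 : ℤ) : ℚ),((3 : ℤ) : ℚ)], (v ∈ order (-1) 3 ∨ v - ⟨1/2, 1/2, 1/2, -1/2⟩ ∈ order (-1) 3) ∧
        v * star v = 1 ∧ moebius (rho (-1) 3 (by norm_num) (castQ (-1) 3 v)) p.1 = q.1)),
      Quot.factor (fun p q : {τ : ℂ // 0 < τ.im ∧ ∃ x : ℍ[ℚ,((-1 : ℤ) : ℚ),((3 : ℤ) : ℚ)],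
        x ∈ order (-1) 3 ∧ x.re = 0 ∧ (x * star x).re = t ∧ moebius (rho (-1) 3 (by norm_num) (castQ (-1) 3 x)) τ = τ} ↦
      ∃ v : ℍ[ℚ,((-1 : ℤ) : ℚ),((3 : ℤ) : ℚ)], (v ∈ order (-1) 3 ∨ v - ⟨1/2, 1/2, 1/2, -1/2⟩ ∈ order (-1) 3) ∧
        v * star v = 1 ∧ moebius (rho (-1) 3 (by norm_num) (castQ (-1) 3 v)) p.1 = q.1)
      (fun p q : {τ : ℂ // 0 < τ.im ∧ ∃ x : ℍ[ℚ,((-1 : ℤ) : ℚ),((3 : ℤ) : ℚ)],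
        x ∈ order (-1) 3 ∧ x.re = 0 ∧ (x * star x).re = t ∧ moebius (rho (-1) 3 (by norm_num) (castQ (-1) 3 x)) τ = τ} ↦
      ∃ g : ℍ[ℚ,((-1 : ℤ) : ℚ),((3 : ℤ) : ℚ)], g ≠ 0 ∧
        (∀ a : ℍ[ℚ,((-1 : ℤ) : ℚ),((3 : ℤ) : ℚ)], (a ∈ order (-1) 3 ∨ a - ⟨1/2, 1/2, 1/2, -1/2⟩ ∈ order (-1) 3) →
          ∃ b : ℍ[ℚ,((-1 : ℤ) : ℚ),((3 : ℤ) : ℚ)], (b ∈ order (-1) 3 ∨ b - ⟨1/2, 1/2, 1/2, -1/2⟩ ∈ order (-1) 3) ∧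
            g * a = b * g) ∧
        0 < (g * star g).re ∧ (∃ s : ℚ, (g * star g).re = s ^ 2 ∨ (g * star g).re = 6 * s ^ 2) ∧
        moebius (rho (-1) 3 (by norm_num) (castQ (-1) 3 g)) p.1 = q.1)
      (atkinLehnerQuotient_rel_of_specialPoints_rel t 6) b = Quot.mk _ p ↔
      (b = Quot.mk _ p ∨ b = Quot.mk _ (⟨moebius (rho (-1) 3 (by norm_num) (castQ (-1) 3 (⟨3, 3, 0, 2⟩ : ℍ[ℚ,((-1 : ℤ) : ℚ),((3 : ℤ) : ℚ)]))) p.1, moebius_w6_mem_specialPoints p.2.1 p.2.2⟩ : {τ : ℂ // 0 < τ.im ∧ ∃ x : ℍ[ℚ,((-1 : ℤ) : ℚ),((3 : ℤ) : ℚ)],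
        x ∈ order (-1) 3 ∧ x.re = 0 ∧ (x * star x).re = t ∧ moebius (rho (-1) 3 (by norm_num) (castQ (-1) 3 x)) τ = τ})) := by
    intro b
    induction b using Quot.ind with
    | _ p' => exact factor_mk_eq_mk_iff_atkinLehnerQuotientSix p' p
  rw [(card_eq_one_iff_of_iff_eq_or_eq₂₁ hF).2.1, ← card_fibre_atkinLehnerQuotientSix_eq_one_iff p,
    (card_eq_one_iff_of_iff_eq_or_eq₂₁ hF).1]

/-- Every fibre of `X₆ → X₆^{(6)}` on `Z(t)` has one or two classes (a double cover). [cite: Ogg1983RealPoints, §2 (3)–(4)] [cite: BayerTravesa2007, §2 p. 318] -/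
theorem card_fibre_atkinLehnerQuotientSix_eq_one_or_eq_two {t : ℤ} (c : (Quot (fun p q : {τ : ℂ // 0 < τ.im ∧ ∃ x : ℍ[ℚ,((-1 : ℤ) : ℚ),((3 : ℤ) : ℚ)],
        x ∈ order (-1) 3 ∧ x.re = 0 ∧ (x * star x).re = t ∧ moebius (rho (-1) 3 (by norm_num) (castQ (-1) 3 x)) τ = τ} ↦
      ∃ g : ℍ[ℚ,((-1 : ℤ) : ℚ),((3 : ℤ) : ℚ)], g ≠ 0 ∧
        (∀ a : ℍ[ℚ,((-1 : ℤ) : ℚ),((3 : ℤ) : ℚ)], (a ∈ order (-1) 3 ∨ a - ⟨1/2, 1/2, 1/2, -1/2⟩ ∈ order (-1) 3) →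
          ∃ b : ℍ[ℚ,((-1 : ℤ) : ℚ),((3 : ℤ) : ℚ)], (b ∈ order (-1) 3 ∨ b - ⟨1/2, 1/2, 1/2, -1/2⟩ ∈ order (-1) 3) ∧
            g * a = b * g) ∧
        0 < (g * star g).re ∧ (∃ s : ℚ, (g * star g).re = s ^ 2 ∨ (g * star g).re = 6 * s ^ 2) ∧
        moebius (rho (-1) 3 (by norm_num) (castQ (-1) 3 g)) p.1 = q.1))) :
    Nat.card {a : (Quot (fun p q : {τ : ℂ // 0 < τ.im ∧ ∃ x : ℍ[ℚ,((-1 : ℤ) : ℚ),((3 : ℤ) : ℚ)],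
        x ∈ order (-1) 3 ∧ x.re = 0 ∧ (x * star x).re = t ∧ moebius (rho (-1) 3 (by norm_num) (castQ (-1) 3 x)) τ = τ} ↦
      ∃ v : ℍ[ℚ,((-1 : ℤ) : ℚ),((3 : ℤ) : ℚ)], (v ∈ order (-1) 3 ∨ v - ⟨1/2, 1/2, 1/2, -1/2⟩ ∈ order (-1) 3) ∧
        v * star v = 1 ∧ moebius (rho (-1) 3 (by norm_num) (castQ (-1) 3 v)) p.1 = q.1)) //
      Quot.factor (fun p q : {τ : ℂ // 0 < τ.im ∧ ∃ x : ℍ[ℚ,((-1 : ℤ) : ℚ),((3 : ℤ) : ℚ)],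
        x ∈ order (-1) 3 ∧ x.re = 0 ∧ (x * star x).re = t ∧ moebius (rho (-1) 3 (by norm_num) (castQ (-1) 3 x)) τ = τ} ↦
      ∃ v : ℍ[ℚ,((-1 : ℤ) : ℚ),((3 : ℤ) : ℚ)], (v ∈ order (-1) 3 ∨ v - ⟨1/2, 1/2, 1/2, -1/2⟩ ∈ order (-1) 3) ∧
        v * star v = 1 ∧ moebius (rho (-1) 3 (by norm_num) (castQ (-1) 3 v)) p.1 = q.1)
      (fun p q : {τ : ℂ // 0 < τ.im ∧ ∃ x : ℍ[ℚ,((-1 : ℤ) : ℚ),((3 : ℤ) : ℚ)],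
        x ∈ order (-1) 3 ∧ x.re = 0 ∧ (x * star x).re = t ∧ moebius (rho (-1) 3 (by norm_num) (castQ (-1) 3 x)) τ = τ} ↦
      ∃ g : ℍ[ℚ,((-1 : ℤ) : ℚ),((3 : ℤ) : ℚ)], g ≠ 0 ∧
        (∀ a : ℍ[ℚ,((-1 : ℤ) : ℚ),((3 : ℤ) : ℚ)], (a ∈ order (-1) 3 ∨ a - ⟨1/2, 1/2, 1/2, -1/2⟩ ∈ order (-1) 3) →
          ∃ b : ℍ[ℚ,((-1 : ℤ) : ℚ),((3 : ℤ) : ℚ)], (b ∈ order (-1) 3 ∨ b - ⟨1/2, 1/2, 1/2, -1/2⟩ ∈ order (-1) 3) ∧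
            g * a = b * g) ∧
        0 < (g * star g).re ∧ (∃ s : ℚ, (g * star g).re = s ^ 2 ∨ (g * star g).re = 6 * s ^ 2) ∧
        moebius (rho (-1) 3 (by norm_num) (castQ (-1) 3 g)) p.1 = q.1)
      (atkinLehnerQuotient_rel_of_specialPoints_rel t 6) a = c} = 1 ∨
    Nat.card {a : (Quot (fun p q : {τ : ℂ // 0 < τ.im ∧ ∃ x : ℍ[ℚ,((-1 : ℤ) : ℚ),((3 : ℤ) : ℚ)],
        x ∈ order (-1) 3 ∧ x.re = 0 ∧ (x * star x).re = t ∧ moebius (rho (-1) 3 (by norm_num) (castQ (-1) 3 x)) τ = τ} ↦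
      ∃ v : ℍ[ℚ,((-1 : ℤ) : ℚ),((3 : ℤ) : ℚ)], (v ∈ order (-1) 3 ∨ v - ⟨1/2, 1/2, 1/2, -1/2⟩ ∈ order (-1) 3) ∧
        v * star v = 1 ∧ moebius (rho (-1) 3 (by norm_num) (castQ (-1) 3 v)) p.1 = q.1)) //
      Quot.factor (fun p q : {τ : ℂ // 0 < τ.im ∧ ∃ x : ℍ[ℚ,((-1 : ℤ) : ℚ),((3 : ℤ) : ℚ)],
        x ∈ order (-1) 3 ∧ x.re = 0 ∧ (x * star x).re = t ∧ moebius (rho (-1) 3 (by norm_num) (castQ (-1) 3 x)) τ = τ} ↦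
      ∃ v : ℍ[ℚ,((-1 : ℤ) : ℚ),((3 : ℤ) : ℚ)], (v ∈ order (-1) 3 ∨ v - ⟨1/2, 1/2, 1/2, -1/2⟩ ∈ order (-1) 3) ∧
        v * star v = 1 ∧ moebius (rho (-1) 3 (by norm_num) (castQ (-1) 3 v)) p.1 = q.1)
      (fun p q : {τ : ℂ // 0 < τ.im ∧ ∃ x : ℍ[ℚ,((-1 : ℤ) : ℚ),((3 : ℤ) : ℚ)],
        x ∈ order (-1) 3 ∧ x.re = 0 ∧ (x * star x).re = t ∧ moebius (rho (-1) 3 (by norm_num) (castQ (-1) 3 x)) τ = τ} ↦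
      ∃ g : ℍ[ℚ,((-1 : ℤ) : ℚ),((3 : ℤ) : ℚ)], g ≠ 0 ∧
        (∀ a : ℍ[ℚ,((-1 : ℤ) : ℚ),((3 : ℤ) : ℚ)], (a ∈ order (-1) 3 ∨ a - ⟨1/2, 1/2, 1/2, -1/2⟩ ∈ order (-1) 3) →
          ∃ b : ℍ[ℚ,((-1 : ℤ) : ℚ),((3 : ℤ) : ℚ)], (b ∈ order (-1) 3 ∨ b - ⟨1/2, 1/2, 1/2, -1/2⟩ ∈ order (-1) 3) ∧
            g * a = b * g) ∧
        0 < (g * star g).re ∧ (∃ s : ℚ, (g * star g).re = s ^ 2 ∨ (g * star g).re = 6 * s ^ 2) ∧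
        moebius (rho (-1) 3 (by norm_num) (castQ (-1) 3 g)) p.1 = q.1)
      (atkinLehnerQuotient_rel_of_specialPoints_rel t 6) a = c} = 2 := by
  induction c using Quot.ind with
  | _ p =>
    have hF : ∀ b : (Quot (fun p q : {τ : ℂ // 0 < τ.im ∧ ∃ x : ℍ[ℚ,((-1 : ℤ) : ℚ),((3 : ℤ) : ℚ)],
        x ∈ order (-1) 3 ∧ x.re = 0 ∧ (x * star x).re = t ∧ moebius (rho (-1) 3 (by norm_num) (castQ (-1) 3 x)) τ = τ} ↦
      ∃ v : ℍ[ℚ,((-1 : ℤ) : ℚ),((3 : ℤ) : ℚ)], (v ∈ order (-1) 3 ∨ v - ⟨1/2, 1/2, 1/2, -1/2⟩ ∈ order (-1) 3) ∧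
        v * star v = 1 ∧ moebius (rho (-1) 3 (by norm_num) (castQ (-1) 3 v)) p.1 = q.1)),
        Quot.factor (fun p q : {τ : ℂ // 0 < τ.im ∧ ∃ x : ℍ[ℚ,((-1 : ℤ) : ℚ),((3 : ℤ) : ℚ)],
        x ∈ order (-1) 3 ∧ x.re = 0 ∧ (x * star x).re = t ∧ moebius (rho (-1) 3 (by norm_num) (castQ (-1) 3 x)) τ = τ} ↦
      ∃ v : ℍ[ℚ,((-1 : ℤ) : ℚ),((3 : ℤ) : ℚ)], (v ∈ order (-1) 3 ∨ v - ⟨1/2, 1/2, 1/2, -1/2⟩ ∈ order (-1) 3) ∧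
        v * star v = 1 ∧ moebius (rho (-1) 3 (by norm_num) (castQ (-1) 3 v)) p.1 = q.1)
      (fun p q : {τ : ℂ // 0 < τ.im ∧ ∃ x : ℍ[ℚ,((-1 : ℤ) : ℚ),((3 : ℤ) : ℚ)],
        x ∈ order (-1) 3 ∧ x.re = 0 ∧ (x * star x).re = t ∧ moebius (rho (-1) 3 (by norm_num) (castQ (-1) 3 x)) τ = τ} ↦
      ∃ g : ℍ[ℚ,((-1 : ℤ) : ℚ),((3 : ℤ) : ℚ)], g ≠ 0 ∧
        (∀ a : ℍ[ℚ,((-1 : ℤ) : ℚ),((3 : ℤ) : ℚ)], (a ∈ order (-1) 3 ∨ a - ⟨1/2, 1/2, 1/2, -1/2⟩ ∈ order (-1) 3) →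
          ∃ b : ℍ[ℚ,((-1 : ℤ) : ℚ),((3 : ℤ) : ℚ)], (b ∈ order (-1) 3 ∨ b - ⟨1/2, 1/2, 1/2, -1/2⟩ ∈ order (-1) 3) ∧
            g * a = b * g) ∧
        0 < (g * star g).re ∧ (∃ s : ℚ, (g * star g).re = s ^ 2 ∨ (g * star g).re = 6 * s ^ 2) ∧
        moebius (rho (-1) 3 (by norm_num) (castQ (-1) 3 g)) p.1 = q.1)
      (atkinLehnerQuotient_rel_of_specialPoints_rel t 6) b = Quot.mk _ p ↔
        (b = Quot.mk _ p ∨ b = Quot.mk _ (⟨moebius (rho (-1) 3 (by norm_num) (castQ (-1) 3 (⟨3, 3, 0, 2⟩ : ℍ[ℚ,((-1 : ℤ) : ℚ),((3 : ℤ) : ℚ)]))) p.1, moebius_w6_mem_specialPoints p.2.1 p.2.2⟩ : {τ : ℂ // 0 < τ.im ∧ ∃ x : ℍ[ℚ,((-1 : ℤ) : ℚ),((3 : ℤ) : ℚ)],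
        x ∈ order (-1) 3 ∧ x.re = 0 ∧ (x * star x).re = t ∧ moebius (rho (-1) 3 (by norm_num) (castQ (-1) 3 x)) τ = τ})) := by
      intro b
      induction b using Quot.ind with
      | _ p' => exact factor_mk_eq_mk_iff_atkinLehnerQuotientSix p' p
    exact (card_eq_one_iff_of_iff_eq_or_eq₂₁ hF).2.2

/-- **CLASS EQUATION OF `X₆ → X₆^{(6)}` ON `Z(t)`** (`t > 0`): `#(Pt(t)/Γ₆) + #{one-class fibres} = 2·#(Pt(t)/Γ₆^{(6)})`.
[cite: Ogg1983RealPoints, §2 (3)–(4)] [cite: BayerTravesa2007, §2 p. 318] -/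
theorem card_specialPoints_add_card_oneFibres_eq_two_mul_card_atkinLehnerQuotientSix {t : ℤ} (ht : 0 < t) :
    Nat.card (Quot (fun p q : {τ : ℂ // 0 < τ.im ∧ ∃ x : ℍ[ℚ,((-1 : ℤ) : ℚ),((3 : ℤ) : ℚ)],
        x ∈ order (-1) 3 ∧ x.re = 0 ∧ (x * star x).re = t ∧ moebius (rho (-1) 3 (by norm_num) (castQ (-1) 3 x)) τ = τ} ↦
      ∃ v : ℍ[ℚ,((-1 : ℤ) : ℚ),((3 : ℤ) : ℚ)], (v ∈ order (-1) 3 ∨ v - ⟨1/2, 1/2, 1/2, -1/2⟩ ∈ order (-1) 3) ∧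
        v * star v = 1 ∧ moebius (rho (-1) 3 (by norm_num) (castQ (-1) 3 v)) p.1 = q.1)) +
    Nat.card {c : (Quot (fun p q : {τ : ℂ // 0 < τ.im ∧ ∃ x : ℍ[ℚ,((-1 : ℤ) : ℚ),((3 : ℤ) : ℚ)],
        x ∈ order (-1) 3 ∧ x.re = 0 ∧ (x * star x).re = t ∧ moebius (rho (-1) 3 (by norm_num) (castQ (-1) 3 x)) τ = τ} ↦
      ∃ g : ℍ[ℚ,((-1 : ℤ) : ℚ),((3 : ℤ) : ℚ)], g ≠ 0 ∧
        (∀ a : ℍ[ℚ,((-1 : ℤ) : ℚ),((3 : ℤ) : ℚ)], (a ∈ order (-1) 3 ∨ a - ⟨1/2, 1/2, 1/2, -1/2⟩ ∈ order (-1) 3) →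
          ∃ b : ℍ[ℚ,((-1 : ℤ) : ℚ),((3 : ℤ) : ℚ)], (b ∈ order (-1) 3 ∨ b - ⟨1/2, 1/2, 1/2, -1/2⟩ ∈ order (-1) 3) ∧
            g * a = b * g) ∧
        0 < (g * star g).re ∧ (∃ s : ℚ, (g * star g).re = s ^ 2 ∨ (g * star g).re = 6 * s ^ 2) ∧
        moebius (rho (-1) 3 (by norm_num) (castQ (-1) 3 g)) p.1 = q.1)) //
      Nat.card {a : (Quot (fun p q : {τ : ℂ // 0 < τ.im ∧ ∃ x : ℍ[ℚ,((-1 : ℤ) : ℚ),((3 : ℤ) : ℚ)],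
        x ∈ order (-1) 3 ∧ x.re = 0 ∧ (x * star x).re = t ∧ moebius (rho (-1) 3 (by norm_num) (castQ (-1) 3 x)) τ = τ} ↦
      ∃ v : ℍ[ℚ,((-1 : ℤ) : ℚ),((3 : ℤ) : ℚ)], (v ∈ order (-1) 3 ∨ v - ⟨1/2, 1/2, 1/2, -1/2⟩ ∈ order (-1) 3) ∧
        v * star v = 1 ∧ moebius (rho (-1) 3 (by norm_num) (castQ (-1) 3 v)) p.1 = q.1)) //
        Quot.factor (fun p q : {τ : ℂ // 0 < τ.im ∧ ∃ x : ℍ[ℚ,((-1 : ℤ) : ℚ),((3 : ℤ) : ℚ)],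
        x ∈ order (-1) 3 ∧ x.re = 0 ∧ (x * star x).re = t ∧ moebius (rho (-1) 3 (by norm_num) (castQ (-1) 3 x)) τ = τ} ↦
      ∃ v : ℍ[ℚ,((-1 : ℤ) : ℚ),((3 : ℤ) : ℚ)], (v ∈ order (-1) 3 ∨ v - ⟨1/2, 1/2, 1/2, -1/2⟩ ∈ order (-1) 3) ∧
        v * star v = 1 ∧ moebius (rho (-1) 3 (by norm_num) (castQ (-1) 3 v)) p.1 = q.1)
      (fun p q : {τ : ℂ // 0 < τ.im ∧ ∃ x : ℍ[ℚ,((-1 : ℤ) : ℚ),((3 : ℤ) : ℚ)],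
        x ∈ order (-1) 3 ∧ x.re = 0 ∧ (x * star x).re = t ∧ moebius (rho (-1) 3 (by norm_num) (castQ (-1) 3 x)) τ = τ} ↦
      ∃ g : ℍ[ℚ,((-1 : ℤ) : ℚ),((3 : ℤ) : ℚ)], g ≠ 0 ∧
        (∀ a : ℍ[ℚ,((-1 : ℤ) : ℚ),((3 : ℤ) : ℚ)], (a ∈ order (-1) 3 ∨ a - ⟨1/2, 1/2, 1/2, -1/2⟩ ∈ order (-1) 3) →
          ∃ b : ℍ[ℚ,((-1 : ℤ) : ℚ),((3 : ℤ) : ℚ)], (b ∈ order (-1) 3 ∨ b - ⟨1/2, 1/2, 1/2, -1/2⟩ ∈ order (-1) 3) ∧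
            g * a = b * g) ∧
        0 < (g * star g).re ∧ (∃ s : ℚ, (g * star g).re = s ^ 2 ∨ (g * star g).re = 6 * s ^ 2) ∧
        moebius (rho (-1) 3 (by norm_num) (castQ (-1) 3 g)) p.1 = q.1)
      (atkinLehnerQuotient_rel_of_specialPoints_rel t 6) a = c} = 1} =
    2 * Nat.card (Quot (fun p q : {τ : ℂ // 0 < τ.im ∧ ∃ x : ℍ[ℚ,((-1 : ℤ) : ℚ),((3 : ℤ) : ℚ)],
        x ∈ order (-1) 3 ∧ x.re = 0 ∧ (x * star x).re = t ∧ moebius (rho (-1) 3 (by norm_num) (castQ (-1) 3 x)) τ = τ} ↦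
      ∃ g : ℍ[ℚ,((-1 : ℤ) : ℚ),((3 : ℤ) : ℚ)], g ≠ 0 ∧
        (∀ a : ℍ[ℚ,((-1 : ℤ) : ℚ),((3 : ℤ) : ℚ)], (a ∈ order (-1) 3 ∨ a - ⟨1/2, 1/2, 1/2, -1/2⟩ ∈ order (-1) 3) →
          ∃ b : ℍ[ℚ,((-1 : ℤ) : ℚ),((3 : ℤ) : ℚ)], (b ∈ order (-1) 3 ∨ b - ⟨1/2, 1/2, 1/2, -1/2⟩ ∈ order (-1) 3) ∧
            g * a = b * g) ∧
        0 < (g * star g).re ∧ (∃ s : ℚ, (g * star g).re = s ^ 2 ∨ (g * star g).re = 6 * s ^ 2) ∧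
        moebius (rho (-1) 3 (by norm_num) (castQ (-1) 3 g)) p.1 = q.1)) := by
  haveI := finite_specialPoints ht
  haveI := finite_atkinLehnerQuotient ht 6
  exact card_add_card_eq_two_mul₂₁ _ card_fibre_atkinLehnerQuotientSix_eq_one_or_eq_two

/-- **THE ONE-CLASS FIBRES OF `X₆ → X₆^{(6)}` ON `Z(t)` ARE COUNTED BY `#((Pt(t) ∩ Pt(6))/Γ₆)`** (`t > 0`) — the fibrewise
count agrees with Burnside's (`…XSixAtkinLehnerQuotientsSpecialPoints`:
`#(Pt(t)/Γ₆) + #((Pt(t) ∩ Pt(6))/Γ₆) = 2·#(Pt(t)/Γ₆^{(6)})`). [cite: Ogg1983RealPoints, §2 (3)–(4)] [cite: BayerTravesa2007, §2 p. 318 and §7 Table 9] -/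
theorem card_oneFibres_atkinLehnerQuotientSix_eq_card_inter {t : ℤ} (ht : 0 < t) :
    Nat.card {c : (Quot (fun p q : {τ : ℂ // 0 < τ.im ∧ ∃ x : ℍ[ℚ,((-1 : ℤ) : ℚ),((3 : ℤ) : ℚ)],
        x ∈ order (-1) 3 ∧ x.re = 0 ∧ (x * star x).re = t ∧ moebius (rho (-1) 3 (by norm_num) (castQ (-1) 3 x)) τ = τ} ↦
      ∃ g : ℍ[ℚ,((-1 : ℤ) : ℚ),((3 : ℤ) : ℚ)], g ≠ 0 ∧
        (∀ a : ℍ[ℚ,((-1 : ℤ) : ℚ),((3 : ℤ) : ℚ)], (a ∈ order (-1) 3 ∨ a - ⟨1/2, 1/2, 1/2, -1/2⟩ ∈ order (-1) 3) →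
          ∃ b : ℍ[ℚ,((-1 : ℤ) : ℚ),((3 : ℤ) : ℚ)], (b ∈ order (-1) 3 ∨ b - ⟨1/2, 1/2, 1/2, -1/2⟩ ∈ order (-1) 3) ∧
            g * a = b * g) ∧
        0 < (g * star g).re ∧ (∃ s : ℚ, (g * star g).re = s ^ 2 ∨ (g * star g).re = 6 * s ^ 2) ∧
        moebius (rho (-1) 3 (by norm_num) (castQ (-1) 3 g)) p.1 = q.1)) //
      Nat.card {a : (Quot (fun p q : {τ : ℂ // 0 < τ.im ∧ ∃ x : ℍ[ℚ,((-1 : ℤ) : ℚ),((3 : ℤ) : ℚ)],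
        x ∈ order (-1) 3 ∧ x.re = 0 ∧ (x * star x).re = t ∧ moebius (rho (-1) 3 (by norm_num) (castQ (-1) 3 x)) τ = τ} ↦
      ∃ v : ℍ[ℚ,((-1 : ℤ) : ℚ),((3 : ℤ) : ℚ)], (v ∈ order (-1) 3 ∨ v - ⟨1/2, 1/2, 1/2, -1/2⟩ ∈ order (-1) 3) ∧
        v * star v = 1 ∧ moebius (rho (-1) 3 (by norm_num) (castQ (-1) 3 v)) p.1 = q.1)) //
        Quot.factor (fun p q : {τ : ℂ // 0 < τ.im ∧ ∃ x : ℍ[ℚ,((-1 : ℤ) : ℚ),((3 : ℤ) : ℚ)],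
        x ∈ order (-1) 3 ∧ x.re = 0 ∧ (x * star x).re = t ∧ moebius (rho (-1) 3 (by norm_num) (castQ (-1) 3 x)) τ = τ} ↦
      ∃ v : ℍ[ℚ,((-1 : ℤ) : ℚ),((3 : ℤ) : ℚ)], (v ∈ order (-1) 3 ∨ v - ⟨1/2, 1/2, 1/2, -1/2⟩ ∈ order (-1) 3) ∧
        v * star v = 1 ∧ moebius (rho (-1) 3 (by norm_num) (castQ (-1) 3 v)) p.1 = q.1)
      (fun p q : {τ : ℂ // 0 < τ.im ∧ ∃ x : ℍ[ℚ,((-1 : ℤ) : ℚ),((3 : ℤ) : ℚ)],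
        x ∈ order (-1) 3 ∧ x.re = 0 ∧ (x * star x).re = t ∧ moebius (rho (-1) 3 (by norm_num) (castQ (-1) 3 x)) τ = τ} ↦
      ∃ g : ℍ[ℚ,((-1 : ℤ) : ℚ),((3 : ℤ) : ℚ)], g ≠ 0 ∧
        (∀ a : ℍ[ℚ,((-1 : ℤ) : ℚ),((3 : ℤ) : ℚ)], (a ∈ order (-1) 3 ∨ a - ⟨1/2, 1/2, 1/2, -1/2⟩ ∈ order (-1) 3) →
          ∃ b : ℍ[ℚ,((-1 : ℤ) : ℚ),((3 : ℤ) : ℚ)], (b ∈ order (-1) 3 ∨ b - ⟨1/2, 1/2, 1/2, -1/2⟩ ∈ order (-1) 3) ∧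
            g * a = b * g) ∧
        0 < (g * star g).re ∧ (∃ s : ℚ, (g * star g).re = s ^ 2 ∨ (g * star g).re = 6 * s ^ 2) ∧
        moebius (rho (-1) 3 (by norm_num) (castQ (-1) 3 g)) p.1 = q.1)
      (atkinLehnerQuotient_rel_of_specialPoints_rel t 6) a = c} = 1} =
    Nat.card (Quot (fun p q : {τ : ℂ // 0 < τ.im ∧ (∃ x : ℍ[ℚ,((-1 : ℤ) : ℚ),((3 : ℤ) : ℚ)],
        x ∈ order (-1) 3 ∧ x.re = 0 ∧ (x * star x).re = t ∧ moebius (rho (-1) 3 (by norm_num) (castQ (-1) 3 x)) τ = τ) ∧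
        (∃ y : ℍ[ℚ,((-1 : ℤ) : ℚ),((3 : ℤ) : ℚ)], y ∈ order (-1) 3 ∧ y.re = 0 ∧ (y * star y).re = ((6 : ℤ) : ℚ) ∧
          moebius (rho (-1) 3 (by norm_num) (castQ (-1) 3 y)) τ = τ)} ↦
      ∃ v : ℍ[ℚ,((-1 : ℤ) : ℚ),((3 : ℤ) : ℚ)], (v ∈ order (-1) 3 ∨ v - ⟨1/2, 1/2, 1/2, -1/2⟩ ∈ order (-1) 3) ∧
        v * star v = 1 ∧ moebius (rho (-1) 3 (by norm_num) (castQ (-1) 3 v)) p.1 = q.1)) := by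
  have h1 := card_specialPoints_add_card_oneFibres_eq_two_mul_card_atkinLehnerQuotientSix ht
  have h2 := card_specialPoints_add_card_inter_eq_two_mul_card_atkinLehnerQuotientSix ht
  omega

/-- **`ρ(μ)ρ(w₂)τ ∼_{Γ₆} τ ⟺ τ ∈ Pt(6)`**: the fixed classes of `ω₃ω₂ = ω₆` are the `Z(6)`-points (`[ρ(μ)ρ(w₂)τ] =
[ρ(w₂)ρ(μ)τ]` and `normOne_moebius_w2_mu_fixed_iff`). [cite: Ogg1983RealPoints, §2 pp. 283–284] [cite: BayerTravesa2007, §7 Table 9] -/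
theorem normOne_moebius_mu_w2_fixed_iff {t : ℤ} (p : {τ : ℂ // 0 < τ.im ∧ ∃ x : ℍ[ℚ,((-1 : ℤ) : ℚ),((3 : ℤ) : ℚ)],
        x ∈ order (-1) 3 ∧ x.re = 0 ∧ (x * star x).re = t ∧ moebius (rho (-1) 3 (by norm_num) (castQ (-1) 3 x)) τ = τ}) :
    (∃ v : ℍ[ℚ,((-1 : ℤ) : ℚ),((3 : ℤ) : ℚ)], (v ∈ order (-1) 3 ∨ v - ⟨1/2, 1/2, 1/2, -1/2⟩ ∈ order (-1) 3) ∧ v * star v = 1 ∧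
      moebius (rho (-1) 3 (by norm_num) (castQ (-1) 3 v)) (moebius (rho (-1) 3 (by norm_num) (castQ (-1) 3 (⟨3, 0, 1, 1⟩ : ℍ[ℚ,((-1 : ℤ) : ℚ),((3 : ℤ) : ℚ)])))
        (moebius (rho (-1) 3 (by norm_num) (castQ (-1) 3 (⟨1, 1, 0, 0⟩ : ℍ[ℚ,((-1 : ℤ) : ℚ),((3 : ℤ) : ℚ)]))) p.1)) = p.1) ↔
    (∃ y : ℍ[ℚ,((-1 : ℤ) : ℚ),((3 : ℤ) : ℚ)], y ∈ order (-1) 3 ∧ y.re = 0 ∧ (y * star y).re = 6 ∧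
        moebius (rho (-1) 3 (by norm_num) (castQ (-1) 3 y)) p.1 = p.1) := by
  rw [← normOne_moebius_w2_mu_fixed_iff p.2.1]
  have e : (Quot.mk (fun p q : {τ : ℂ // 0 < τ.im ∧ ∃ x : ℍ[ℚ,((-1 : ℤ) : ℚ),((3 : ℤ) : ℚ)],
        x ∈ order (-1) 3 ∧ x.re = 0 ∧ (x * star x).re = t ∧ moebius (rho (-1) 3 (by norm_num) (castQ (-1) 3 x)) τ = τ} ↦
      ∃ v : ℍ[ℚ,((-1 : ℤ) : ℚ),((3 : ℤ) : ℚ)], (v ∈ order (-1) 3 ∨ v - ⟨1/2, 1/2, 1/2, -1/2⟩ ∈ order (-1) 3) ∧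
        v * star v = 1 ∧ moebius (rho (-1) 3 (by norm_num) (castQ (-1) 3 v)) p.1 = q.1) (⟨moebius (rho (-1) 3 (by norm_num) (castQ (-1) 3 (⟨3, 0, 1, 1⟩ : ℍ[ℚ,((-1 : ℤ) : ℚ),((3 : ℤ) : ℚ)]))) (⟨moebius (rho (-1) 3 (by norm_num) (castQ (-1) 3 (⟨1, 1, 0, 0⟩ : ℍ[ℚ,((-1 : ℤ) : ℚ),((3 : ℤ) : ℚ)]))) p.1, moebius_w2_mem_specialPoints p.2.1 p.2.2⟩ : {τ : ℂ // 0 < τ.im ∧ ∃ x : ℍ[ℚ,((-1 : ℤ) : ℚ),((3 : ℤ) : ℚ)],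
        x ∈ order (-1) 3 ∧ x.re = 0 ∧ (x * star x).re = t ∧ moebius (rho (-1) 3 (by norm_num) (castQ (-1) 3 x)) τ = τ}).1, moebius_mu_mem_specialPoints (⟨moebius (rho (-1) 3 (by norm_num) (castQ (-1) 3 (⟨1, 1, 0, 0⟩ : ℍ[ℚ,((-1 : ℤ) : ℚ),((3 : ℤ) : ℚ)]))) p.1, moebius_w2_mem_specialPoints p.2.1 p.2.2⟩ : {τ : ℂ // 0 < τ.im ∧ ∃ x : ℍ[ℚ,((-1 : ℤ) : ℚ),((3 : ℤ) : ℚ)],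
        x ∈ order (-1) 3 ∧ x.re = 0 ∧ (x * star x).re = t ∧ moebius (rho (-1) 3 (by norm_num) (castQ (-1) 3 x)) τ = τ}).2.1 (⟨moebius (rho (-1) 3 (by norm_num) (castQ (-1) 3 (⟨1, 1, 0, 0⟩ : ℍ[ℚ,((-1 : ℤ) : ℚ),((3 : ℤ) : ℚ)]))) p.1, moebius_w2_mem_specialPoints p.2.1 p.2.2⟩ : {τ : ℂ // 0 < τ.im ∧ ∃ x : ℍ[ℚ,((-1 : ℤ) : ℚ),((3 : ℤ) : ℚ)],
        x ∈ order (-1) 3 ∧ x.re = 0 ∧ (x * star x).re = t ∧ moebius (rho (-1) 3 (by norm_num) (castQ (-1) 3 x)) τ = τ}).2.2⟩ : {τ : ℂ // 0 < τ.im ∧ ∃ x : ℍ[ℚ,((-1 : ℤ) : ℚ),((3 : ℤ) : ℚ)],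
        x ∈ order (-1) 3 ∧ x.re = 0 ∧ (x * star x).re = t ∧ moebius (rho (-1) 3 (by norm_num) (castQ (-1) 3 x)) τ = τ}) = Quot.mk _ p) ↔ (Quot.mk (fun p q : {τ : ℂ // 0 < τ.im ∧ ∃ x : ℍ[ℚ,((-1 : ℤ) : ℚ),((3 : ℤ) : ℚ)],
        x ∈ order (-1) 3 ∧ x.re = 0 ∧ (x * star x).re = t ∧ moebius (rho (-1) 3 (by norm_num) (castQ (-1) 3 x)) τ = τ} ↦
      ∃ v : ℍ[ℚ,((-1 : ℤ) : ℚ),((3 : ℤ) : ℚ)], (v ∈ order (-1) 3 ∨ v - ⟨1/2, 1/2, 1/2, -1/2⟩ ∈ order (-1) 3) ∧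
        v * star v = 1 ∧ moebius (rho (-1) 3 (by norm_num) (castQ (-1) 3 v)) p.1 = q.1) (⟨moebius (rho (-1) 3 (by norm_num) (castQ (-1) 3 (⟨1, 1, 0, 0⟩ : ℍ[ℚ,((-1 : ℤ) : ℚ),((3 : ℤ) : ℚ)]))) (⟨moebius (rho (-1) 3 (by norm_num) (castQ (-1) 3 (⟨3, 0, 1, 1⟩ : ℍ[ℚ,((-1 : ℤ) : ℚ),((3 : ℤ) : ℚ)]))) p.1, moebius_mu_mem_specialPoints p.2.1 p.2.2⟩ : {τ : ℂ // 0 < τ.im ∧ ∃ x : ℍ[ℚ,((-1 : ℤ) : ℚ),((3 : ℤ) : ℚ)],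
        x ∈ order (-1) 3 ∧ x.re = 0 ∧ (x * star x).re = t ∧ moebius (rho (-1) 3 (by norm_num) (castQ (-1) 3 x)) τ = τ}).1, moebius_w2_mem_specialPoints (⟨moebius (rho (-1) 3 (by norm_num) (castQ (-1) 3 (⟨3, 0, 1, 1⟩ : ℍ[ℚ,((-1 : ℤ) : ℚ),((3 : ℤ) : ℚ)]))) p.1, moebius_mu_mem_specialPoints p.2.1 p.2.2⟩ : {τ : ℂ // 0 < τ.im ∧ ∃ x : ℍ[ℚ,((-1 : ℤ) : ℚ),((3 : ℤ) : ℚ)],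
        x ∈ order (-1) 3 ∧ x.re = 0 ∧ (x * star x).re = t ∧ moebius (rho (-1) 3 (by norm_num) (castQ (-1) 3 x)) τ = τ}).2.1 (⟨moebius (rho (-1) 3 (by norm_num) (castQ (-1) 3 (⟨3, 0, 1, 1⟩ : ℍ[ℚ,((-1 : ℤ) : ℚ),((3 : ℤ) : ℚ)]))) p.1, moebius_mu_mem_specialPoints p.2.1 p.2.2⟩ : {τ : ℂ // 0 < τ.im ∧ ∃ x : ℍ[ℚ,((-1 : ℤ) : ℚ),((3 : ℤ) : ℚ)],
        x ∈ order (-1) 3 ∧ x.re = 0 ∧ (x * star x).re = t ∧ moebius (rho (-1) 3 (by norm_num) (castQ (-1) 3 x)) τ = τ}).2.2⟩ : {τ : ℂ // 0 < τ.im ∧ ∃ x : ℍ[ℚ,((-1 : ℤ) : ℚ),((3 : ℤ) : ℚ)],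
        x ∈ order (-1) 3 ∧ x.re = 0 ∧ (x * star x).re = t ∧ moebius (rho (-1) 3 (by norm_num) (castQ (-1) 3 x)) τ = τ}) = Quot.mk _ p) := by
    rw [(specialPoints_mk_klein p).2.2.1]
  rw [specialPoints_mk_eq_iff, specialPoints_mk_eq_iff] at e
  exact e

/-- **`ρ(w₆)ρ(w₂)τ ∼_{Γ₆} τ ⟺ τ ∈ Pt(3)`**: the fixed classes of `ω₆ω₂ = ω₃` are the `Z(3)`-points (`[ρ(w₆)ρ(w₂)τ] =
[ρ(w₂)ρ(w₂)ρ(μ)τ] = [ρ(μ)τ]` and `normOne_moebius_mu_fixed_iff`). [cite: Ogg1983RealPoints, §2 pp. 283–284] [cite: BayerTravesa2007, §7 Table 9] -/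
theorem normOne_moebius_w6_w2_fixed_iff {t : ℤ} (p : {τ : ℂ // 0 < τ.im ∧ ∃ x : ℍ[ℚ,((-1 : ℤ) : ℚ),((3 : ℤ) : ℚ)],
        x ∈ order (-1) 3 ∧ x.re = 0 ∧ (x * star x).re = t ∧ moebius (rho (-1) 3 (by norm_num) (castQ (-1) 3 x)) τ = τ}) :
    (∃ v : ℍ[ℚ,((-1 : ℤ) : ℚ),((3 : ℤ) : ℚ)], (v ∈ order (-1) 3 ∨ v - ⟨1/2, 1/2, 1/2, -1/2⟩ ∈ order (-1) 3) ∧ v * star v = 1 ∧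
      moebius (rho (-1) 3 (by norm_num) (castQ (-1) 3 v)) (moebius (rho (-1) 3 (by norm_num) (castQ (-1) 3 (⟨3, 3, 0, 2⟩ : ℍ[ℚ,((-1 : ℤ) : ℚ),((3 : ℤ) : ℚ)])))
        (moebius (rho (-1) 3 (by norm_num) (castQ (-1) 3 (⟨1, 1, 0, 0⟩ : ℍ[ℚ,((-1 : ℤ) : ℚ),((3 : ℤ) : ℚ)]))) p.1)) = p.1) ↔
    (∃ y : ℍ[ℚ,((-1 : ℤ) : ℚ),((3 : ℤ) : ℚ)], y ∈ order (-1) 3 ∧ y.re = 0 ∧ (y * star y).re = 3 ∧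
        moebius (rho (-1) 3 (by norm_num) (castQ (-1) 3 y)) p.1 = p.1) := by
  rw [← normOne_moebius_mu_fixed_iff p.2.1]
  have hiff := specialPoints_mk_eq_iff t
  obtain ⟨cM, -, -⟩ := specialPoints_rel_map_w2_mu_w6 t
  -- `[ρ(w₆)ρ(w₂)p] = [ρ(w₂)ρ(μ)ρ(w₂)p] = [ρ(w₂)ρ(w₂)ρ(μ)p] = [ρ(μ)p]`
  have e1 : Quot.mk (fun p q : {τ : ℂ // 0 < τ.im ∧ ∃ x : ℍ[ℚ,((-1 : ℤ) : ℚ),((3 : ℤ) : ℚ)],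
        x ∈ order (-1) 3 ∧ x.re = 0 ∧ (x * star x).re = t ∧ moebius (rho (-1) 3 (by norm_num) (castQ (-1) 3 x)) τ = τ} ↦
      ∃ v : ℍ[ℚ,((-1 : ℤ) : ℚ),((3 : ℤ) : ℚ)], (v ∈ order (-1) 3 ∨ v - ⟨1/2, 1/2, 1/2, -1/2⟩ ∈ order (-1) 3) ∧
        v * star v = 1 ∧ moebius (rho (-1) 3 (by norm_num) (castQ (-1) 3 v)) p.1 = q.1) (⟨moebius (rho (-1) 3 (by norm_num) (castQ (-1) 3 (⟨3, 3, 0, 2⟩ : ℍ[ℚ,((-1 : ℤ) : ℚ),((3 : ℤ) : ℚ)]))) (⟨moebius (rho (-1) 3 (by norm_num) (castQ (-1) 3 (⟨1, 1, 0, 0⟩ : ℍ[ℚ,((-1 : ℤ) : ℚ),((3 : ℤ) : ℚ)]))) p.1, moebius_w2_mem_specialPoints p.2.1 p.2.2⟩ : {τ : ℂ // 0 < τ.im ∧ ∃ x : ℍ[ℚ,((-1 : ℤ) : ℚ),((3 : ℤ) : ℚ)],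
        x ∈ order (-1) 3 ∧ x.re = 0 ∧ (x * star x).re = t ∧ moebius (rho (-1) 3 (by norm_num) (castQ (-1) 3 x)) τ = τ}).1, moebius_w6_mem_specialPoints (⟨moebius (rho (-1) 3 (by norm_num) (castQ (-1) 3 (⟨1, 1, 0, 0⟩ : ℍ[ℚ,((-1 : ℤ) : ℚ),((3 : ℤ) : ℚ)]))) p.1, moebius_w2_mem_specialPoints p.2.1 p.2.2⟩ : {τ : ℂ // 0 < τ.im ∧ ∃ x : ℍ[ℚ,((-1 : ℤ) : ℚ),((3 : ℤ) : ℚ)],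
        x ∈ order (-1) 3 ∧ x.re = 0 ∧ (x * star x).re = t ∧ moebius (rho (-1) 3 (by norm_num) (castQ (-1) 3 x)) τ = τ}).2.1 (⟨moebius (rho (-1) 3 (by norm_num) (castQ (-1) 3 (⟨1, 1, 0, 0⟩ : ℍ[ℚ,((-1 : ℤ) : ℚ),((3 : ℤ) : ℚ)]))) p.1, moebius_w2_mem_specialPoints p.2.1 p.2.2⟩ : {τ : ℂ // 0 < τ.im ∧ ∃ x : ℍ[ℚ,((-1 : ℤ) : ℚ),((3 : ℤ) : ℚ)],
        x ∈ order (-1) 3 ∧ x.re = 0 ∧ (x * star x).re = t ∧ moebius (rho (-1) 3 (by norm_num) (castQ (-1) 3 x)) τ = τ}).2.2⟩ : {τ : ℂ // 0 < τ.im ∧ ∃ x : ℍ[ℚ,((-1 : ℤ) : ℚ),((3 : ℤ) : ℚ)],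
        x ∈ order (-1) 3 ∧ x.re = 0 ∧ (x * star x).re = t ∧ moebius (rho (-1) 3 (by norm_num) (castQ (-1) 3 x)) τ = τ}) = Quot.mk _ (⟨moebius (rho (-1) 3 (by norm_num) (castQ (-1) 3 (⟨3, 0, 1, 1⟩ : ℍ[ℚ,((-1 : ℤ) : ℚ),((3 : ℤ) : ℚ)]))) p.1, moebius_mu_mem_specialPoints p.2.1 p.2.2⟩ : {τ : ℂ // 0 < τ.im ∧ ∃ x : ℍ[ℚ,((-1 : ℤ) : ℚ),((3 : ℤ) : ℚ)],
        x ∈ order (-1) 3 ∧ x.re = 0 ∧ (x * star x).re = t ∧ moebius (rho (-1) 3 (by norm_num) (castQ (-1) 3 x)) τ = τ}) := by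
    rw [(specialPoints_mk_klein _).2.2.2, ← (specialPoints_mk_klein (⟨moebius (rho (-1) 3 (by norm_num) (castQ (-1) 3 (⟨3, 0, 1, 1⟩ : ℍ[ℚ,((-1 : ℤ) : ℚ),((3 : ℤ) : ℚ)]))) p.1, moebius_mu_mem_specialPoints p.2.1 p.2.2⟩ : {τ : ℂ // 0 < τ.im ∧ ∃ x : ℍ[ℚ,((-1 : ℤ) : ℚ),((3 : ℤ) : ℚ)],
        x ∈ order (-1) 3 ∧ x.re = 0 ∧ (x * star x).re = t ∧ moebius (rho (-1) 3 (by norm_num) (castQ (-1) 3 x)) τ = τ})).1]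
    exact (hiff _ _).2 (cM _ _ ((hiff _ _).1 ((specialPoints_mk_klein p).2.2.1).symm))
  have e : (Quot.mk (fun p q : {τ : ℂ // 0 < τ.im ∧ ∃ x : ℍ[ℚ,((-1 : ℤ) : ℚ),((3 : ℤ) : ℚ)],
        x ∈ order (-1) 3 ∧ x.re = 0 ∧ (x * star x).re = t ∧ moebius (rho (-1) 3 (by norm_num) (castQ (-1) 3 x)) τ = τ} ↦
      ∃ v : ℍ[ℚ,((-1 : ℤ) : ℚ),((3 : ℤ) : ℚ)], (v ∈ order (-1) 3 ∨ v - ⟨1/2, 1/2, 1/2, -1/2⟩ ∈ order (-1) 3) ∧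
        v * star v = 1 ∧ moebius (rho (-1) 3 (by norm_num) (castQ (-1) 3 v)) p.1 = q.1) (⟨moebius (rho (-1) 3 (by norm_num) (castQ (-1) 3 (⟨3, 3, 0, 2⟩ : ℍ[ℚ,((-1 : ℤ) : ℚ),((3 : ℤ) : ℚ)]))) (⟨moebius (rho (-1) 3 (by norm_num) (castQ (-1) 3 (⟨1, 1, 0, 0⟩ : ℍ[ℚ,((-1 : ℤ) : ℚ),((3 : ℤ) : ℚ)]))) p.1, moebius_w2_mem_specialPoints p.2.1 p.2.2⟩ : {τ : ℂ // 0 < τ.im ∧ ∃ x : ℍ[ℚ,((-1 : ℤ) : ℚ),((3 : ℤ) : ℚ)],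
        x ∈ order (-1) 3 ∧ x.re = 0 ∧ (x * star x).re = t ∧ moebius (rho (-1) 3 (by norm_num) (castQ (-1) 3 x)) τ = τ}).1, moebius_w6_mem_specialPoints (⟨moebius (rho (-1) 3 (by norm_num) (castQ (-1) 3 (⟨1, 1, 0, 0⟩ : ℍ[ℚ,((-1 : ℤ) : ℚ),((3 : ℤ) : ℚ)]))) p.1, moebius_w2_mem_specialPoints p.2.1 p.2.2⟩ : {τ : ℂ // 0 < τ.im ∧ ∃ x : ℍ[ℚ,((-1 : ℤ) : ℚ),((3 : ℤ) : ℚ)],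
        x ∈ order (-1) 3 ∧ x.re = 0 ∧ (x * star x).re = t ∧ moebius (rho (-1) 3 (by norm_num) (castQ (-1) 3 x)) τ = τ}).2.1 (⟨moebius (rho (-1) 3 (by norm_num) (castQ (-1) 3 (⟨1, 1, 0, 0⟩ : ℍ[ℚ,((-1 : ℤ) : ℚ),((3 : ℤ) : ℚ)]))) p.1, moebius_w2_mem_specialPoints p.2.1 p.2.2⟩ : {τ : ℂ // 0 < τ.im ∧ ∃ x : ℍ[ℚ,((-1 : ℤ) : ℚ),((3 : ℤ) : ℚ)],
        x ∈ order (-1) 3 ∧ x.re = 0 ∧ (x * star x).re = t ∧ moebius (rho (-1) 3 (by norm_num) (castQ (-1) 3 x)) τ = τ}).2.2⟩ : {τ : ℂ // 0 < τ.im ∧ ∃ x : ℍ[ℚ,((-1 : ℤ) : ℚ),((3 : ℤ) : ℚ)],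
        x ∈ order (-1) 3 ∧ x.re = 0 ∧ (x * star x).re = t ∧ moebius (rho (-1) 3 (by norm_num) (castQ (-1) 3 x)) τ = τ}) = Quot.mk _ p) ↔ (Quot.mk (fun p q : {τ : ℂ // 0 < τ.im ∧ ∃ x : ℍ[ℚ,((-1 : ℤ) : ℚ),((3 : ℤ) : ℚ)],
        x ∈ order (-1) 3 ∧ x.re = 0 ∧ (x * star x).re = t ∧ moebius (rho (-1) 3 (by norm_num) (castQ (-1) 3 x)) τ = τ} ↦
      ∃ v : ℍ[ℚ,((-1 : ℤ) : ℚ),((3 : ℤ) : ℚ)], (v ∈ order (-1) 3 ∨ v - ⟨1/2, 1/2, 1/2, -1/2⟩ ∈ order (-1) 3) ∧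
        v * star v = 1 ∧ moebius (rho (-1) 3 (by norm_num) (castQ (-1) 3 v)) p.1 = q.1) (⟨moebius (rho (-1) 3 (by norm_num) (castQ (-1) 3 (⟨3, 0, 1, 1⟩ : ℍ[ℚ,((-1 : ℤ) : ℚ),((3 : ℤ) : ℚ)]))) p.1, moebius_mu_mem_specialPoints p.2.1 p.2.2⟩ : {τ : ℂ // 0 < τ.im ∧ ∃ x : ℍ[ℚ,((-1 : ℤ) : ℚ),((3 : ℤ) : ℚ)],
        x ∈ order (-1) 3 ∧ x.re = 0 ∧ (x * star x).re = t ∧ moebius (rho (-1) 3 (by norm_num) (castQ (-1) 3 x)) τ = τ}) = Quot.mk _ p) := by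
    rw [e1]
  rw [hiff, hiff] at e
  exact e

end Fibres

end Literature.Geometry.Kaehler.ComplexTorus.QuaternionType
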